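import Summits.QuantumFields.QCD.Theses.SpectralDefectExtinction
import Literature.MathematicalPhysics.QuantumLattice.WilsonPositivityDomain
import Literature.Barriers.QuantumFields.WilsonDeterminantSign
import Summits.QuantumFields.QCD.Theorems.ExtinctionBuildsQCD.Negative.IndexBudget
import Summits.QuantumFields.QCD.Theorems.ExtinctionBuildsQCD.Negative.VolumeLever
import Summits.QuantumFields.QCD.Theorems.ExtinctionBuildsQCD.Negative.CoercivityCeiling
import Summits.QuantumFields.QCD.Theorems.TipPricing.Negative.ReflectionSignedTight
import Summits.QuantumFields.QCD.Theorems.SpectralDefectExtinctionTipPricingStubCountMeasurable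

/-!
# Disproof work file — crux `WindowExtinction` (stmt-QuantumFields-18063 = SD⁺, restated 2026-08-17 from
# stmt-QuantumFields-8964; route `SpectralDefectExtinction`)

Standing crux disprover `refuter-cdisprove-stmt-QuantumFields-8964-0`, cycle 1 (2026-08-16); extended by
`refuter-cdisprove-stmt-QuantumFields-8964-g2-0`, cycle 2 (2026-08-16, §§7–9); RETYPED for the restated crux
SD⁺ and extended (§11) by `refuter-cdisprove-stmt-QuantumFields-18063-0`, cycle 3 = first cycle on stmt-18063
(2026-08-17). Everything below is `sorry`-free (axioms `propext`, `Classical.choice`, `Quot.sound`); prose only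
in docstrings.

## The crux, read back (SD⁺; the three clauses NEW on 2026-08-17 are marked ⁺)

`WindowExtinction`: for `N_f ∈ {2,3}` THERE IS `reg : QCDRegularisation N_f` (mass-scaling, asymptotically
scaling; `a_k > 0`, `a_k → 0`, `a_k L_k → ∞`, `Z_m(k) > 0` are structure fields; `m_crit : ℕ → ℝ` is FREE)
with ⁺(CAP) `∃ p : ℕ, ∀ᶠ k, L_k ≤ a_k^{−p}`, ⁺(BRANCH) `∀ᶠ k, −1 < m_crit(k)`, and `M₀ ≥ 0`, `c > 0` such that
for every mass tuple `m > M₀`: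
* (EXTINCT, verbatim as filed) `∀ ε > 0, ∀ᶠ k, ∀ S ≥ L_k`: phase-quenched `E₊` on the torus `2S+1` at `β_k` of
  `Σ_f [ #{real roots z of charpoly D_W(U,0,1) with re z < −m_f(k)} + #{roots of charpoly Γ₅D_W(U,m_f(k),1)
  with |re| < c a_k m_f/Z_k} ]` is `≤ ε ((2S+1)/(2L_k+1))⁴`, `m_f(k) = m_crit(k) + a_k m_f/Z_k`;
* ⁺(TIGHT⁺) `∃ η > 0, ∀ M > M₀, ∀ᶠ k`: `max 1 (η (a_k(2L_k+1))²) ≤ E₊ | n₋(Γ₅ D_W(U, m_crit(k) − a_k M/Z_k, 1)) −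
  6(2L_k+1)⁴ |` on the scheme torus (`n₋` = roots with negative real part; `6(2L_k+1)⁴ = n/2`,
  `card_quarkIdx_div_two`); the filed TIGHT had floor `1`.
CURRENCY for SD⁺ (landed, sibling seat): `ExtinctionBuildsQCD/Negative/WithoutTightPlusCollapse.lean` —
`TightPlus`, `SDPlusHyp`, `windowExtinction_iff_sdPlus : WindowExtinction ↔ ∀ N_f ∈ {2,3}, SDPlusHyp N_f`,
`tight_of_tightPlus`, `sdHyp_of_sdPlusHyp`. WARNING (build coherence): the root module `WithoutTightCollapse`'s
`windowExtinction_iff` / `extinctionBuildsQCD_iff` / `not_extinctionBuildsQCD_iff` are `Iff.rfl` against the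
RETIRED bodies (source-broken, served from stale oleans) — never use them; its `Extinct`/`Tight`/`SDHyp` are fine.

## Relation to LANDED negative knowledge (read this first)

The sibling crux disprover of the bridge `ExtinctionBuildsQCD` (stmt-QuantumFields-8968) has landed
`Summits/QuantumFields/QCD/Theorems/ExtinctionBuildsQCD/Negative/{WithoutTightCollapse, ChiralInertia,
TightPinsLine}.lean`: `Extinct`/`Tight`/`SDHyp` (with `windowExtinction_iff : WindowExtinction ↔ ∀ N_f ∈
{2,3}, SDHyp N_f`), the configuration-wise spectral facts, `sdWithoutTight_canonicalAF` (EXTINCT alone is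
inhabited by `canonicalAF`), chiral inertia and `negCount_hermitianWilson_eq` (`n₋ = 6L⁴` off `[−8,0]`),
`Tight.eventually_probe_mem` / `SDHyp.line_pinned` (the pin) and `tight_independent` (`shiftedAF`,
`m_crit ≡ 1`, passes EXTINCT and fails TIGHT). Sections §1–§4 below are an INDEPENDENT re-derivation of the
same facts in this crux's own vocabulary (kept here because the work file must stand alone; provers should
import the landed files). NEW in this file: §5 (spectral flow), landed separately as
`Theorems/WindowExtinction/Negative/SpectralFlowLocal.lean` (p74913, ACCEPTED, commit 65cabc038ec3) +
`SpectralFlow.lean` (p76803, ACCEPTED, commit 99673e0aea9b) on top of that toolkit — provers: import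
`Summits.QuantumFields.QCD.Theorems.WindowExtinction.Negative.SpectralFlow` for `pencil_flow`,
`negCount_sub_negCount_le_realModes`, `negCount_sub_anchor_le_realModes_below`, `window_realModes_ge`.

## Findings (theorems of this file)

1. **LOAD-BEARING = TIGHT** (§3, `extinctOnly_holds`). With TIGHT deleted the crux is INHABITED for every
   `N_f` by the tree's `canonicalAF N_f` (`m_crit ≡ 0`, the free side of the Wilson hole), `M₀ = 0`, `c = 1`:
   both defect counts vanish for EVERY gauge field, every `k`, every torus (`defectCounts_eq_zero`), because
   every eigenvalue `z` of `D_W(U,m,1)` has `‖(m+4) − z‖ ≤ 4` (§1 `norm_sub_le_four_…`, hence `Re z ≥ m`) and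
   every eigenvalue of `Γ₅ D_W(U,m,1)` is real with `|z| ≥ m` (§1 `im_eq_zero_and_mass_le_abs_re_…`).
   So no refutation can come from EXTINCT alone and any proof must use TIGHT to place `m_crit(k)`.
2. **THE PIN, made explicit** (§2, §4). The spectral index of `H_W(U, m₀) = Γ₅ D_W(U,m₀,1)` VANISHES
   IDENTICALLY off the hole: `n₋ = n/2` for every gauge field whenever `m₀ > 0` or `m₀ < −8`
   (`negCount_hermitianWilsonDirac_eq_half`; min–max lower bound `finrank_le_card_filter` applied to the two
   chirality subspaces, on which `Re v†D_W v` has a sign, `wilsonDirac_re_form_definite`). Hence the TIGHT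
   integrand is identically `0` at any `k` with `m_crit(k) − a_k M/Z_k ∉ [−8, 0]` (`tightRatio_eq_zero_of_not_mem`),
   and TIGHT forces `−8 + a_k M/Z_k ≤ m_crit(k) ≤ a_k M/Z_k` eventually, for every `M > M₀`
   (`tight_pins_mcrit`); `WindowExtinction ↔ PinnedWindowExtinction` (`windowExtinction_iff_pinned`) records
   that this pin costs nothing. The trivial witnesses `m_crit ≫ 0` and `m_crit ≪ −8` are exactly what TIGHT
   removes; INSIDE `[−8, 0]` the index is configuration dependent and nothing pathwise decides TIGHT or EXTINCT.
3. **SPECTRAL FLOW ⇒ the witness must exhibit a real-mode accumulation edge** (§5). The counting form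
   of Weyl's inequality (`card_filter_lt_neg_le`) and an induction over crossing values give, for every gauge
   field, `|n₋(Γ₅D_W(U,m₁,1)) − n₋(Γ₅D_W(U,m₂,1))| ≤ #{real eigenvalues λ of D_W(U,0,1), −λ ∈ [m₁,m₂]}`
   (`negCount_sub_negCount_le_realModes`; abstractly `pencil_flow`), hence
   `|n₋(Γ₅D_W(U,m₀,1)) − n/2| ≤ #{real λ ≤ −m₀}` for `m₀ ≤ 0` (`index_le_realModes_below`) and the WINDOW
   COUNT `#{real λ ∈ [t₁,t₂]} ≥ |index at −t₂| − #{real λ < t₁}` (`window_realModes_ge`). With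
   `t₁ = −m_crit(k) − a_k m_f/Z_k`, `t₂ = −m_crit(k) + a_k M/Z_k` (`≥ 0` eventually by finding 2) this is the
   pathwise form of TIGHT ∧ EXTINCT(a): modulo measurability of the counts, any witness has, eventually,
   `E₊[#{real modes of D_W(U,0,1) in a window of width a_k(m_f+M)/Z_k → 0 at −m_crit(k)}] ≥ 1 − ε` while
   `E₊[#{real modes below the window}] ≤ ε` — a sharp ACCUMULATION EDGE of real modes (EHN's `m₁(β)`), per
   scheme torus. This is the precise target a refutation must miss and a proof must hit; deciding it needs
   ensemble control of 4D `SU(3)` at weak coupling on tori of physical size `→ ∞` (open both ways; no theorem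
   in print, grounder g15-8).
4. **Consistency of the design with the literature** (§5): Wilson χPT (Kieburg–Verbaarschot–Zafeiropoulos 2012)
   puts the additional real modes of `D_W` within `O(a³)` (lattice units) of the critical point with Gaussian
   tails, inside every allowed window `a m_f/Z ≫ a³`; Mohler–Schaefer 2020 §4.2 see `P(det_s < 0)` fall
   `2% → 0.3% → 0.05%` for `β = 3.4 → 3.7`; EHN 1998 find first crossings `m₁(β)` slightly below `|m_c(β)|`
   (quenched, ensemble-size dependent). None of this is a theorem; the `N_f = 2` margin (`s_d > 1/(4b₀) = 4.08`
   vs thin flux sheets `≈ 3.3`) is the planner's own open flank and is not decidable pathwise.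

5. **(cycle 2) QUANTIFIER ORDER** (§7, `not_windowExtinctionUniformM`): TIGHT with `∀ᶠ k, ∀ M > M₀` instead of
   `∀ M > M₀, ∀ᶠ k` is FALSE for every regularisation (probe leaves the hole through `−8` at fixed `k`); any
   proof's threshold `k₀(M)` must grow with `M`. Landing copy `Negative/UniformTight.lean` (filed).
6. **(cycle 2) CLAUSE (b) ⊇ NEAR-EIGENVALUE DISCS** (§8, `coercivityDefect_of_near_root`): any characteristic
   root `z` of `D_W(U,0,1)`, complex included, with `‖z + m_f(k)‖ < c a_k m_f/Z_k` is a coercivity defect; over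
   `m_f > M₀` the discs sweep a cone of half-opening `arcsin c` left of the witness's edge — EXTINCT(b) keeps the
   whole massless spectrum out of it in mean (one-sided). Landing copy `Negative/CoercivityDefectNearRoot.lean`.
7. **(cycle 2) STATUS** (§9): the crux is plausibly TRUE-HOLLOW (tip family + fixed-coupling index spreading,
   `hollow_direction_status`), so no unconditional kill is expected; the landed `VolumeLever.IndexSpread` is false
   as typed (vacuous lemma); paper audit of the registered skeleton `chessboard-cold-cells`
   (`registered_skeleton_audit`): no stub killed; flanks = `TransferStmt` quantifies over all `reg` (deep-hole
   lines), `EdgeWitnessStmt` is inhabited by any admissible `reg` with `¬PQFlatLD` (hypothesis inside `∃`),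
   `ColumnPatternCost`'s cheapest all-flat mechanism is `SU(2)`-reducibility (≈ 32 nats/cube, codim 21 not 26).

8. **(cycle 2) CLAUSE (b) IS SHARP AT `c = 1`** (§10, `windowConstant_le_one`): pathwise
   `|TIGHT integrand| ≤ count_a(f) + #{|e(H_W(m_f(k)))| ≤ a_k(m_f+M)/Z_k}` ⇒ `≤ EXTINCT integrand` when
   `c > 1 + M/m_f`; hence `c ≤ 1` for every witness (UNCONDITIONALLY in the landing copy
   `Negative/WindowConstantLeOne.lean`, using the root-count measurability now in
   the tree; obtained in parallel by the sibling 8968 disprover, `CoercivityCeiling.lean`). The strengthening of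
   the crux with `∃ c > 1` is FALSE.

9. **(cycle 3, SD⁺) RETYPING.** §4 `windowExtinction_iff_tightRatio`, `PinnedWindowExtinction`,
   `windowExtinction_iff_pinned` and §7 `WindowExtinctionUniformM` are re-typed against the restated body (cap,
   branch, floor `max 1 (η (a_k(2L_k+1))²)`); all cycle-1/2 conclusions survive verbatim because TIGHT⁺ ⇒ TIGHT
   (`tightPlus_floor_one`). What the sibling seats have ALREADY landed for SD⁺ and is NOT repeated here: cap and
   branch are not junk-excluding (`WithoutTightPlusCollapse.sdPlusWithoutTight_canonicalAF`, `NearTipBand`: the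
   whole near-tip band `m_crit(k) ≥ −(1−c)a_kM₀/Z_k` has EXTINCT integrand `≡ 0`); with BRANCH the line is pinned
   into `(−1, a_kM/Z_k]`; the EXTENSIVE two-sided pin (`TwoSidedPin.lean`; floor versions drafted by the 18064 seat as
   `ExtensivePin.lean`): window / band / unitary-shell means `≥ max 1 (η(a_k(2L_k+1))²) − ε`.
10. **(cycle 3, SD⁺) THE CAP EXPONENT STARTS AT 2** (§11a, `not_cap_of_le_one`, `not_windowExtinction_capLeOne`):
   `∀ᶠ k, L_k ≤ a_k^{−p}` is impossible for `p ≤ 1` along ANY regularisation (`a_k L_k → ∞`, `a_k → 0`), so the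
   variant of SD⁺ with `∃ p ≤ 1` is FALSE and every witness has `a_k⁻¹ ≪ L_k ≤ a_k^{−p}`, `p ≥ 2`: the scheme torus
   carries between `a_k^{−4}·ω(1)` and `a_k^{−4p}` sites — the entropy factor any pricing must beat is at least
   `e^{β_k/b₀}` and at most `e^{pβ_k/b₀}` (AFBookkeeping).
11. **(cycle 3, SD⁺) THE INDEX IS EXTINCT AT AND ABOVE EVERY SEA MASS; TIGHT PROBED ABOVE THE LINE IS FALSE**
   (§11b; landing copy `Theorems/WindowExtinction/Negative/ProbeAboveLine.lean`, p138086 ACCEPTED, commit 44252414cd11 — def-free, statements with explicit integrals). Pathwise, for every probe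
   `p ≥ m_{f₀}(k)`: `|n₋(Γ₅D_W(U,p,1)) − 6(2S+1)⁴|·W ≤ (EXTINCT integrand)·W` (crossing budget + the weight-killing
   atom); hence for EXTINCT witness data, eventually in `k`, ON EVERY TORUS `S ≥ L_k` and at EVERY `p ≥ m_{f₀}(k)`,
   `E₊|index(p)| ≤ ε((2S+1)/(2L_k+1))⁴` (`extinct_eventually_indexRatioAt_le`). Consequences: (i) the variant of the
   crux whose TIGHT⁺ probes at `m_crit(k) + a_kM/Z_k` is FALSE for every witness (`not_windowExtinctionProbeAbove`:
   tuple `m ≡ M₀+1`, probe `M₀+1`, `1 ≤ E₊|index| ≤ 1/2`) — with `ReflectionSignedTight` (the `|·|`) and `UniformTight`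
   (`∀ M ∀ᶠ k`) this exhausts the cheap symmetries of the pin: only the below-the-line, modulus, pointwise-in-`M` form
   is consistent with EXTINCT; (ii) THE INDEX JUMP (`index_jump_of_windowExtinction`): an SD⁺ witness has `E₊|index| ≤ ε` at
   `m_crit(k) + a_k m_f/Z_k` and `≥ max 1 (η (a_k(2L_k+1))²)` at `m_crit(k) − a_kM/Z_k` — `≳ η√V_phys` levels of `H_W`
   cross, net, inside a window of bare width `a_k(m_f+M)/Z_k → 0` at the line, and (on larger tori) nothing net
   crosses above it at density `> ε` per scheme volume.
12. **(cycle 3, SD⁺) NEAR-MISS: near-tip lines should die by a HAAR small-ball bound, no Boltzmann factor needed**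
   (§11c: deterministic half `realMode_flat_section` PROVED — a real mode `λ ≤ δ` of `D_W(U,0,1)` is a `δ`-FLAT
   covariant section, `Re⟨v, D_W(U,0,1) v⟩ = λ Σ‖v‖² ≤ δ Σ‖v‖²`; probabilistic half recorded as the precise missing
   law in `nearTip_smallBall_programme`). TIGHT⁺ at a line with `0 ≤ −m_crit(k) ≤ δ_k − a_kM/Z_k` needs
   `E₊[#{real modes in [0, δ_k]}] ≥ η(a_k(2L_k+1))²` with `δ_k` EXPONENTIALLY small in `β_k` for the tip family; the
   flat event on a cube of side `R ≍ δ^{−1/2}` has HAAR measure `≲ e^{−(15/2)R⁴ log(1/δ) + O(R⁴)}` (codimension `5`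
   of the stabiliser `SU(2) ⊂ SU(3)` per independent link) while the DLR denominator costs at most
   `e^{−16R⁴ log β − O(R⁴) − 4.5β·O(R³)}` (small ball at the identity; boundary plaquettes bounded by `4.5` each,
   uniformly in the exterior) — for `log(1/δ) ≍ β/(4b₀) ≫ log β` the Boltzmann factor is never needed. An
   ELEMENTARY (non-Bałaban) route to "the capped tip family fails TIGHT⁺ (indeed TIGHT)"; it does NOT touch honest
   lines (`−m_crit ≍ 0.87/β`, where `δ`-flatness at `δ ≍ g₀²` is typical), and the `|det|` reweighting of `E₊` must be
   carried through the DLR bound (open). Recorded for the planner as a typed target, no claim.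

13. **(cycle 3, SD⁺) TIGHT⁺ IS ONE-SIDED** (§11d; landing copy `Negative/OneSidedTight.lean`, p138357): on every torus
   `∫ |n₋ − 6S⁴|·W ≤ 2 ∫ (6S⁴ − n₋)⁺·W` (`|q| = q + 2q⁻` and the landed reflection antisymmetry `∫ (n₋ − 6S⁴)·W ≤ 0`), so
   TIGHT⁺ ⇒ `E₊[(6(2L_k+1)⁴ − n₋)⁺] ≥ max 1 (η (a_k(2L_k+1))²)/2` eventually (`deficit_of_windowExtinction`): the modulus
   hides no cancellation budget; one tail decides.

## How provers can use this file
* `mass_le_re_of_mem_roots_charpoly_wilsonDirac`, `im_eq_zero_and_mass_le_abs_re_…`: real modes of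
  `D_W(U,0,1)` live in `Re ≥ 0`; `H_W(m)` is gapped by `|m|`-… for `m > 0` — the free-side half of every
  window estimate.
* `negCount_hermitianWilsonDirac_eq_half`: the index is `0` for `m₀ > 0` and `m₀ < −8`; combined with
  `realSpecCount` bookkeeping this is the `m₀ → ±∞` anchor of any spectral-flow argument for TIGHT.
* `finrank_le_card_filter`, `card_filter_lt_neg_le`, `pencil_flow`: reusable min–max / Weyl-counting /
  spectral-flow tools for Hermitian matrices and `Γ`-selfadjoint pencils over `ℂ` (the flow-parity lemma of
  support item `PositivityDeficitLeDefects` is the mod-2 shadow of `negCount_sub_negCount_le_realModes`).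
-/

namespace Summit.QuantumFields.QCD.Cruxes.WindowExtinction.Disproof

open Literature.MathematicalPhysics.QuantumLattice Literature.MathematicalPhysics.QuantumFieldTheory
  Literature.Probability.LatticeModels MeasureTheory Filter Matrix
open scoped Matrix.Norms.L2Operator

noncomputable section

/-- The colour group. -/
local notation "SU3" => Matrix.specialUnitaryGroup (Fin 3) ℂ

/-! ## §1 Pathwise spectral facts (pure linear algebra, every gauge field) -/

section Spectral

variable {L N : ℕ} [NeZero L] {G : Type*} [Group G] (ρ : G →* Matrix (Fin N) (Fin N) ℂ)

/-- A root of the characteristic polynomial of a complex matrix has an eigenvector. [folklore] -/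
theorem exists_eigenvector_of_mem_roots_charpoly {n : Type*} [Fintype n] [DecidableEq n]
    (A : Matrix n n ℂ) {z : ℂ} (hz : z ∈ A.charpoly.roots) :
    ∃ v : n → ℂ, v ≠ 0 ∧ A *ᵥ v = z • v := by
  have hroot : A.charpoly.IsRoot z := (Polynomial.mem_roots (A.charpoly_monic.ne_zero)).1 hz
  have hspec : z ∈ spectrum ℂ A := Matrix.mem_spectrum_iff_isRoot_charpoly.2 hroot
  rw [spectrum.mem_iff, Matrix.isUnit_iff_isUnit_det, isUnit_iff_ne_zero, not_not] at hspec
  obtain ⟨v, hv, hv0⟩ := Matrix.exists_mulVec_eq_zero_iff.2 hspec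
  refine ⟨v, hv, ?_⟩
  rw [Algebra.algebraMap_eq_smul_one, Matrix.sub_mulVec, Matrix.smul_mulVec, Matrix.one_mulVec,
    sub_eq_zero] at hv0
  exact hv0.symm

/-- `Σ_i ‖(c • v) i‖² = ‖c‖² Σ_i ‖v i‖²`. [folklore] -/
theorem sum_norm_sq_smul {n : Type*} [Fintype n] (c : ℂ) (v : n → ℂ) :
    ∑ i, ‖(c • v) i‖ ^ 2 = ‖c‖ ^ 2 * ∑ i, ‖v i‖ ^ 2 := by
  rw [Finset.mul_sum]
  refine Finset.sum_congr rfl fun i _ => ?_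
  rw [Pi.smul_apply, smul_eq_mul, norm_mul, mul_pow]

/-- A non-zero vector has positive `ℓ²` mass. [folklore] -/
theorem sum_norm_sq_pos {n : Type*} [Fintype n] {v : n → ℂ} (hv : v ≠ 0) :
    0 < ∑ i, ‖v i‖ ^ 2 := by
  obtain ⟨i, hi⟩ : ∃ i, v i ≠ 0 := Function.ne_iff.mp hv
  exact Finset.sum_pos' (fun j _ => by positivity) ⟨i, Finset.mem_univ _, by positivity⟩

/-- The hopping term is bounded by `4` in quadratic-form language:
`Σ_i ‖(K v) i‖² ≤ 16 Σ_i ‖v i‖²`, `K = Σ_μ W_μ`. [folklore] -/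
theorem sum_norm_sq_hop_mulVec_le (hρ : ∀ g, ρ g ∈ Matrix.unitaryGroup (Fin N) ℂ)
    (U : GaugeConfig 4 L G) (v : TorusSite 4 L × Fin N × Fin 4 → ℂ) :
    ∑ i, ‖((∑ μ, wilsonHop ρ U μ) *ᵥ v) i‖ ^ 2 ≤ 16 * ∑ i, ‖v i‖ ^ 2 := by
  refine (sum_norm_sq_mulVec_le _ v).trans ?_
  have h4 := l2_opNorm_sum_wilsonHop_le ρ hρ U
  have h0 : 0 ≤ ∑ i, ‖v i‖ ^ 2 := Finset.sum_nonneg fun i _ => by positivity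
  have h16 : ‖∑ μ, wilsonHop ρ U μ‖ ^ 2 ≤ 16 := by
    nlinarith [norm_nonneg (∑ μ, wilsonHop ρ U μ)]
  exact mul_le_mul_of_nonneg_right h16 h0

/-- **Disc bound (Wilson hole, outer form).** Every eigenvalue `z` of `D_W(U, m, 1)` (root of the
characteristic polynomial, any gauge field, unitary colour representation) satisfies
`‖(m + 4) − z‖ ≤ 4`: the spectrum lies in the disc of radius `4` about `m + 4`
(`D_W = (m+4)·1 − K`, `‖K‖ ≤ 4`). [folklore] -/
theorem norm_sub_le_four_of_mem_roots_charpoly_wilsonDirac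
    (hρ : ∀ g, ρ g ∈ Matrix.unitaryGroup (Fin N) ℂ) (U : GaugeConfig 4 L G) (m : ℝ) {z : ℂ}
    (hz : z ∈ (wilsonDirac ρ U m 1).charpoly.roots) : ‖((m + 4 : ℝ) : ℂ) - z‖ ≤ 4 := by
  obtain ⟨v, hv, hDv⟩ := exists_eigenvector_of_mem_roots_charpoly _ hz
  rw [wilsonDirac_eq_sub_sum_wilsonHop ρ hρ U m, Matrix.sub_mulVec, Matrix.smul_mulVec,
    Matrix.one_mulVec] at hDv
  have hK : (∑ μ, wilsonHop ρ U μ) *ᵥ v = (((m + 4 : ℝ) : ℂ) - z) • v := by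
    rw [sub_smul, ← hDv, sub_sub_cancel]
  have hle := sum_norm_sq_hop_mulVec_le ρ hρ U v
  rw [hK, sum_norm_sq_smul] at hle
  have hpos := sum_norm_sq_pos hv
  have hsq : ‖((m + 4 : ℝ) : ℂ) - z‖ ^ 2 ≤ 16 := le_of_mul_le_mul_right hle hpos
  nlinarith [norm_nonneg (((m + 4 : ℝ) : ℂ) - z)]

/-- **Real parts are bounded below by the bare mass**: every eigenvalue `z` of `D_W(U, m, 1)` has
`m ≤ Re z` (the Hermitian part of `D_W` is `m + ½ Σ_μ ∇_μ†∇_μ ≥ m`). In particular the massless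
operator `D_W(U, 0, 1)` has NO eigenvalue, real or not, with negative real part. [folklore] -/
theorem mass_le_re_of_mem_roots_charpoly_wilsonDirac
    (hρ : ∀ g, ρ g ∈ Matrix.unitaryGroup (Fin N) ℂ) (U : GaugeConfig 4 L G) (m : ℝ) {z : ℂ}
    (hz : z ∈ (wilsonDirac ρ U m 1).charpoly.roots) : m ≤ z.re := by
  have h := norm_sub_le_four_of_mem_roots_charpoly_wilsonDirac ρ hρ U m hz
  have hre := Complex.abs_re_le_norm (((m + 4 : ℝ) : ℂ) - z)
  have hre' : (((m + 4 : ℝ) : ℂ) - z).re = m + 4 - z.re := by simp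
  rw [hre'] at hre
  have := (abs_le.mp (hre.trans h)).2
  linarith

/-- `Γ₅ = spinorLift gammaFive` acts diagonally by the signs `ε = (1, 1, −1, −1)` on the spin index. [folklore] -/
theorem spinorLift_gammaFive_mulVec_apply (v : TorusSite 4 L × Fin N × Fin 4 → ℂ)
    (p : TorusSite 4 L × Fin N × Fin 4) :
    ((spinorLift gammaFive : Matrix _ _ ℂ) *ᵥ v) p = (![1, 1, -1, -1] : Fin 4 → ℂ) p.2.2 * v p := by
  rw [spinorLift_gammaFive_eq_diagonal, Matrix.mulVec_diagonal]

/-- The chirality signs have modulus one. [folklore] -/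
theorem norm_gammaFiveSign (s : Fin 4) : ‖(![1, 1, -1, -1] : Fin 4 → ℂ) s‖ = 1 := by
  fin_cases s <;> simp

/-- The chirality signs are real. [folklore] -/
theorem gammaFiveSign_eq_ofReal (s : Fin 4) :
    ∃ e : ℝ, (e = 1 ∨ e = -1) ∧ (![1, 1, -1, -1] : Fin 4 → ℂ) s = (e : ℂ) := by
  fin_cases s
  · exact ⟨1, Or.inl rfl, by simp⟩
  · exact ⟨1, Or.inl rfl, by simp⟩
  · exact ⟨-1, Or.inr rfl, by simp⟩
  · exact ⟨-1, Or.inr rfl, by simp⟩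

/-- **Coercivity outside the hole.** Every eigenvalue `z` of the Hermitian Wilson–Dirac operator
`H_W(m) = Γ₅ D_W(U, m, 1)` is real and satisfies `m ≤ |z|` (for `m > 0`: `σ_min(D_W + m) ≥ m`,
no eigenvalue of `H_W(m)` in `(−m, m)`; vacuous for `m ≤ 0`). Proof: for an eigenvector `v`,
`K v = (m+4) v − z Γ₅ v` componentwise, `|m + 4 − z ε_p| ≥ m + 4 − |z|`, and `‖K v‖ ≤ 4 ‖v‖`. [folklore] -/
theorem im_eq_zero_and_mass_le_abs_re_of_mem_roots_charpoly_hermitianWilsonDirac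
    (hρ : ∀ g, ρ g ∈ Matrix.unitaryGroup (Fin N) ℂ) (U : GaugeConfig 4 L G) (m : ℝ) {z : ℂ}
    (hz : z ∈ (spinorLift gammaFive * wilsonDirac ρ U m 1).charpoly.roots) :
    z.im = 0 ∧ m ≤ |z.re| := by
  have hH : (spinorLift gammaFive * wilsonDirac ρ U m 1).IsHermitian :=
    Literature.Barriers.QuantumFields.WilsonDeterminant.isHermitian_hermitianWilsonDirac ρ hρ U m 1
  have hz' := hz
  rw [hH.roots_charpoly_eq_eigenvalues] at hz'
  obtain ⟨i, -, rfl⟩ := Multiset.mem_map.1 hz'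
  have hzi : (RCLike.ofReal ∘ hH.eigenvalues) i = ((hH.eigenvalues i : ℝ) : ℂ) := rfl
  rw [hzi, Complex.ofReal_im, Complex.ofReal_re]
  refine ⟨rfl, ?_⟩
  set ev : ℝ := hH.eigenvalues i with hev
  -- the eigenvector
  set v : TorusSite 4 L × Fin N × Fin 4 → ℂ := ⇑(hH.eigenvectorBasis i) with hvdef
  have hHv : (spinorLift gammaFive * wilsonDirac ρ U m 1) *ᵥ v = (ev : ℂ) • v := by
    have := hH.mulVec_eigenvectorBasis i
    rw [RCLike.real_smul_eq_coe_smul (K := ℂ)] at this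
    exact this
  have hv0 : v ≠ 0 := by
    intro h0
    exact hH.eigenvectorBasis.orthonormal.ne_zero i ((WithLp.ofLp_eq_zero 2).1 h0)
  -- D v = ev • Γ₅ v
  have hDv : wilsonDirac ρ U m 1 *ᵥ v = (ev : ℂ) • ((spinorLift gammaFive : Matrix _ _ ℂ) *ᵥ v) := by
    have h2 := congrArg (fun w => (spinorLift gammaFive : Matrix _ _ ℂ) *ᵥ w) hHv
    simp only [Matrix.mulVec_mulVec, ← Matrix.mul_assoc, spinorLift_gammaFive_mul_self, Matrix.one_mul,
      Matrix.mulVec_smul] at h2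
    exact h2
  -- K v = (m+4) v − ev Γ₅ v
  rw [wilsonDirac_eq_sub_sum_wilsonHop ρ hρ U m, Matrix.sub_mulVec, Matrix.smul_mulVec,
    Matrix.one_mulVec] at hDv
  have hK : (∑ μ, wilsonHop ρ U μ) *ᵥ v =
      ((m + 4 : ℝ) : ℂ) • v - (ev : ℂ) • ((spinorLift gammaFive : Matrix _ _ ℂ) *ᵥ v) := by
    rw [← hDv, sub_sub_cancel]
  have hle := sum_norm_sq_hop_mulVec_le ρ hρ U v
  rw [hK] at hle
  -- componentwise lower bound
  by_contra hlt
  rw [not_le] at hlt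
  have hgap : 4 < m + 4 - |ev| := by linarith
  have hcomp : ∀ p, (m + 4 - |ev|) ^ 2 * ‖v p‖ ^ 2 ≤
      ‖(((m + 4 : ℝ) : ℂ) • v - (ev : ℂ) • ((spinorLift gammaFive : Matrix _ _ ℂ) *ᵥ v)) p‖ ^ 2 := by
    intro p
    obtain ⟨e, he, hep⟩ := gammaFiveSign_eq_ofReal p.2.2
    have hcoef : (((m + 4 : ℝ) : ℂ) • v - (ev : ℂ) • ((spinorLift gammaFive : Matrix _ _ ℂ) *ᵥ v)) p =
        ((m + 4 - ev * e : ℝ) : ℂ) * v p := by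
      simp only [Pi.sub_apply, Pi.smul_apply, smul_eq_mul, spinorLift_gammaFive_mulVec_apply, hep]
      push_cast
      ring
    rw [hcoef, norm_mul, mul_pow, Complex.norm_real, Real.norm_eq_abs]
    have habs : m + 4 - |ev| ≤ |m + 4 - ev * e| := by
      rcases he with rfl | rfl
      · rw [mul_one]
        calc m + 4 - |ev| ≤ m + 4 - ev := by linarith [le_abs_self ev]
          _ ≤ |m + 4 - ev| := le_abs_self _
      · rw [mul_neg, mul_one, sub_neg_eq_add]
        calc m + 4 - |ev| ≤ m + 4 + ev := by linarith [neg_abs_le ev]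
          _ ≤ |m + 4 + ev| := le_abs_self _
    have h0 : 0 ≤ m + 4 - |ev| := by linarith
    have hsq : (m + 4 - |ev|) ^ 2 ≤ |m + 4 - ev * e| ^ 2 := by
      exact pow_le_pow_left₀ h0 habs 2
    exact mul_le_mul_of_nonneg_right hsq (by positivity)
  have hsum : (m + 4 - |ev|) ^ 2 * ∑ p, ‖v p‖ ^ 2 ≤
      ∑ p, ‖(((m + 4 : ℝ) : ℂ) • v - (ev : ℂ) • ((spinorLift gammaFive : Matrix _ _ ℂ) *ᵥ v)) p‖ ^ 2 := by
    rw [Finset.mul_sum]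
    exact Finset.sum_le_sum fun p _ => hcomp p
  have hpos := sum_norm_sq_pos hv0
  have h16 : (m + 4 - |ev|) ^ 2 ≤ 16 := le_of_mul_le_mul_right (hsum.trans hle) hpos
  nlinarith

end Spectral

/-! ## §2 Inertia: a min–max lower bound and the index of `Γ₅ D_W` off the hole -/

section Abstract
variable {n : Type*} [Fintype n]

/-- Cauchy–Schwarz in sum form: `Re (v† w) ≤ Σ ‖vᵢ‖ ‖wᵢ‖`. [folklore] -/
theorem re_star_dotProduct_le (v w : n → ℂ) :
    (star v ⬝ᵥ w).re ≤ ∑ i, ‖v i‖ * ‖w i‖ := by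
  rw [dotProduct, Complex.re_sum]
  refine Finset.sum_le_sum fun i _ => ?_
  calc (star v i * w i).re ≤ ‖star v i * w i‖ := Complex.re_le_norm _
    _ = ‖v i‖ * ‖w i‖ := by rw [norm_mul, Pi.star_apply, norm_star]

/-- If `Σ ‖wᵢ‖² ≤ C² Σ ‖vᵢ‖²` (`C ≥ 0`) then `Re (v† w) ≤ C Σ ‖vᵢ‖²`. [folklore] -/
theorem re_star_dotProduct_le_of_sq_le (v w : n → ℂ) {C : ℝ} (hC : 0 ≤ C)
    (h : ∑ i, ‖w i‖ ^ 2 ≤ C ^ 2 * ∑ i, ‖v i‖ ^ 2) :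
    (star v ⬝ᵥ w).re ≤ C * ∑ i, ‖v i‖ ^ 2 := by
  refine (re_star_dotProduct_le v w).trans ?_
  have hcs := Finset.sum_mul_sq_le_sq_mul_sq Finset.univ (fun i => ‖v i‖) (fun i => ‖w i‖)
  have hS : 0 ≤ ∑ i, ‖v i‖ ^ 2 := Finset.sum_nonneg fun i _ => by positivity
  have h2 : (∑ i, ‖v i‖ * ‖w i‖) ^ 2 ≤ (C * ∑ i, ‖v i‖ ^ 2) ^ 2 := by
    calc (∑ i, ‖v i‖ * ‖w i‖) ^ 2 ≤ (∑ i, ‖v i‖ ^ 2) * ∑ i, ‖w i‖ ^ 2 := hcs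
      _ ≤ (∑ i, ‖v i‖ ^ 2) * (C ^ 2 * ∑ i, ‖v i‖ ^ 2) := mul_le_mul_of_nonneg_left h hS
      _ = (C * ∑ i, ‖v i‖ ^ 2) ^ 2 := by ring
  have hnn : 0 ≤ C * ∑ i, ‖v i‖ ^ 2 := mul_nonneg hC hS
  exact (pow_le_pow_iff_left₀ (Finset.sum_nonneg fun i _ => by positivity) hnn two_ne_zero).1 h2

variable [DecidableEq n]

/-- **Quadratic form in the eigenbasis.** For a Hermitian matrix `A = U D U†` (`U` the unitary of
eigenvectors): `Re (v† A v) = Σ_j λ_j ‖(U† v)_j‖²`. [folklore] -/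
theorem re_star_dotProduct_mulVec_eq {A : Matrix n n ℂ} (hA : A.IsHermitian) (v : n → ℂ) :
    (star v ⬝ᵥ A *ᵥ v).re =
      ∑ j, hA.eigenvalues j * ‖((star (hA.eigenvectorUnitary : Matrix n n ℂ)) *ᵥ v) j‖ ^ 2 := by
  set U : Matrix n n ℂ := (hA.eigenvectorUnitary : Matrix n n ℂ) with hU
  set w : n → ℂ := (star U) *ᵥ v with hw
  have hA' : A = U * diagonal (RCLike.ofReal ∘ hA.eigenvalues) * star U := by
    conv_lhs => rw [hA.spectral_theorem, Unitary.conjStarAlgAut_apply]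
  have h1 : A *ᵥ v = U *ᵥ (diagonal (RCLike.ofReal ∘ hA.eigenvalues) *ᵥ w) := by
    conv_lhs => rw [hA']
    rw [← mulVec_mulVec, ← mulVec_mulVec]
  have h2 : star v ⬝ᵥ (U *ᵥ (diagonal (RCLike.ofReal ∘ hA.eigenvalues) *ᵥ w)) =
      star w ⬝ᵥ (diagonal (RCLike.ofReal ∘ hA.eigenvalues) *ᵥ w) := by
    rw [dotProduct_mulVec, hw, star_mulVec, star_eq_conjTranspose, conjTranspose_conjTranspose]
  rw [h1, h2, dotProduct, Complex.re_sum]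
  refine Finset.sum_congr rfl fun j _ => ?_
  rw [mulVec_diagonal, Pi.star_apply, Function.comp_apply]
  have : star (w j) * ((RCLike.ofReal (hA.eigenvalues j) : ℂ) * w j) =
      ((hA.eigenvalues j * ‖w j‖ ^ 2 : ℝ) : ℂ) := by
    rw [RCLike.ofReal_eq_complex_ofReal]  -- no-op if already Complex.ofReal
    have hc : star (w j) * w j = ((‖w j‖ ^ 2 : ℝ) : ℂ) := by
      rw [Complex.star_def, Complex.conj_mul']; push_cast; ring
    calc star (w j) * ((hA.eigenvalues j : ℂ) * w j) = (hA.eigenvalues j : ℂ) * (star (w j) * w j) := by ring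
      _ = ((hA.eigenvalues j * ‖w j‖ ^ 2 : ℝ) : ℂ) := by rw [hc]; push_cast; ring
  rw [this, Complex.ofReal_re]

/-- **Min–max, lower half (inertia bound).** Let `A` be Hermitian and `σ = ±1`. If the Hermitian
form `σ · Re (v† A v)` is negative on a subspace `W` (off `0`), then `A` has at least `dim W`
eigenvalues `λ` with `σ λ < 0`. [folklore] -/
theorem finrank_le_card_filter {A : Matrix n n ℂ} (hA : A.IsHermitian) (σ : ℝ)
    (W : Submodule ℂ (n → ℂ)) (hW : ∀ v ∈ W, v ≠ 0 → σ * (star v ⬝ᵥ A *ᵥ v).re < 0) :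
    Module.finrank ℂ W ≤ (Finset.univ.filter fun i => σ * hA.eigenvalues i < 0).card := by
  by_contra hlt
  rw [not_le] at hlt
  set U : Matrix n n ℂ := (hA.eigenvectorUnitary : Matrix n n ℂ) with hU
  -- coordinates in the "bad" eigendirections
  let Neg := {i // σ * hA.eigenvalues i < 0}
  let Φ : W →ₗ[ℂ] (Neg → ℂ) :=
    (LinearMap.pi fun j : Neg => LinearMap.proj (R := ℂ) (φ := fun _ : n => ℂ) j.1) ∘ₗ
      (star U).mulVecLin ∘ₗ W.subtype
  have hdim : Module.finrank ℂ (Neg → ℂ) < Module.finrank ℂ W := by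
    rw [Module.finrank_fintype_fun_eq_card, Fintype.card_subtype]
    exact hlt
  obtain ⟨⟨v, hvW⟩, hvker, hv0⟩ :=
    Submodule.exists_mem_ne_zero_of_ne_bot (LinearMap.ker_ne_bot_of_finrank_lt (f := Φ) hdim)
  have hv0' : v ≠ 0 := fun h => hv0 (by simp [h])
  have hcoord : ∀ j, σ * hA.eigenvalues j < 0 → ((star U) *ᵥ v) j = 0 := by
    intro j hj
    have := congrFun (LinearMap.mem_ker.1 hvker) ⟨j, hj⟩
    simpa [Φ] using this
  have hq := re_star_dotProduct_mulVec_eq hA v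
  have hnonneg : 0 ≤ σ * (star v ⬝ᵥ A *ᵥ v).re := by
    rw [hq, Finset.mul_sum]
    refine Finset.sum_nonneg fun j _ => ?_
    by_cases hj : σ * hA.eigenvalues j < 0
    · rw [hcoord j hj]; simp
    · rw [not_lt] at hj
      have : σ * (hA.eigenvalues j * ‖(star U *ᵥ v) j‖ ^ 2) = (σ * hA.eigenvalues j) * ‖(star U *ᵥ v) j‖ ^ 2 := by ring
      rw [this]
      exact mul_nonneg hj (by positivity)
  exact absurd (hW v hvW hv0') (not_lt.2 hnonneg)

end Abstract

section Chiral

open Literature.MathematicalPhysics.QuantumLattice Literature.MathematicalPhysics.QuantumFieldTheory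
  Literature.Probability.LatticeModels
open scoped Matrix.Norms.L2Operator

variable {L N : ℕ} [NeZero L]

/-- **Chirality subspaces.** For a set `S` of spin components there is a subspace of quark-index
vectors supported on spins in `S`, of dimension `#sites · N · #S` (the range of extension by zero). [folklore] -/
theorem exists_spinSupported (L N : ℕ) [NeZero L] (S : Finset (Fin 4)) :
    ∃ W : Submodule ℂ (TorusSite 4 L × Fin N × Fin 4 → ℂ),
      Module.finrank ℂ W = Fintype.card (TorusSite 4 L) * (N * S.card) ∧
        ∀ v ∈ W, ∀ p, p.2.2 ∉ S → v p = 0 := by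
  let ι : ({p : TorusSite 4 L × Fin N × Fin 4 // p.2.2 ∈ S} → ℂ) →ₗ[ℂ]
      (TorusSite 4 L × Fin N × Fin 4 → ℂ) :=
    LinearMap.pi fun p => if h : p.2.2 ∈ S then LinearMap.proj ⟨p, h⟩ else 0
  have hιapply : ∀ c p, ι c p = if h : p.2.2 ∈ S then c ⟨p, h⟩ else 0 := by
    intro c p
    simp only [ι, LinearMap.pi_apply]
    split_ifs <;> simp
  have hinj : Function.Injective ι := by
    intro c c' h
    funext ⟨p, hp⟩
    have := congrFun h p
    rw [hιapply, hιapply, dif_pos hp, dif_pos hp] at this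
    exact this
  refine ⟨LinearMap.range ι, ?_, ?_⟩
  · rw [LinearMap.finrank_range_of_inj hinj, Module.finrank_fintype_fun_eq_card, Fintype.card_subtype]
    have : (Finset.univ.filter fun p : TorusSite 4 L × Fin N × Fin 4 => p.2.2 ∈ S) =
        Finset.univ ×ˢ (Finset.univ ×ˢ S) := by
      ext p
      simp
    rw [this, Finset.card_product, Finset.card_product, Finset.card_univ, Finset.card_univ,
      Fintype.card_fin]
  · rintro v ⟨c, rfl⟩ p hp
    rw [hιapply, dif_neg hp]

theorem card_idx :
    Fintype.card (TorusSite 4 L × Fin N × Fin 4) = Fintype.card (TorusSite 4 L) * (N * 4) := by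
  simp [Fintype.card_prod]

/-- `Γ₅ v = -v` on the lower chirality subspace (spins `2, 3`). [folklore] -/
theorem gammaFive_mulVec_of_lower {v : TorusSite 4 L × Fin N × Fin 4 → ℂ}
    (hv : ∀ p, p.2.2 ∉ ({2, 3} : Finset (Fin 4)) → v p = 0) :
    (spinorLift gammaFive : Matrix _ _ ℂ) *ᵥ v = -v := by
  ext p
  rw [spinorLift_gammaFive_eq_diagonal, mulVec_diagonal, Pi.neg_apply]
  have hp := hv p
  obtain ⟨x, a, s⟩ := p
  fin_cases s
  · simp at hp; simp [hp]
  · simp at hp; simp [hp]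
  · simp
  · simp

/-- `Γ₅ v = v` on the upper chirality subspace (spins `0, 1`). [folklore] -/
theorem gammaFive_mulVec_of_upper {v : TorusSite 4 L × Fin N × Fin 4 → ℂ}
    (hv : ∀ p, p.2.2 ∉ ({0, 1} : Finset (Fin 4)) → v p = 0) :
    (spinorLift gammaFive : Matrix _ _ ℂ) *ᵥ v = v := by
  ext p
  rw [spinorLift_gammaFive_eq_diagonal, mulVec_diagonal]
  have hp := hv p
  obtain ⟨x, a, s⟩ := p
  fin_cases s
  · simp
  · simp
  · simp at hp; simp [hp]
  · simp at hp; simp [hp]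

/-- `v† (Γ₅ D) v = (Γ₅ v)† D v` (`Γ₅` Hermitian). [folklore] -/
theorem star_dotProduct_gammaFive_mul_mulVec (D : Matrix (TorusSite 4 L × Fin N × Fin 4)
    (TorusSite 4 L × Fin N × Fin 4) ℂ) (v : TorusSite 4 L × Fin N × Fin 4 → ℂ) :
    star v ⬝ᵥ (spinorLift gammaFive * D) *ᵥ v =
      star ((spinorLift gammaFive : Matrix _ _ ℂ) *ᵥ v) ⬝ᵥ D *ᵥ v := by
  rw [← mulVec_mulVec, dotProduct_mulVec, star_mulVec,
    Literature.Barriers.QuantumFields.WilsonDeterminant.conjTranspose_spinorLift_gammaFive]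

/-- **The index of `Γ₅ D` vanishes when the Hermitian part of `D` is definite.** If `H = Γ₅ D`
is Hermitian and `τ Re (v† D v) > 0` for all `v ≠ 0` (`τ = ±1`), then exactly half of the
eigenvalues of `H` are negative and half positive: `n₋ = n₊ = n/2` (inertia additivity across the
two chirality subspaces, each of dimension `n/2`). [folklore] -/
theorem card_neg_eigenvalues_eq_half {D : Matrix (TorusSite 4 L × Fin N × Fin 4)
    (TorusSite 4 L × Fin N × Fin 4) ℂ} (hH : (spinorLift gammaFive * D).IsHermitian) {τ : ℝ}
    (hτ : τ = 1 ∨ τ = -1) (hD : ∀ v : TorusSite 4 L × Fin N × Fin 4 → ℂ, v ≠ 0 →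
      0 < τ * (star v ⬝ᵥ D *ᵥ v).re) :
    (Finset.univ.filter fun i => hH.eigenvalues i < 0).card =
      Fintype.card (TorusSite 4 L × Fin N × Fin 4) / 2 := by
  set half := Fintype.card (TorusSite 4 L) * (N * 2) with hhalf
  have hcard : Fintype.card (TorusSite 4 L × Fin N × Fin 4) = 2 * half := by
    rw [card_idx, hhalf]; ring
  have hlow : half ≤ (Finset.univ.filter fun i => τ * hH.eigenvalues i < 0).card := by
    obtain ⟨W, hW, hWmem⟩ := exists_spinSupported L N ({2, 3} : Finset (Fin 4))
    have h1 := finrank_le_card_filter hH τ W (by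
      intro v hv hv0
      rw [star_dotProduct_gammaFive_mul_mulVec, gammaFive_mulVec_of_lower (hWmem v hv), star_neg,
        neg_dotProduct, Complex.neg_re]
      have := hD v hv0
      nlinarith)
    rwa [hW, show ({2, 3} : Finset (Fin 4)).card = 2 from rfl] at h1
  have hupp : half ≤ (Finset.univ.filter fun i => -τ * hH.eigenvalues i < 0).card := by
    obtain ⟨W, hW, hWmem⟩ := exists_spinSupported L N ({0, 1} : Finset (Fin 4))
    have h1 := finrank_le_card_filter hH (-τ) W (by
      intro v hv hv0
      rw [star_dotProduct_gammaFive_mul_mulVec, gammaFive_mulVec_of_upper (hWmem v hv)]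
      have := hD v hv0
      nlinarith)
    rwa [hW, show ({0, 1} : Finset (Fin 4)).card = 2 from rfl] at h1
  have hdisj : Disjoint (Finset.univ.filter fun i => τ * hH.eigenvalues i < 0)
      (Finset.univ.filter fun i => -τ * hH.eigenvalues i < 0) := by
    rw [Finset.disjoint_filter]
    intro i _ h1 h2
    nlinarith
  have hsum : (Finset.univ.filter fun i => τ * hH.eigenvalues i < 0).card +
      (Finset.univ.filter fun i => -τ * hH.eigenvalues i < 0).card ≤ 2 * half := by
    rw [← Finset.card_union_of_disjoint hdisj, ← hcard]
    exact Finset.card_le_univ _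
  have hτcard : (Finset.univ.filter fun i => τ * hH.eigenvalues i < 0).card = half := by omega
  have hτ'card : (Finset.univ.filter fun i => -τ * hH.eigenvalues i < 0).card = half := by omega
  rw [hcard, Nat.mul_div_cancel_left _ two_pos]
  rcases hτ with rfl | rfl
  · rw [← hτcard]
    congr 1
    exact Finset.filter_congr fun i _ => by simp
  · rw [← hτ'card]
    congr 1
    exact Finset.filter_congr fun i _ => by simp

/-- `v† v = Σ ‖v_p‖²` (as a complex number). [folklore] -/
theorem star_dotProduct_self_eq {n : Type*} [Fintype n] (v : n → ℂ) :
    star v ⬝ᵥ v = ((∑ i, ‖v i‖ ^ 2 : ℝ) : ℂ) := by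
  rw [dotProduct]
  push_cast
  refine Finset.sum_congr rfl fun i _ => ?_
  rw [Pi.star_apply, Complex.star_def, Complex.conj_mul']

/-- **Definiteness of the Hermitian part of the Wilson operator off the hole.** For `m > 0`:
`Re (v† D_W(U,m,1) v) ≥ m Σ‖v‖² > 0`; for `m < -8`: `Re (v† D_W v) ≤ (m + 8) Σ‖v‖² < 0`. [folklore] -/
theorem wilsonDirac_re_form_definite {G : Type*} [Group G] (ρ : G →* Matrix (Fin N) (Fin N) ℂ)
    (hρ : ∀ g, ρ g ∈ Matrix.unitaryGroup (Fin N) ℂ) (U : GaugeConfig 4 L G) {m : ℝ}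
    (hm : 0 < m ∨ m < -8) (v : TorusSite 4 L × Fin N × Fin 4 → ℂ) (hv : v ≠ 0) :
    0 < (if 0 < m then (1 : ℝ) else -1) * (star v ⬝ᵥ wilsonDirac ρ U m 1 *ᵥ v).re := by
  set K := ∑ μ, wilsonHop ρ U μ with hK
  have hS := sum_norm_sq_pos hv
  have hKv : ∑ i, ‖(K *ᵥ v) i‖ ^ 2 ≤ 4 ^ 2 * ∑ i, ‖v i‖ ^ 2 := by
    have := sum_norm_sq_hop_mulVec_le ρ hρ U v
    norm_num
    exact this
  have hre : (star v ⬝ᵥ wilsonDirac ρ U m 1 *ᵥ v).re =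
      (m + 4) * ∑ i, ‖v i‖ ^ 2 - (star v ⬝ᵥ K *ᵥ v).re := by
    rw [wilsonDirac_eq_sub_sum_wilsonHop ρ hρ U m, sub_mulVec, smul_mulVec, one_mulVec,
      dotProduct_sub, dotProduct_smul, star_dotProduct_self_eq, Complex.sub_re, smul_eq_mul,
      ← Complex.ofReal_mul, Complex.ofReal_re]
  have hup : (star v ⬝ᵥ K *ᵥ v).re ≤ 4 * ∑ i, ‖v i‖ ^ 2 :=
    re_star_dotProduct_le_of_sq_le v (K *ᵥ v) (by norm_num) hKv
  have hdown : -(4 * ∑ i, ‖v i‖ ^ 2) ≤ (star v ⬝ᵥ K *ᵥ v).re := by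
    have h := re_star_dotProduct_le_of_sq_le v (-(K *ᵥ v)) (by norm_num : (0 : ℝ) ≤ 4)
      (by simpa [Pi.neg_apply, norm_neg] using hKv)
    rw [dotProduct_neg, Complex.neg_re] at h
    linarith
  rcases hm with hm | hm
  · rw [if_pos hm, one_mul, hre]
    nlinarith
  · rw [if_neg (by linarith), hre]
    nlinarith

end Chiral

section Pin

open Literature.MathematicalPhysics.QuantumLattice Literature.MathematicalPhysics.QuantumFieldTheory
  Literature.Probability.LatticeModels MeasureTheory Filter
open scoped Matrix.Norms.L2Operator

variable {L N : ℕ} [NeZero L]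

/-- `#(torus sites) = L⁴`. [folklore] -/
theorem card_torusSite : Fintype.card (TorusSite 4 L) = L ^ 4 := by
  simp [TorusSite, ZMod.card]

/-- **The spectral index of `H_W(U, m, 1) = Γ₅ D_W` vanishes off `[-8, 0]`**: for bare mass
`m > 0` or `m < -8`, exactly half of the (real) eigenvalues of `Γ₅ D_W(U, m, 1)` are negative,
`n₋ = n/2`, for EVERY gauge field (no level of `H_W` can cross zero outside the Wilson hole:
`Re D_W ≥ m > 0`, resp. `≤ m + 8 < 0`, and inertia is additive over the chirality split). [folklore] -/
theorem negCount_hermitianWilsonDirac_eq_half {G : Type*} [Group G]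
    (ρ : G →* Matrix (Fin N) (Fin N) ℂ) (hρ : ∀ g, ρ g ∈ Matrix.unitaryGroup (Fin N) ℂ)
    (U : GaugeConfig 4 L G) {m : ℝ} (hm : 0 < m ∨ m < -8) :
    (spinorLift gammaFive * wilsonDirac ρ U m 1).charpoly.roots.countP (fun z : ℂ => z.re < 0) =
      Fintype.card (TorusSite 4 L × Fin N × Fin 4) / 2 := by
  have hH : (spinorLift gammaFive * wilsonDirac ρ U m 1).IsHermitian :=
    Literature.Barriers.QuantumFields.WilsonDeterminant.isHermitian_hermitianWilsonDirac ρ hρ U m 1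
  rw [hH.roots_charpoly_eq_eigenvalues, Multiset.countP_map]
  have hτ : (if 0 < m then (1 : ℝ) else -1) = 1 ∨ (if 0 < m then (1 : ℝ) else -1) = -1 := by
    split_ifs <;> simp
  rw [← card_neg_eigenvalues_eq_half hH hτ (fun v hv => wilsonDirac_re_form_definite ρ hρ U hm v hv),
    Finset.card_def, Finset.filter_val]
  congr 1

/-- For `SU(3)` on the torus of side `S'`: `n/2 = 6 S'⁴`. [folklore] -/
theorem card_quarkIdx_div_two (S' : ℕ) [NeZero S'] :
    Fintype.card (TorusSite 4 S' × Fin 3 × Fin 4) / 2 = 6 * S' ^ 4 := by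
  rw [card_idx, card_torusSite]
  omega


end Pin

/-! ## §3 LOAD-BEARING: without TIGHT the crux is vacuous (inhabited by the tree's `canonicalAF`) -/

/-- `WindowExtinction` with the TIGHT conjunct deleted (verbatim EXTINCT clause). -/
def ExtinctOnly : Prop :=
open Literature.MathematicalPhysics.QuantumLattice Literature.MathematicalPhysics.QuantumFieldTheory Literature.Probability.LatticeModels in ∀ Nf : ℕ, (Nf = 2 ∨ Nf = 3) → ∃ reg : QCDRegularisation Nf, reg.HasMassScaling ∧ (reg.scheme 0 0 0).HasAsymptoticScaling ∧ ∃ M₀ : ℝ, 0 ≤ M₀ ∧ ∃ c : ℝ, 0 < c ∧ ∀ m : Fin Nf → ℝ, (∀ f, M₀ < m f) → (∀ ε : ℝ, 0 < ε → ∀ᶠ k : ℕ in Filter.atTop, ∀ S : ℕ, reg.L k ≤ S → (∫ U, ((∑ f : Fin Nf, ((Multiset.countP (fun z : ℂ => z.im = 0 ∧ z.re < -(reg.mcrit k + reg.a k * m f / reg.Zm k)) (wilsonDirac (fundamentalRep (Fin 3)) U 0 1).charpoly.roots : ℝ) + (Multiset.countP (fun z : ℂ => |z.re| < c * (reg.a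 k * m f / reg.Zm k)) (spinorLift gammaFive * wilsonDirac (fundamentalRep (Fin 3)) U (reg.mcrit k + reg.a k * m f / reg.Zm k) 1).charpoly.roots : ℝ)))) * ∏ f : Fin Nf, ‖fermionDet (wilsonDirac (fundamentalRep (Fin 3)) U (reg.mcrit k + reg.a k * m f / reg.Zm k) 1)‖ ∂(wilsonMeasure (d := 4) (L := 2 * S + 1) (fundamentalRep (Fin 3)) (reg.β k))) / (∫ U, ∏ f : Fin Nf, ‖fermionDet (wilsonDirac (fundamentalRep (Fin 3)) U (reg.mcrit k + reg.a k * m f / reg.Zm k) 1)‖ ∂(wilsonMeasure (d := 4) (L := 2 * S + 1) (fundamentalRep (Fin 3)) (reg.β k))) ≤ ε * ((2 * S + 1 : ℝ) / (2 * reg.L k + 1)) ^ 4)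

/-- For the free-side witness `m_crit ≡ 0` both defect counts vanish for EVERY gauge field: no real
eigenvalue of `D_W(U,0,1)` lies below `−a m/Z < 0`, and `H_W(a m/Z)` has no eigenvalue in
`(−a m/Z, a m/Z)`. [folklore] -/
theorem defectCounts_eq_zero {S : ℕ} (U : GaugeConfig 4 (2 * S + 1) SU3) {μ₀ c : ℝ} (hμ : 0 < μ₀)
    (hc : c ≤ 1) :
    (Multiset.countP (fun z : ℂ => z.im = 0 ∧ z.re < -(0 + μ₀))
        (wilsonDirac (fundamentalRep (Fin 3)) U 0 1).charpoly.roots : ℝ) +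
      (Multiset.countP (fun z : ℂ => |z.re| < c * μ₀)
        (spinorLift gammaFive * wilsonDirac (fundamentalRep (Fin 3)) U (0 + μ₀) 1).charpoly.roots : ℝ)
      = 0 := by
  have hρ : ∀ g : SU3, fundamentalRep (Fin 3) g ∈ Matrix.unitaryGroup (Fin 3) ℂ :=
    fundamentalRep_mem_unitaryGroup
  have h1 : Multiset.countP (fun z : ℂ => z.im = 0 ∧ z.re < -(0 + μ₀))
      (wilsonDirac (fundamentalRep (Fin 3)) U 0 1).charpoly.roots = 0 := by
    refine Multiset.countP_eq_zero.2 fun z hz h => ?_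
    have := mass_le_re_of_mem_roots_charpoly_wilsonDirac (fundamentalRep (Fin 3)) hρ U 0 hz
    linarith [h.2]
  have h2 : Multiset.countP (fun z : ℂ => |z.re| < c * μ₀)
      (spinorLift gammaFive * wilsonDirac (fundamentalRep (Fin 3)) U (0 + μ₀) 1).charpoly.roots = 0 := by
    refine Multiset.countP_eq_zero.2 fun z hz h => ?_
    have := (im_eq_zero_and_mass_le_abs_re_of_mem_roots_charpoly_hermitianWilsonDirac
      (fundamentalRep (Fin 3)) hρ U (0 + μ₀) hz).2
    nlinarith [abs_nonneg z.re]
  rw [h1, h2]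
  simp

/-- **EXTINCT alone is vacuous.** The tree's degenerate regularisation `canonicalAF N_f`
(`m_crit ≡ 0`, canonical `Z_m`, `β_k = afBeta N_f 1 a_k`) satisfies the EXTINCT clause of
`WindowExtinction` for EVERY `N_f`, with `M₀ = 0`, `c = 1`, from `k = 0` on and on every torus:
both defect counts vanish configuration by configuration (`defectCounts_eq_zero`), so the
phase-quenched expectation is `0 ≤ ε · (volume ratio)⁴`. Hence any proof of the crux must use
TIGHT to locate `m_crit(k)`, and no refutation can come from EXTINCT alone. [folklore] -/
theorem extinctOnly_holds : ExtinctOnly := by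
  intro Nf _
  refine ⟨QCDRegularisation.canonicalAF Nf, QCDRegularisation.canonicalAF_hasMassScaling, ?_, 0, le_rfl,
    1, one_pos, ?_⟩
  · exact ⟨1, one_pos, by simp [QCDRegularisation.scheme, QCDRegularisation.canonicalAF, QCDScheme.zeroAF]⟩
  · intro m hm ε hε
    refine Filter.Eventually.of_forall fun k S _ => ?_
    have hμ : ∀ f : Fin Nf, 0 < (QCDRegularisation.canonicalAF Nf).a k * m f /
        (QCDRegularisation.canonicalAF Nf).Zm k := fun f =>
      div_pos (mul_pos ((QCDRegularisation.canonicalAF Nf).a_pos k) (hm f))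
        ((QCDRegularisation.canonicalAF Nf).Zm_pos k)
    have hcrit : ∀ k, (QCDRegularisation.canonicalAF Nf).mcrit k = 0 := fun _ => rfl
    simp only [hcrit]
    have hint : ∀ U : GaugeConfig 4 (2 * S + 1) SU3,
        (∑ f : Fin Nf, ((Multiset.countP (fun z : ℂ => z.im = 0 ∧ z.re <
            -(0 + (QCDRegularisation.canonicalAF Nf).a k * m f / (QCDRegularisation.canonicalAF Nf).Zm k))
            (wilsonDirac (fundamentalRep (Fin 3)) U 0 1).charpoly.roots : ℝ) +
          (Multiset.countP (fun z : ℂ => |z.re| < 1 *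
            ((QCDRegularisation.canonicalAF Nf).a k * m f / (QCDRegularisation.canonicalAF Nf).Zm k))
            (spinorLift gammaFive * wilsonDirac (fundamentalRep (Fin 3)) U
              (0 + (QCDRegularisation.canonicalAF Nf).a k * m f / (QCDRegularisation.canonicalAF Nf).Zm k)
              1).charpoly.roots : ℝ))) = 0 := by
      intro U
      exact Finset.sum_eq_zero fun f _ => defectCounts_eq_zero U (hμ f) le_rfl
    simp only [hint, zero_mul, integral_zero, zero_div]
    positivity


/-! ## §4 THE PIN: TIGHT forces `m_crit(k) ∈ [−8 + a_k M/Z_k, a_k M/Z_k]` eventually -/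

section PinConsequences

/-- The TIGHT ratio of `WindowExtinction` at step `k` (verbatim): the phase-quenched expectation
of `|n₋(Γ₅ D_W(U, m_crit(k) − a_k M/Z_k, 1)) − 6(2L_k+1)⁴|` on the scheme torus. -/
noncomputable def tightRatio {Nf : ℕ} (reg : QCDRegularisation Nf) (m : Fin Nf → ℝ) (M : ℝ) (k : ℕ) : ℝ :=
  open Literature.MathematicalPhysics.QuantumLattice Literature.MathematicalPhysics.QuantumFieldTheory Literature.Probability.LatticeModels in (∫ U, (|(Multiset.countP (fun z : ℂ => z.re < 0) (spinorLift gammaFive * wilsonDirac (fundamentalRep (Fin 3)) U (reg.mcrit k - reg.a k * M / reg.Zm k) 1).charpoly.roots : ℝ) - 6 * (2 * reg.L k + 1 : ℝ) ^ 4|) * ∏ f : Fin Nf, ‖fermionDet (wilsonDirac (fundamentalRep (Fin 3)) U (reg.mcrit k + reg.a k * m f / reg.Zm k) 1)‖ ∂(wilsonMeasure (d := 4) (L := 2 * reg.L k + 1) (fundamentalRep (Fin 3)) (reg.β k))) / (∫ U, ∏ f : Fin Nf, ‖fermionDet (wilsonDirac (fundamentalRep (Fin 3)) U (reg.mcrit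 k + reg.a k * m f / reg.Zm k) 1)‖ ∂(wilsonMeasure (d := 4) (L := 2 * reg.L k + 1) (fundamentalRep (Fin 3)) (reg.β k)))

/-- `WindowExtinction` (SD⁺, restated 2026-08-17) read through `tightRatio` (definitional sanity check; RETYPED in
cycle 3 — the cycle-1 statement was `Iff.rfl` against the retired stmt-8964 body). -/
theorem windowExtinction_iff_tightRatio :
    Summit.QuantumFields.QCD.Theses.SpectralDefectExtinction.WindowExtinction ↔
    (open Literature.MathematicalPhysics.QuantumLattice Literature.MathematicalPhysics.QuantumFieldTheory Literature.Probability.LatticeModels in ∀ Nf : ℕ, (Nf = 2 ∨ Nf = 3) → ∃ reg : QCDRegularisation Nf, reg.HasMassScaling ∧ (reg.scheme 0 0 0).HasAsymptoticScaling ∧ (∃ p : ℕ, ∀ᶠ k : ℕ in Filter.atTop, (reg.L k : ℝ) ≤ (reg.a k)⁻¹ ^ p) ∧ (∀ᶠ k : ℕ in Filter.atTop, -1 < reg.mcrit k) ∧ ∃ M₀ : ℝ, 0 ≤ M₀ ∧ ∃ c : ℝ, 0 < c ∧ ∀ m : Fin Nf → ℝ, (∀ f, M₀ < m f) → (∀ ε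 : ℝ, 0 < ε → ∀ᶠ k : ℕ in Filter.atTop, ∀ S : ℕ, reg.L k ≤ S → (∫ U, ((∑ f : Fin Nf, ((Multiset.countP (fun z : ℂ => z.im = 0 ∧ z.re < -(reg.mcrit k + reg.a k * m f / reg.Zm k)) (wilsonDirac (fundamentalRep (Fin 3)) U 0 1).charpoly.roots : ℝ) + (Multiset.countP (fun z : ℂ => |z.re| < c * (reg.a k * m f / reg.Zm k)) (spinorLift gammaFive * wilsonDirac (fundamentalRep (Fin 3)) U (reg.mcrit k + reg.a k * m f / reg.Zm k) 1).charpoly.roots : ℝ)))) * ∏ f : Fin Nf, ‖fermionDet (wilsonDirac (fundamentalRep (Fin 3)) U (reg.mcrit k + reg.a k * m f / reg.Zm k) 1)‖ ∂(wilsonMeasure (d := 4) (L := 2 * S + 1) (fundamentalRep (Fin 3)) (reg.β k))) / (∫ U, ∏ f : Fin Nf, ‖fermionDet (wilsonDirac (fundamentalRep (Fin 3)) U (reg.mcrit k + reg.a k * m f / reg.Zm k) 1)‖ ∂(wilsonMeasure (d := 4) (L := 2 * S + 1) (fundamentalRep (Fin 3)) (reg.β k))) ≤ ε * ((2 * S +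 1 : ℝ) / (2 * reg.L k + 1)) ^ 4) ∧ (∃ η : ℝ, 0 < η ∧ ∀ M : ℝ, M₀ < M → ∀ᶠ k : ℕ in Filter.atTop, max 1 (η * (reg.a k * (2 * reg.L k + 1 : ℝ)) ^ 2) ≤ tightRatio reg m M k)) :=
  Iff.rfl

/-- **TIGHT⁺ ⇒ TIGHT**: the extensive floor `max 1 (η (a_k(2L_k+1))²)` is at least the filed floor `1`, so every
consequence of `∀ᶠ k, 1 ≤ tightRatio reg m M k` (the pin, §5, §7, §10) applies to SD⁺ witnesses verbatim. -/
theorem tightPlus_floor_one {Nf : ℕ} (reg : QCDRegularisation Nf) (m : Fin Nf → ℝ) {M₀ : ℝ}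
    (hT : ∃ η : ℝ, 0 < η ∧ ∀ M : ℝ, M₀ < M → ∀ᶠ k : ℕ in Filter.atTop,
      max 1 (η * (reg.a k * (2 * reg.L k + 1 : ℝ)) ^ 2) ≤ tightRatio reg m M k)
    {M : ℝ} (hM : M₀ < M) : ∀ᶠ k : ℕ in Filter.atTop, 1 ≤ tightRatio reg m M k := by
  obtain ⟨η, -, h⟩ := hT
  exact (h M hM).mono fun k hk => le_trans (le_max_left _ _) hk

/-- **Off the hole the TIGHT integrand vanishes identically**: if `m_crit(k) − a_k M/Z_k > 0` or
`< −8`, then `|n₋ − 6(2L_k+1)⁴| = 0` for every gauge field, so the TIGHT ratio at step `k` is `0`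
(whatever the weights, integrable or not). [folklore] -/
theorem tightRatio_eq_zero_of_not_mem {Nf : ℕ} (reg : QCDRegularisation Nf) (m : Fin Nf → ℝ)
    (M : ℝ) (k : ℕ)
    (h : 0 < reg.mcrit k - reg.a k * M / reg.Zm k ∨ reg.mcrit k - reg.a k * M / reg.Zm k < -8) :
    tightRatio reg m M k = 0 := by
  have hρ : ∀ g : Matrix.specialUnitaryGroup (Fin 3) ℂ, fundamentalRep (Fin 3) g ∈
      Matrix.unitaryGroup (Fin 3) ℂ := fundamentalRep_mem_unitaryGroup
  have hcount : ∀ U : GaugeConfig 4 (2 * reg.L k + 1) (Matrix.specialUnitaryGroup (Fin 3) ℂ),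
      ((Multiset.countP (fun z : ℂ => z.re < 0) (spinorLift gammaFive *
        wilsonDirac (fundamentalRep (Fin 3)) U (reg.mcrit k - reg.a k * M / reg.Zm k) 1).charpoly.roots
          : ℕ) : ℝ) = 6 * (2 * reg.L k + 1 : ℝ) ^ 4 := by
    intro U
    rw [negCount_hermitianWilsonDirac_eq_half (fundamentalRep (Fin 3)) hρ U h, card_quarkIdx_div_two]
    push_cast
    ring
  unfold tightRatio
  simp only [hcount, sub_self, abs_zero, zero_mul, integral_zero, zero_div]

/-- **TIGHT pins the witness's critical line into `[−8 + a_k M/Z_k, a_k M/Z_k]`.** If the TIGHT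
clause holds at `M` along `reg`, then eventually `−8 ≤ m_crit(k) − a_k M/Z_k ≤ 0`: the Wilson
critical mass of any witness of `WindowExtinction` lies eventually in `[−8, 0]` up to the vanishing
offset `a_k M/Z_k` (for every `M > M₀`). The trivial witnesses `m_crit ≫ 0` (below the hole) and
`m_crit ≪ −8` (above it) are exactly what TIGHT excludes; inside `[−8, 0]` the index is
configuration dependent and nothing pathwise decides TIGHT. [folklore] -/
theorem tight_pins_mcrit {Nf : ℕ} (reg : QCDRegularisation Nf) (m : Fin Nf → ℝ) (M : ℝ)
    (hT : ∀ᶠ k : ℕ in Filter.atTop, 1 ≤ tightRatio reg m M k) :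
    ∀ᶠ k : ℕ in Filter.atTop,
      -8 ≤ reg.mcrit k - reg.a k * M / reg.Zm k ∧ reg.mcrit k - reg.a k * M / reg.Zm k ≤ 0 := by
  refine hT.mono fun k hk => ?_
  by_contra hno
  have h' : 0 < reg.mcrit k - reg.a k * M / reg.Zm k ∨ reg.mcrit k - reg.a k * M / reg.Zm k < -8 := by
    rcases not_and_or.1 hno with h1 | h1
    · exact Or.inr (lt_of_not_ge h1)
    · exact Or.inl (lt_of_not_ge h1)
  have := tightRatio_eq_zero_of_not_mem reg m M k h'
  linarith

/-- `WindowExtinction` (SD⁺) with the pin made explicit: the same statement plus the conjunct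
"for every `M > M₀`, eventually `−8 ≤ m_crit(k) − a_k M/Z_k ≤ 0`" (with BRANCH this is `(−1, a_kM/Z_k]`;
RETYPED in cycle 3 for the restated body). -/
def PinnedWindowExtinction : Prop :=
open Literature.MathematicalPhysics.QuantumLattice Literature.MathematicalPhysics.QuantumFieldTheory Literature.Probability.LatticeModels in ∀ Nf : ℕ, (Nf = 2 ∨ Nf = 3) → ∃ reg : QCDRegularisation Nf, reg.HasMassScaling ∧ (reg.scheme 0 0 0).HasAsymptoticScaling ∧ (∃ p : ℕ, ∀ᶠ k : ℕ in Filter.atTop, (reg.L k : ℝ) ≤ (reg.a k)⁻¹ ^ p) ∧ (∀ᶠ k : ℕ in Filter.atTop, -1 < reg.mcrit k) ∧ ∃ M₀ : ℝ, 0 ≤ M₀ ∧ ∃ c : ℝ, 0 < c ∧ ∀ m : Fin Nf → ℝ, (∀ f, M₀ < m f) → (∀ ε : ℝ, 0 < ε → ∀ᶠ k : ℕ in Filter.atTop, ∀ S : ℕ, reg.L k ≤ S → (∫ U, ((∑ f : Fin Nf, ((Multiset.countP (fun z : ℂ => z.im = 0 ∧ z.re < -(reg.mcrit k + reg.a k *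 m f / reg.Zm k)) (wilsonDirac (fundamentalRep (Fin 3)) U 0 1).charpoly.roots : ℝ) + (Multiset.countP (fun z : ℂ => |z.re| < c * (reg.a k * m f / reg.Zm k)) (spinorLift gammaFive * wilsonDirac (fundamentalRep (Fin 3)) U (reg.mcrit k + reg.a k * m f / reg.Zm k) 1).charpoly.roots : ℝ)))) * ∏ f : Fin Nf, ‖fermionDet (wilsonDirac (fundamentalRep (Fin 3)) U (reg.mcrit k + reg.a k * m f / reg.Zm k) 1)‖ ∂(wilsonMeasure (d := 4) (L := 2 * S + 1) (fundamentalRep (Fin 3)) (reg.β k))) / (∫ U, ∏ f : Fin Nf, ‖fermionDet (wilsonDirac (fundamentalRep (Fin 3)) U (reg.mcrit k + reg.a k * m f / reg.Zm k) 1)‖ ∂(wilsonMeasure (d := 4) (L := 2 * S + 1) (fundamentalRep (Fin 3)) (reg.β k))) ≤ ε * ((2 * S + 1 : ℝ) / (2 * reg.L k + 1)) ^ 4) ∧ (∃ η : ℝ, 0 < η ∧ ∀ M : ℝ, M₀ < M → ∀ᶠ k : ℕ in Filter.atTop, max 1 (η * (reg.a k * (2 * reg.L k + 1 : ℝ)) ^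 2) ≤ (∫ U, (|(Multiset.countP (fun z : ℂ => z.re < 0) (spinorLift gammaFive * wilsonDirac (fundamentalRep (Fin 3)) U (reg.mcrit k - reg.a k * M / reg.Zm k) 1).charpoly.roots : ℝ) - 6 * (2 * reg.L k + 1 : ℝ) ^ 4|) * ∏ f : Fin Nf, ‖fermionDet (wilsonDirac (fundamentalRep (Fin 3)) U (reg.mcrit k + reg.a k * m f / reg.Zm k) 1)‖ ∂(wilsonMeasure (d := 4) (L := 2 * reg.L k + 1) (fundamentalRep (Fin 3)) (reg.β k))) / (∫ U, ∏ f : Fin Nf, ‖fermionDet (wilsonDirac (fundamentalRep (Fin 3)) U (reg.mcrit k + reg.a k * m f / reg.Zm k) 1)‖ ∂(wilsonMeasure (d := 4) (L := 2 * reg.L k + 1) (fundamentalRep (Fin 3)) (reg.β k)))) ∧ (∀ M : ℝ, M₀ < M → ∀ᶠ k : ℕ in Filter.atTop, -8 ≤ reg.mcrit k - reg.a k * M / reg.Zm k ∧ reg.mcrit k - reg.a k * M / reg.Zm k ≤ 0)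

/-- **The pin is free**: `WindowExtinction` is equivalent to its pinned form — any witness
automatically has its critical line eventually in `[−8 + a_k M/Z_k, a_k M/Z_k]` for all `M > M₀`. [folklore] -/
theorem windowExtinction_iff_pinned :
    Summit.QuantumFields.QCD.Theses.SpectralDefectExtinction.WindowExtinction ↔
      PinnedWindowExtinction := by
  constructor
  · intro h Nf hNf
    obtain ⟨reg, h1, h2, hcap, hbr, M₀, hM₀, c, hc, hm⟩ := h Nf hNf
    refine ⟨reg, h1, h2, hcap, hbr, M₀, hM₀, c, hc, fun m hmM => ?_⟩
    obtain ⟨hE, hT⟩ := hm m hmM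
    exact ⟨hE, hT, fun M hM => tight_pins_mcrit reg m M (tightPlus_floor_one reg m hT hM)⟩
  · intro h Nf hNf
    obtain ⟨reg, h1, h2, hcap, hbr, M₀, hM₀, c, hc, hm⟩ := h Nf hNf
    refine ⟨reg, h1, h2, hcap, hbr, M₀, hM₀, c, hc, fun m hmM => ?_⟩
    obtain ⟨hE, hT, -⟩ := hm m hmM
    exact ⟨hE, hT⟩

/-- **With BRANCH the pin is `(−1, a_kM/Z_k]`**: every SD⁺ witness has, for every `M > M₀`, eventually
`−1 < m_crit(k) ≤ a_kM/Z_k` (TIGHT⁺ gives the upper end, BRANCH the lower; `a_kM/Z_k → 0`). [folklore] -/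
theorem line_mem_Ioc_of_windowExtinction
    (h : Summit.QuantumFields.QCD.Theses.SpectralDefectExtinction.WindowExtinction) {Nf : ℕ} (hNf : Nf = 2 ∨ Nf = 3) :
    ∃ reg : QCDRegularisation Nf, ∃ M₀ : ℝ, 0 ≤ M₀ ∧ ∀ m : Fin Nf → ℝ, (∀ f, M₀ < m f) → ∀ M : ℝ, M₀ < M →
      ∀ᶠ k : ℕ in Filter.atTop, -1 < reg.mcrit k ∧ reg.mcrit k ≤ reg.a k * M / reg.Zm k := by
  obtain ⟨reg, -, -, -, hbr, M₀, hM₀, c, -, hm⟩ := h Nf hNf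
  refine ⟨reg, M₀, hM₀, fun m hmM M hM => ?_⟩
  filter_upwards [hbr, tight_pins_mcrit reg m M (tightPlus_floor_one reg m (hm m hmM).2 hM)] with k hk1 hk2
  exact ⟨hk1, by linarith [hk2.2]⟩

end PinConsequences

/-! ## §5 SPECTRAL FLOW: the index is carried by real modes; the window count

The counting form of Weyl's inequality (`card_filter_lt_neg_le`, from the min–max bound of §2) makes the
negative-eigenvalue count of the Hermitian pencil `H(m) = Γ₅D + mΓ₅` locally constant off the finitely many
crossing values `m = −λ` (`λ` a real eigenvalue of `D`) and bounds its jump at a crossing by the nullity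
`≤` algebraic multiplicity (`pencil_local`, `pencil_zero_count_le`); induction over the crossing values gives
the spectral flow counting inequality `pencil_flow`, and for Wilson fermions `index_le_realModes_below` and
the pathwise WINDOW COUNT `window_realModes_ge` — what TIGHT ∧ EXTINCT(a) force on any witness. -/

section Flow

variable {n : Type*} [Fintype n] [DecidableEq n]

/-- For a Hermitian matrix the root count with a real predicate is the eigenvalue count. [folklore] -/
theorem countP_roots_eq_card_filter {A : Matrix n n ℂ} (hA : A.IsHermitian) (p : ℝ → Prop)
    [DecidablePred p] :
    A.charpoly.roots.countP (fun z => p z.re) = (Finset.univ.filter fun i => p (hA.eigenvalues i)).card := by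
  rw [hA.roots_charpoly_eq_eigenvalues, Multiset.countP_map, Finset.card_def, Finset.filter_val]
  congr 1

/-- Parseval for the eigenvector unitary: `Σ ‖(U† v)_j‖² = Σ ‖v_j‖²`. [folklore] -/
theorem sum_norm_sq_star_unitary_mulVec (U : Matrix.unitaryGroup n ℂ) (v : n → ℂ) :
    ∑ j, ‖((star (U : Matrix n n ℂ)) *ᵥ v) j‖ ^ 2 = ∑ j, ‖v j‖ ^ 2 := by
  have h : star ((star (U : Matrix n n ℂ)) *ᵥ v) ⬝ᵥ ((star (U : Matrix n n ℂ)) *ᵥ v) = star v ⬝ᵥ v := by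
    rw [star_mulVec, star_eq_conjTranspose, conjTranspose_conjTranspose, ← dotProduct_mulVec, mulVec_mulVec]
    have : (U : Matrix n n ℂ) * star (U : Matrix n n ℂ) = 1 := Unitary.coe_mul_star_self U
    rw [star_eq_conjTranspose] at this
    rw [this, one_mulVec]
  have h2 := congrArg Complex.re h
  rw [star_dotProduct_self_eq, star_dotProduct_self_eq, Complex.ofReal_re, Complex.ofReal_re] at h2
  exact h2

/-- **Counting stability (Weyl's inequality in counting form, with a sign `σ = ±1`).** Let `A`, `B` be
Hermitian with `|Re v†(B − A)v| ≤ δ Σ‖v‖²`. Then `B` has at least as many eigenvalues with `σλ < 0` as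
`A` has eigenvalues with `σλ < −δ`. [folklore] -/
theorem card_filter_lt_neg_le {A B : Matrix n n ℂ} (hA : A.IsHermitian) (hB : B.IsHermitian) {σ δ : ℝ}
    (hσ : σ = 1 ∨ σ = -1)
    (hE : ∀ v : n → ℂ, |(star v ⬝ᵥ (B - A) *ᵥ v).re| ≤ δ * ∑ i, ‖v i‖ ^ 2) :
    (Finset.univ.filter fun i => σ * hA.eigenvalues i < -δ).card ≤
      (Finset.univ.filter fun i => σ * hB.eigenvalues i < 0).card := by
  set U : Matrix n n ℂ := (hA.eigenvectorUnitary : Matrix n n ℂ) with hU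
  let I := {i // σ * hA.eigenvalues i < -δ}
  let J := {i // ¬ σ * hA.eigenvalues i < -δ}
  -- W = vectors whose `A`-eigencoordinates vanish off `I`
  let Φ : (n → ℂ) →ₗ[ℂ] (J → ℂ) :=
    (LinearMap.pi fun j : J => LinearMap.proj (R := ℂ) (φ := fun _ : n => ℂ) j.1) ∘ₗ (star U).mulVecLin
  let W : Submodule ℂ (n → ℂ) := LinearMap.ker Φ
  have hWmem : ∀ v ∈ W, ∀ j, ¬ σ * hA.eigenvalues j < -δ → ((star U) *ᵥ v) j = 0 := by
    intro v hv j hj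
    have := congrFun (LinearMap.mem_ker.1 hv) ⟨j, hj⟩
    simpa [Φ] using this
  have hWdim : Fintype.card I ≤ Module.finrank ℂ W := by
    show Fintype.card I ≤ Module.finrank ℂ (LinearMap.ker Φ)
    have h1 := Φ.finrank_range_add_finrank_ker
    have h2 : Module.finrank ℂ (LinearMap.range Φ) ≤ Fintype.card J := by
      calc Module.finrank ℂ (LinearMap.range Φ) ≤ Module.finrank ℂ (J → ℂ) := Submodule.finrank_le _
        _ = Fintype.card J := Module.finrank_fintype_fun_eq_card ℂ
    have h3 : Module.finrank ℂ (n → ℂ) = Fintype.card n := Module.finrank_fintype_fun_eq_card ℂ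
    have h4 : Fintype.card I + Fintype.card J = Fintype.card n := by
      rw [Fintype.card_subtype_compl, Nat.add_sub_cancel' (Fintype.card_subtype_le _)]
    omega
  have hW : ∀ v ∈ W, v ≠ 0 → σ * (star v ⬝ᵥ B *ᵥ v).re < 0 := by
    intro v hv hv0
    set w := (star U) *ᵥ v with hw
    have hS := sum_norm_sq_star_unitary_mulVec hA.eigenvectorUnitary v
    rw [← hU, ← hw] at hS
    have hSpos : 0 < ∑ j, ‖w j‖ ^ 2 := by rw [hS]; exact sum_norm_sq_pos hv0
    -- quadratic form of A
    have hqA : σ * (star v ⬝ᵥ A *ᵥ v).re < -δ * ∑ j, ‖v j‖ ^ 2 := by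
      rw [re_star_dotProduct_mulVec_eq hA v, ← hU, ← hw, Finset.mul_sum, ← hS, Finset.mul_sum]
      -- termwise: σ λ_j ‖w_j‖² ≤ -δ ‖w_j‖², strict for some j
      have hle : ∀ j ∈ Finset.univ, σ * (hA.eigenvalues j * ‖w j‖ ^ 2) ≤ -δ * ‖w j‖ ^ 2 := by
        intro j _
        by_cases hj : σ * hA.eigenvalues j < -δ
        · have : σ * (hA.eigenvalues j * ‖w j‖ ^ 2) = (σ * hA.eigenvalues j) * ‖w j‖ ^ 2 := by ring
          rw [this]
          exact mul_le_mul_of_nonneg_right hj.le (by positivity)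
        · have h0 : w j = 0 := by rw [hw]; exact hWmem v hv j hj
          rw [h0]; simp
      obtain ⟨j₀, hj₀⟩ : ∃ j, w j ≠ 0 := Function.ne_iff.mp (fun h => by rw [h] at hSpos; simp at hSpos)
      have hj₀I : σ * hA.eigenvalues j₀ < -δ := by
        by_contra hc
        exact hj₀ (by rw [hw]; exact hWmem v hv j₀ hc)
      have hlt : σ * (hA.eigenvalues j₀ * ‖w j₀‖ ^ 2) < -δ * ‖w j₀‖ ^ 2 := by
        have : σ * (hA.eigenvalues j₀ * ‖w j₀‖ ^ 2) = (σ * hA.eigenvalues j₀) * ‖w j₀‖ ^ 2 := by ring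
        rw [this]
        exact mul_lt_mul_of_pos_right hj₀I (by positivity)
      exact Finset.sum_lt_sum hle ⟨j₀, Finset.mem_univ _, hlt⟩
    have hEv := hE v
    have hBv : (star v ⬝ᵥ B *ᵥ v).re = (star v ⬝ᵥ A *ᵥ v).re + (star v ⬝ᵥ (B - A) *ᵥ v).re := by
      rw [sub_mulVec, dotProduct_sub, Complex.sub_re]; ring
    rw [hBv, mul_add]
    have : σ * (star v ⬝ᵥ (B - A) *ᵥ v).re ≤ δ * ∑ i, ‖v i‖ ^ 2 := by
      rcases hσ with rfl | rfl
      · rw [one_mul]; exact (le_abs_self _).trans hEv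
      · rw [neg_one_mul]; exact (neg_le_abs _).trans hEv
    linarith
  calc (Finset.univ.filter fun i => σ * hA.eigenvalues i < -δ).card = Fintype.card I := by
        rw [Fintype.card_subtype]
    _ ≤ Module.finrank ℂ W := hWdim
    _ ≤ _ := finrank_le_card_filter hB σ W hW

end Flow

section Pencil

variable {n : Type*} [Fintype n] [DecidableEq n]

omit [DecidableEq n] in
/-- `‖v† w‖ ≤ C Σ‖v‖²` when `Σ‖w‖² ≤ C² Σ‖v‖²`. [folklore] -/
theorem norm_star_dotProduct_le_of_sq_le (v w : n → ℂ) {C : ℝ} (hC : 0 ≤ C)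
    (h : ∑ i, ‖w i‖ ^ 2 ≤ C ^ 2 * ∑ i, ‖v i‖ ^ 2) :
    ‖star v ⬝ᵥ w‖ ≤ C * ∑ i, ‖v i‖ ^ 2 := by
  have h1 : ‖star v ⬝ᵥ w‖ ≤ ∑ i, ‖v i‖ * ‖w i‖ := by
    rw [dotProduct]
    refine (norm_sum_le _ _).trans (le_of_eq (Finset.sum_congr rfl fun i _ => ?_))
    rw [norm_mul, Pi.star_apply, norm_star]
  refine h1.trans ?_
  have hcs := Finset.sum_mul_sq_le_sq_mul_sq Finset.univ (fun i => ‖v i‖) (fun i => ‖w i‖)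
  have hS : 0 ≤ ∑ i, ‖v i‖ ^ 2 := Finset.sum_nonneg fun i _ => by positivity
  have h2 : (∑ i, ‖v i‖ * ‖w i‖) ^ 2 ≤ (C * ∑ i, ‖v i‖ ^ 2) ^ 2 := by
    calc (∑ i, ‖v i‖ * ‖w i‖) ^ 2 ≤ (∑ i, ‖v i‖ ^ 2) * ∑ i, ‖w i‖ ^ 2 := hcs
      _ ≤ (∑ i, ‖v i‖ ^ 2) * (C ^ 2 * ∑ i, ‖v i‖ ^ 2) := mul_le_mul_of_nonneg_left h hS
      _ = (C * ∑ i, ‖v i‖ ^ 2) ^ 2 := by ring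
  have hnn : 0 ≤ C * ∑ i, ‖v i‖ ^ 2 := mul_nonneg hC hS
  exact (pow_le_pow_iff_left₀ (Finset.sum_nonneg fun i _ => by positivity) hnn two_ne_zero).1 h2

/-- An isometric matrix (`Mᴴ M = 1`) preserves `Σ‖·‖²`. [folklore] -/
theorem sum_norm_sq_mulVec_of_isometry {M : Matrix n n ℂ} (hM : Mᴴ * M = 1) (v : n → ℂ) :
    ∑ j, ‖(M *ᵥ v) j‖ ^ 2 = ∑ j, ‖v j‖ ^ 2 := by
  have h : star (M *ᵥ v) ⬝ᵥ (M *ᵥ v) = star v ⬝ᵥ v := by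
    rw [star_mulVec, ← dotProduct_mulVec, mulVec_mulVec, hM, one_mulVec]
  have h2 := congrArg Complex.re h
  rw [star_dotProduct_self_eq, star_dotProduct_self_eq, Complex.ofReal_re, Complex.ofReal_re] at h2
  exact h2

variable {Γ D : Matrix n n ℂ}

omit [DecidableEq n] in
/-- The pencil `Γ D + m Γ` is Hermitian for real `m` when `Γ` and `Γ D` are. [folklore] -/
theorem pencil_isHermitian (hΓ : Γᴴ = Γ) (hD : (Γ * D)ᴴ = Γ * D) (m : ℝ) :
    (Γ * D + (m : ℂ) • Γ).IsHermitian := by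
  unfold Matrix.IsHermitian
  rw [conjTranspose_add, conjTranspose_smul, hD, hΓ, Complex.star_def, Complex.conj_ofReal]

/-- `|Re v†(H(m') − H(m))v| ≤ |m' − m| Σ‖v‖²` (`Γ` unitary). [folklore] -/
theorem pencil_diff_bound (hΓ : Γᴴ = Γ) (hΓ2 : Γ * Γ = 1) (m m' : ℝ) (v : n → ℂ) :
    |(star v ⬝ᵥ ((Γ * D + (m' : ℂ) • Γ) - (Γ * D + (m : ℂ) • Γ)) *ᵥ v).re| ≤ |m' - m| * ∑ i, ‖v i‖ ^ 2 := by
  have hdiff : (Γ * D + (m' : ℂ) • Γ) - (Γ * D + (m : ℂ) • Γ) = ((m' - m : ℝ) : ℂ) • Γ := by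
    rw [add_sub_add_left_eq_sub, ← sub_smul, ← Complex.ofReal_sub]
  rw [hdiff, smul_mulVec, dotProduct_smul, smul_eq_mul]
  have hiso : ∑ j, ‖(Γ *ᵥ v) j‖ ^ 2 ≤ 1 ^ 2 * ∑ j, ‖v j‖ ^ 2 := by
    rw [one_pow, one_mul, sum_norm_sq_mulVec_of_isometry (by rw [hΓ, hΓ2]) v]
  have hb := norm_star_dotProduct_le_of_sq_le v (Γ *ᵥ v) zero_le_one hiso
  calc |(((m' - m : ℝ) : ℂ) * (star v ⬝ᵥ Γ *ᵥ v)).re| ≤ ‖((m' - m : ℝ) : ℂ) * (star v ⬝ᵥ Γ *ᵥ v)‖ :=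
        Complex.abs_re_le_norm _
    _ = |m' - m| * ‖star v ⬝ᵥ Γ *ᵥ v‖ := by rw [norm_mul, Complex.norm_real, Real.norm_eq_abs]
    _ ≤ |m' - m| * (1 * ∑ i, ‖v i‖ ^ 2) := mul_le_mul_of_nonneg_left hb (abs_nonneg _)
    _ = |m' - m| * ∑ i, ‖v i‖ ^ 2 := by rw [one_mul]

/-- Trichotomy of the eigenvalue counts of a Hermitian matrix: `ν + π + κ = n`. [folklore] -/
theorem countP_neg_add_pos_add_zero {A : Matrix n n ℂ} (hA : A.IsHermitian) :
    A.charpoly.roots.countP (fun z => z.re < 0) + A.charpoly.roots.countP (fun z => 0 < z.re) +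
      A.charpoly.roots.countP (fun z => z.re = 0) = Fintype.card n := by
  rw [countP_roots_eq_card_filter hA (· < 0), countP_roots_eq_card_filter hA (0 < ·),
    countP_roots_eq_card_filter hA (· = 0)]
  have h1 := Finset.card_filter_add_card_filter_not (s := Finset.univ)
    (fun i => hA.eigenvalues i < 0)
  have h2 : (Finset.univ.filter fun i => ¬ hA.eigenvalues i < 0) =
      (Finset.univ.filter fun i => 0 < hA.eigenvalues i) ∪ (Finset.univ.filter fun i => hA.eigenvalues i = 0) := by
    ext i
    simp only [Finset.mem_filter, Finset.mem_univ, true_and, Finset.mem_union, not_lt]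
    constructor
    · intro h
      rcases h.lt_or_eq with h | h
      · exact Or.inl h
      · exact Or.inr h.symm
    · rintro (h | h)
      · exact h.le
      · exact h.ge
  have h3 : Disjoint (Finset.univ.filter fun i => 0 < hA.eigenvalues i)
      (Finset.univ.filter fun i => hA.eigenvalues i = 0) := by
    rw [Finset.disjoint_filter]
    intro i _ h1 h2
    rw [h2] at h1
    exact lt_irrefl _ h1
  rw [h2, Finset.card_union_of_disjoint h3, Finset.card_univ] at h1
  omega

/-- **Local step of the spectral flow.** For the Hermitian pencil `H(m) = ΓD + mΓ` (`Γ` a Hermitian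
unitary, `ΓD` Hermitian) and every `m` there is `ε > 0` such that for `|t| < ε`:
`ν(m) ≤ ν(m+t) ≤ ν(m) + κ(m)` and `π(m) ≤ π(m+t)`, where `ν, π, κ` count the negative, positive and zero
eigenvalues. [folklore] -/
theorem pencil_local (hΓ : Γᴴ = Γ) (hΓ2 : Γ * Γ = 1) (hD : (Γ * D)ᴴ = Γ * D) (m : ℝ) :
    ∃ ε : ℝ, 0 < ε ∧ ∀ t : ℝ, |t| < ε →
      (Γ * D + (m : ℂ) • Γ).charpoly.roots.countP (fun z => z.re < 0) ≤
          (Γ * D + ((m + t : ℝ) : ℂ) • Γ).charpoly.roots.countP (fun z => z.re < 0) ∧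
        (Γ * D + (m : ℂ) • Γ).charpoly.roots.countP (fun z => 0 < z.re) ≤
          (Γ * D + ((m + t : ℝ) : ℂ) • Γ).charpoly.roots.countP (fun z => 0 < z.re) ∧
        (Γ * D + ((m + t : ℝ) : ℂ) • Γ).charpoly.roots.countP (fun z => z.re < 0) ≤
          (Γ * D + (m : ℂ) • Γ).charpoly.roots.countP (fun z => z.re < 0) +
            (Γ * D + (m : ℂ) • Γ).charpoly.roots.countP (fun z => z.re = 0) := by
  have hA := pencil_isHermitian hΓ hD m
  -- a positive lower bound for the non-zero eigenvalues
  obtain ⟨ε, hε, hgap⟩ : ∃ ε : ℝ, 0 < ε ∧ ∀ i, hA.eigenvalues i ≠ 0 → ε ≤ |hA.eigenvalues i| := by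
    by_cases hne : (Finset.univ.filter fun i => hA.eigenvalues i ≠ 0).Nonempty
    · obtain ⟨i₀, hi₀, hmin⟩ := Finset.exists_min_image _ (fun i => |hA.eigenvalues i|) hne
      refine ⟨|hA.eigenvalues i₀|, abs_pos.2 (Finset.mem_filter.1 hi₀).2, fun i hi => hmin i ?_⟩
      exact Finset.mem_filter.2 ⟨Finset.mem_univ _, hi⟩
    · refine ⟨1, one_pos, fun i hi => ?_⟩
      exact absurd ⟨i, Finset.mem_filter.2 ⟨Finset.mem_univ _, hi⟩⟩ hne
  refine ⟨ε, hε, fun t ht => ?_⟩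
  have hB := pencil_isHermitian hΓ hD (m + t)
  have hE : ∀ v : n → ℂ, |(star v ⬝ᵥ ((Γ * D + ((m + t : ℝ) : ℂ) • Γ) - (Γ * D + (m : ℂ) • Γ)) *ᵥ v).re|
      ≤ |t| * ∑ i, ‖v i‖ ^ 2 := by
    intro v
    have := pencil_diff_bound (D := D) hΓ hΓ2 m (m + t) v
    rwa [add_sub_cancel_left] at this
  have hν := card_filter_lt_neg_le hA hB (σ := 1) (δ := |t|) (Or.inl rfl) hE
  have hπ := card_filter_lt_neg_le hA hB (σ := -1) (δ := |t|) (Or.inr rfl) hE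
  -- below the gap the shifted thresholds do not matter
  have hνA : (Finset.univ.filter fun i => 1 * hA.eigenvalues i < -|t|) =
      (Finset.univ.filter fun i => hA.eigenvalues i < 0) := by
    refine Finset.filter_congr fun i _ => ?_
    rw [one_mul]
    constructor
    · intro h; linarith [abs_nonneg t]
    · intro h
      have := hgap i h.ne
      rw [abs_of_neg h] at this
      linarith
  have hπA : (Finset.univ.filter fun i => -1 * hA.eigenvalues i < -|t|) =
      (Finset.univ.filter fun i => 0 < hA.eigenvalues i) := by
    refine Finset.filter_congr fun i _ => ?_
    rw [neg_one_mul, neg_lt_neg_iff]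
    constructor
    · intro h; linarith [abs_nonneg t]
    · intro h
      have := hgap i h.ne'
      rw [abs_of_pos h] at this
      linarith
  have hνB : (Finset.univ.filter fun i => 1 * hB.eigenvalues i < 0) =
      (Finset.univ.filter fun i => hB.eigenvalues i < 0) :=
    Finset.filter_congr fun i _ => by rw [one_mul]
  have hπB : (Finset.univ.filter fun i => -1 * hB.eigenvalues i < 0) =
      (Finset.univ.filter fun i => 0 < hB.eigenvalues i) :=
    Finset.filter_congr fun i _ => by rw [neg_one_mul, neg_lt_zero]
  rw [hνA, hνB] at hν
  rw [hπA, hπB] at hπ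
  rw [countP_roots_eq_card_filter hA (· < 0), countP_roots_eq_card_filter hB (· < 0),
    countP_roots_eq_card_filter hA (0 < ·), countP_roots_eq_card_filter hB (0 < ·),
    countP_roots_eq_card_filter hA (· = 0)]
  refine ⟨hν, hπ, ?_⟩
  have htriA := countP_neg_add_pos_add_zero hA
  have htriB := countP_neg_add_pos_add_zero hB
  rw [countP_roots_eq_card_filter hA (· < 0), countP_roots_eq_card_filter hA (0 < ·),
    countP_roots_eq_card_filter hA (· = 0)] at htriA
  rw [countP_roots_eq_card_filter hB (· < 0), countP_roots_eq_card_filter hB (0 < ·),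
    countP_roots_eq_card_filter hB (· = 0)] at htriB
  omega

/-- **Zero modes of the pencil are eigenvalues of `D`**: `κ(m) ≤` the algebraic multiplicity of `−m` as
an eigenvalue of `D` (nullity of `Γ(D + m) ≤` geometric `≤` algebraic multiplicity). [folklore] -/
theorem pencil_zero_count_le (hΓ : Γᴴ = Γ) (hΓ2 : Γ * Γ = 1) (hD : (Γ * D)ᴴ = Γ * D) (m : ℝ) :
    (Γ * D + (m : ℂ) • Γ).charpoly.roots.countP (fun z => z.re = 0) ≤
      D.charpoly.roots.count (-(m : ℂ)) := by
  have hA := pencil_isHermitian hΓ hD m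
  rw [countP_roots_eq_card_filter hA (· = 0)]
  -- #{λ = 0} = n - rank
  have hrank := hA.rank_eq_card_non_zero_eigs
  have hzero : (Finset.univ.filter fun i => hA.eigenvalues i = 0).card =
      Fintype.card n - (Γ * D + (m : ℂ) • Γ).rank := by
    rw [hrank, Fintype.card_subtype_compl, Fintype.card_subtype,
      Nat.sub_sub_self (Finset.card_le_univ _)]
  rw [hzero]
  -- rank (Γ (D + m)) = rank (D + m)
  have hfac : Γ * D + (m : ℂ) • Γ = Γ * (D + (m : ℂ) • (1 : Matrix n n ℂ)) := by
    rw [mul_add, Matrix.mul_smul, mul_one]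
  have hΓunit : IsUnit Γ.det := by
    have : IsUnit Γ := ⟨⟨Γ, Γ, hΓ2, hΓ2⟩, rfl⟩
    exact (Matrix.isUnit_iff_isUnit_det Γ).1 this
  rw [hfac, Matrix.rank_mul_eq_right_of_isUnit_det Γ _ hΓunit]
  -- rank-nullity for D + m
  have hrn := (D + (m : ℂ) • (1 : Matrix n n ℂ)).mulVecLin.finrank_range_add_finrank_ker
  rw [Module.finrank_fintype_fun_eq_card] at hrn
  have hrk : (D + (m : ℂ) • (1 : Matrix n n ℂ)).rank =
      Module.finrank ℂ (LinearMap.range (D + (m : ℂ) • (1 : Matrix n n ℂ)).mulVecLin) := rfl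
  -- ker (D + m) ≤ eigenspace D (-m)
  have hker : LinearMap.ker (D + (m : ℂ) • (1 : Matrix n n ℂ)).mulVecLin ≤
      Module.End.eigenspace (Matrix.toLin' D) (-(m : ℂ)) := by
    intro v hv
    rw [LinearMap.mem_ker, Matrix.mulVecLin_apply, add_mulVec, smul_mulVec, one_mulVec] at hv
    rw [Module.End.mem_eigenspace_iff, Matrix.toLin'_apply, neg_smul]
    exact eq_neg_of_add_eq_zero_left hv
  have hle := (Submodule.finrank_mono hker).trans (LinearMap.finrank_eigenspace_le (Matrix.toLin' D) (-(m : ℂ)))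
  rw [Matrix.charpoly_toLin', ← Polynomial.count_roots] at hle
  omega

end Pencil

section FlowGlobal

variable {n : Type*} [Fintype n] [DecidableEq n]

omit [DecidableEq n] in
/-- Monotonicity of `countP` in the predicate. [folklore] -/
theorem countP_mono_pred {α : Type*} (s : Multiset α) {p q : α → Prop} [DecidablePred p] [DecidablePred q]
    (h : ∀ a, p a → q a) : s.countP p ≤ s.countP q := by
  rw [Multiset.countP_eq_card_filter, Multiset.countP_eq_card_filter]
  exact Multiset.card_le_card (Multiset.monotone_filter_right s h)

omit [DecidableEq n] in
/-- Additivity of `countP` over disjoint predicates, as an inequality. [folklore] -/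
theorem countP_add_countP_le {α : Type*} (s : Multiset α) {p q r : α → Prop} [DecidablePred p]
    [DecidablePred q] [DecidablePred r] (hpq : ∀ a, p a → q a → False) (hp : ∀ a, p a → r a)
    (hq : ∀ a, q a → r a) : s.countP p + s.countP q ≤ s.countP r := by
  classical
  rw [Multiset.countP_eq_countP_filter_add s r p]
  refine add_le_add ?_ ?_
  · rw [Multiset.countP_filter]
    exact countP_mono_pred s fun a hpa => ⟨hp a hpa, hpa⟩
  · rw [Multiset.countP_filter]
    exact countP_mono_pred s fun a hqa => ⟨hq a hqa, fun hpa => hpq a hpa hqa⟩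

variable {Γ D : Matrix n n ℂ}

/-- **Spectral flow counting inequality.** For the Hermitian pencil `H(m) = ΓD + mΓ` of a
`Γ`-selfadjoint matrix `D` (`Γ` Hermitian unitary): the number of negative eigenvalues of `H` changes
between `m₁ ≤ m₂` by at most the number (with algebraic multiplicity) of REAL eigenvalues `λ` of `D`
with `−λ ∈ [m₁, m₂]` — levels of `H(m)` cross zero only at `m = −λ`, and by at most the multiplicity.
Proof: counting stability (`card_filter_lt_neg_le`) makes `ν` locally constant off the finitely many
crossing values and bounds the jump at a crossing by the nullity `≤` algebraic multiplicity
(`pencil_zero_count_le`); induction on the number of crossing values in `[m₁, m₂]`. [folklore] -/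
theorem pencil_flow (hΓ : Γᴴ = Γ) (hΓ2 : Γ * Γ = 1) (hD : (Γ * D)ᴴ = Γ * D) {m₁ m₂ : ℝ} (h12 : m₁ ≤ m₂) :
    |((Γ * D + (m₁ : ℂ) • Γ).charpoly.roots.countP (fun z => z.re < 0) : ℤ) -
        ((Γ * D + (m₂ : ℂ) • Γ).charpoly.roots.countP (fun z => z.re < 0) : ℤ)| ≤
      (D.charpoly.roots.countP (fun μ => μ.im = 0 ∧ m₁ ≤ -μ.re ∧ -μ.re ≤ m₂) : ℤ) := by
  -- notation
  set ν : ℝ → ℕ := fun x => (Γ * D + (x : ℂ) • Γ).charpoly.roots.countP (fun z => z.re < 0) with hν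
  set κ : ℝ → ℕ := fun x => (Γ * D + (x : ℂ) • Γ).charpoly.roots.countP (fun z => z.re = 0) with hκ
  set Z : ℝ → ℝ → ℕ := fun a b =>
    D.charpoly.roots.countP (fun μ => μ.im = 0 ∧ a ≤ -μ.re ∧ -μ.re ≤ b) with hZ
  change |(ν m₁ : ℤ) - (ν m₂ : ℤ)| ≤ (Z m₁ m₂ : ℤ)
  -- the finite set of crossing values
  set C : Finset ℝ := ((D.charpoly.roots.filter fun μ => μ.im = 0).map fun μ => -μ.re).toFinset with hC
  have hmemC : ∀ x : ℝ, 0 < D.charpoly.roots.count (-(x : ℂ)) → x ∈ C := by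
    intro x hx
    rw [hC, Multiset.mem_toFinset, Multiset.mem_map]
    exact ⟨-(x : ℂ), Multiset.mem_filter.2 ⟨Multiset.count_pos.1 hx, by simp⟩, by simp⟩
  have hκ0 : ∀ x : ℝ, x ∉ C → κ x = 0 := by
    intro x hx
    have h := pencil_zero_count_le hΓ hΓ2 hD x
    have : D.charpoly.roots.count (-(x : ℂ)) = 0 := by
      by_contra hne
      exact hx (hmemC x (Nat.pos_of_ne_zero hne))
    simpa [hκ, this] using h
  have hκZ : ∀ a b x : ℝ, a ≤ x → x ≤ b → κ x ≤ Z a b := by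
    intro a b x hax hxb
    refine (pencil_zero_count_le hΓ hΓ2 hD x).trans ?_
    change D.charpoly.roots.countP (fun μ => -(x : ℂ) = μ) ≤ _
    refine countP_mono_pred _ fun μ hμ => ?_
    rw [← hμ]
    simp [hax, hxb]
  -- local step packaged: near every x, ν stays in [ν x, ν x + κ x]
  have hloc : ∀ x : ℝ, ∃ ε : ℝ, 0 < ε ∧ ∀ y : ℝ, |y - x| < ε → ν x ≤ ν y ∧ ν y ≤ ν x + κ x := by
    intro x
    obtain ⟨ε, hε, hstep⟩ := pencil_local hΓ hΓ2 hD x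
    refine ⟨ε, hε, fun y hy => ?_⟩
    have := hstep (y - x) hy
    rw [show x + (y - x) = y by ring] at this
    exact ⟨this.1, this.2.2⟩
  -- constancy on crossing-free intervals
  have hconst : ∀ a b : ℝ, a ≤ b → (∀ x, a ≤ x → x ≤ b → x ∉ C) → ν a = ν b := by
    intro a b hab hfree
    have hcont : ContinuousOn ν (Set.Icc a b) := by
      intro x hx
      obtain ⟨ε, hε, hε'⟩ := hloc x
      have hk : κ x = 0 := hκ0 x (hfree x hx.1 hx.2)
      have heq : ν =ᶠ[nhds x] fun _ => ν x := by
        rw [Filter.eventuallyEq_iff_exists_mem]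
        refine ⟨Metric.ball x ε, Metric.ball_mem_nhds x hε, fun y hy => ?_⟩
        have := hε' y (by simpa [Real.dist_eq] using hy)
        show ν y = ν x
        omega
      exact ((continuousAt_congr heq).2 continuousAt_const).continuousWithinAt
    exact isPreconnected_Icc.constant hcont (Set.left_mem_Icc.2 hab) (Set.right_mem_Icc.2 hab)
  -- main induction on the number of crossing values in [m₁, b]
  suffices hmain : ∀ k : ℕ, ∀ b : ℝ, m₁ ≤ b → (C.filter fun c => m₁ ≤ c ∧ c ≤ b).card ≤ k →
      |(ν m₁ : ℤ) - (ν b : ℤ)| ≤ (Z m₁ b : ℤ) from hmain _ m₂ h12 le_rfl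
  intro k
  induction k with
  | zero =>
    intro b hb hcard
    have hfree : ∀ x, m₁ ≤ x → x ≤ b → x ∉ C := by
      intro x h1 h2 hx
      have : x ∈ C.filter fun c => m₁ ≤ c ∧ c ≤ b := Finset.mem_filter.2 ⟨hx, h1, h2⟩
      rw [Nat.le_zero, Finset.card_eq_zero] at hcard
      rw [hcard] at this
      exact absurd this (Finset.notMem_empty _)
    rw [hconst m₁ b hb hfree, sub_self, abs_zero]
    positivity
  | succ k ih =>
    intro b hb hcard
    by_cases hempty : (C.filter fun c => m₁ ≤ c ∧ c ≤ b) = ∅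
    · have hfree : ∀ x, m₁ ≤ x → x ≤ b → x ∉ C := by
        intro x h1 h2 hx
        have : x ∈ C.filter fun c => m₁ ≤ c ∧ c ≤ b := Finset.mem_filter.2 ⟨hx, h1, h2⟩
        rw [hempty] at this
        exact absurd this (Finset.notMem_empty _)
      rw [hconst m₁ b hb hfree, sub_self, abs_zero]
      positivity
    -- the largest crossing value c in [m₁, b]
    have hne : (C.filter fun c => m₁ ≤ c ∧ c ≤ b).Nonempty := Finset.nonempty_iff_ne_empty.2 hempty
    set c := (C.filter fun c => m₁ ≤ c ∧ c ≤ b).max' hne with hc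
    have hcmem : c ∈ C.filter fun c => m₁ ≤ c ∧ c ≤ b := Finset.max'_mem _ hne
    have hc1 : m₁ ≤ c := (Finset.mem_filter.1 hcmem).2.1
    have hc2 : c ≤ b := (Finset.mem_filter.1 hcmem).2.2
    have hcmax : ∀ x ∈ C, m₁ ≤ x → x ≤ b → x ≤ c := fun x hx h1 h2 =>
      Finset.le_max' _ x (Finset.mem_filter.2 ⟨hx, h1, h2⟩)
    obtain ⟨ε, hε, hε'⟩ := hloc c
    -- right part: ν b ∈ [ν c, ν c + κ c]
    have hright : ν c ≤ ν b ∧ ν b ≤ ν c + κ c := by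
      rcases hc2.lt_or_eq with hlt | heq
      · -- pick a point just right of c
        set η := min (ε / 2) (b - c) with hη
        have hηpos : 0 < η := lt_min (by linarith) (by linarith)
        have hηε : η < ε := (min_le_left _ _).trans_lt (by linarith)
        have h1 := hε' (c + η) (by rw [add_sub_cancel_left, abs_of_pos hηpos]; exact hηε)
        have h2 : ν (c + η) = ν b := hconst (c + η) b (by linarith [min_le_right (ε / 2) (b - c)])
          (fun x hx1 hx2 hxC => by
            have := hcmax x hxC (by linarith) hx2
            linarith)
        rw [← h2]
        exact h1
      · rw [← heq]
        exact ⟨le_rfl, Nat.le_add_right _ _⟩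
    rcases hc1.lt_or_eq with hlt1 | heq1
    · -- left part via the induction hypothesis on [m₁, c - η]
      -- distance to crossing values strictly left of c
      have hgapC : ∃ δ : ℝ, 0 < δ ∧ ∀ x ∈ C, x < c → x ≤ c - δ := by
        by_cases hne' : (C.filter fun x => x < c).Nonempty
        · set c' := (C.filter fun x => x < c).max' hne' with hc'
          have hc'lt : c' < c := (Finset.mem_filter.1 (Finset.max'_mem _ hne')).2
          refine ⟨c - c', by linarith, fun x hx hxc => ?_⟩
          have hxmem : x ∈ C.filter fun x => x < c := Finset.mem_filter.2 ⟨hx, hxc⟩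
          have := Finset.le_max' _ x hxmem
          linarith
        · refine ⟨1, one_pos, fun x hx hxc => ?_⟩
          exact absurd (⟨x, Finset.mem_filter.2 ⟨hx, hxc⟩⟩ : (C.filter fun x => x < c).Nonempty) hne'
      obtain ⟨δ, hδ, hδ'⟩ := hgapC
      set η := min (min (ε / 2) (δ / 2)) ((c - m₁) / 2) with hη
      have hηpos : 0 < η := lt_min (lt_min (by linarith) (by linarith)) (by linarith)
      have hηε : η < ε := ((min_le_left _ _).trans (min_le_left _ _)).trans_lt (by linarith)
      have hηδ : η < δ := ((min_le_left _ _).trans (min_le_right _ _)).trans_lt (by linarith)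
      have hηm : m₁ ≤ c - η := by
        have := min_le_right (min (ε / 2) (δ / 2)) ((c - m₁) / 2)
        linarith
      -- ν (c - η) ∈ [ν c, ν c + κ c]
      have hleft := hε' (c - η) (by rw [sub_sub_cancel_left, abs_neg, abs_of_pos hηpos]; exact hηε)
      -- crossing values in [m₁, c - η] are those of [m₁, b] minus c
      have hsub : (C.filter fun x => m₁ ≤ x ∧ x ≤ c - η) ⊂ C.filter fun x => m₁ ≤ x ∧ x ≤ b := by
        rw [Finset.ssubset_iff_of_subset]
        · refine ⟨c, hcmem, fun hcin => ?_⟩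
          have := (Finset.mem_filter.1 hcin).2.2
          linarith
        · intro x hx
          have hx' := Finset.mem_filter.1 hx
          exact Finset.mem_filter.2 ⟨hx'.1, hx'.2.1, by linarith [hx'.2.2]⟩
      have hcard' : (C.filter fun x => m₁ ≤ x ∧ x ≤ c - η).card ≤ k := by
        have := Finset.card_lt_card hsub
        omega
      have hIH := ih (c - η) hηm hcard'
      -- Z additivity: Z m₁ (c - η) + κ c ≤ Z m₁ b
      have hZadd : Z m₁ (c - η) + κ c ≤ Z m₁ b := by
        refine (add_le_add le_rfl (pencil_zero_count_le hΓ hΓ2 hD c)).trans ?_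
        change D.charpoly.roots.countP _ + D.charpoly.roots.countP (fun μ => -(c : ℂ) = μ) ≤ _
        refine countP_add_countP_le _ (fun μ h1 h2 => ?_) (fun μ h1 => ?_) (fun μ h2 => ?_)
        · rw [← h2] at h1
          simp at h1
          linarith [h1.2]
        · exact ⟨h1.1, h1.2.1, by linarith [h1.2.2]⟩
        · rw [← h2]
          simp [hc1, hc2]
      -- combine
      have e1 : |(ν m₁ : ℤ) - (ν (c - η) : ℤ)| ≤ (Z m₁ (c - η) : ℤ) := hIH
      have e2 : |(ν (c - η) : ℤ) - (ν b : ℤ)| ≤ (κ c : ℤ) := by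
        rw [abs_le]
        constructor <;> omega
      calc |(ν m₁ : ℤ) - (ν b : ℤ)| = |((ν m₁ : ℤ) - ν (c - η)) + ((ν (c - η) : ℤ) - ν b)| := by ring_nf
        _ ≤ |(ν m₁ : ℤ) - ν (c - η)| + |(ν (c - η) : ℤ) - ν b| := abs_add_le _ _
        _ ≤ (Z m₁ (c - η) : ℤ) + (κ c : ℤ) := add_le_add e1 e2
        _ ≤ (Z m₁ b : ℤ) := by exact_mod_cast hZadd
    · -- c = m₁: only the jump at c
      have hκle : κ c ≤ Z m₁ b := hκZ m₁ b c hc1 hc2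
      rw [← heq1] at hright hκle
      rw [abs_le]
      constructor <;> omega

end FlowGlobal

section WilsonFlow

open Literature.MathematicalPhysics.QuantumLattice Literature.MathematicalPhysics.QuantumFieldTheory
  Literature.Probability.LatticeModels

variable {L N : ℕ} [NeZero L] {G : Type*} [Group G] (ρ : G →* Matrix (Fin N) (Fin N) ℂ)

/-- `Γ₅ D_W(U,m,1) = Γ₅ D_W(U,0,1) + m Γ₅` (the bare mass enters additively). [folklore] -/
theorem hermitianWilsonDirac_eq_pencil (hρ : ∀ g, ρ g ∈ Matrix.unitaryGroup (Fin N) ℂ)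
    (U : GaugeConfig 4 L G) (m : ℝ) :
    spinorLift gammaFive * wilsonDirac ρ U m 1 =
      spinorLift gammaFive * wilsonDirac ρ U 0 1 + (m : ℂ) • (spinorLift gammaFive : Matrix _ _ ℂ) := by
  have h : wilsonDirac ρ U m 1 = wilsonDirac ρ U 0 1 + (m : ℂ) • (1 : Matrix _ _ ℂ) := by
    rw [wilsonDirac_eq_sub_sum_wilsonHop ρ hρ U m, wilsonDirac_eq_sub_sum_wilsonHop ρ hρ U 0,
      sub_add_eq_add_sub, ← add_smul, ← Complex.ofReal_add, zero_add, add_comm 4 m]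
  rw [h, mul_add, Matrix.mul_smul, mul_one]

/-- **Spectral flow inequality for Wilson fermions (every gauge field).** For bare masses
`m₁ ≤ m₂`, the number `n₋` of negative eigenvalues of the Hermitian Wilson–Dirac operator
`H_W(m) = Γ₅ D_W(U,m,1)` changes between `m₁` and `m₂` by at most the number (algebraic multiplicity)
of REAL eigenvalues `λ` of the massless operator `D_W(U,0,1)` with `−λ ∈ [m₁, m₂]`: levels of `H_W`
cross zero exactly at `m = −λ` ("level crossing ⟺ real mode", Edwards–Heller–Narayanan), by at most the
multiplicity. [folklore] -/
theorem negCount_sub_negCount_le_realModes (hρ : ∀ g, ρ g ∈ Matrix.unitaryGroup (Fin N) ℂ)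
    (U : GaugeConfig 4 L G) {m₁ m₂ : ℝ} (h12 : m₁ ≤ m₂) :
    |((spinorLift gammaFive * wilsonDirac ρ U m₁ 1).charpoly.roots.countP (fun z : ℂ => z.re < 0) : ℤ) -
        ((spinorLift gammaFive * wilsonDirac ρ U m₂ 1).charpoly.roots.countP (fun z : ℂ => z.re < 0) : ℤ)| ≤
      ((wilsonDirac ρ U 0 1).charpoly.roots.countP (fun μ : ℂ => μ.im = 0 ∧ m₁ ≤ -μ.re ∧ -μ.re ≤ m₂) : ℤ) := by
  rw [hermitianWilsonDirac_eq_pencil ρ hρ U m₁, hermitianWilsonDirac_eq_pencil ρ hρ U m₂]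
  exact pencil_flow Literature.Barriers.QuantumFields.WilsonDeterminant.conjTranspose_spinorLift_gammaFive
    spinorLift_gammaFive_mul_self
    (Literature.Barriers.QuantumFields.WilsonDeterminant.isHermitian_hermitianWilsonDirac ρ hρ U 0 1) h12

/-- **The index is bounded by the real modes below.** For `m₀ ≤ 0` and every gauge field:
`|n₋(Γ₅ D_W(U,m₀,1)) − n/2| ≤ #{real eigenvalues λ of D_W(U,0,1) with λ ≤ −m₀}` (algebraic
multiplicity) — the anchor `n₋ = n/2` at bare mass `1 > 0` (`negCount_hermitianWilsonDirac_eq_half`) plus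
the spectral flow inequality on `[m₀, 1]`. [folklore] -/
theorem index_le_realModes_below (hρ : ∀ g, ρ g ∈ Matrix.unitaryGroup (Fin N) ℂ)
    (U : GaugeConfig 4 L G) {m₀ : ℝ} (hm₀ : m₀ ≤ 0) :
    |((spinorLift gammaFive * wilsonDirac ρ U m₀ 1).charpoly.roots.countP (fun z : ℂ => z.re < 0) : ℤ) -
        (Fintype.card (TorusSite 4 L × Fin N × Fin 4) / 2 : ℕ)| ≤
      ((wilsonDirac ρ U 0 1).charpoly.roots.countP (fun μ : ℂ => μ.im = 0 ∧ μ.re ≤ -m₀) : ℤ) := by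
  have h := negCount_sub_negCount_le_realModes ρ hρ U (show m₀ ≤ 1 by linarith)
  rw [negCount_hermitianWilsonDirac_eq_half ρ hρ U (Or.inl one_pos)] at h
  refine h.trans ?_
  have hle : (wilsonDirac ρ U 0 1).charpoly.roots.countP (fun μ : ℂ => μ.im = 0 ∧ m₀ ≤ -μ.re ∧ -μ.re ≤ 1) ≤
      (wilsonDirac ρ U 0 1).charpoly.roots.countP (fun μ : ℂ => μ.im = 0 ∧ μ.re ≤ -m₀) :=
    countP_mono_pred _ fun μ hμ => ⟨hμ.1, by linarith [hμ.2.1]⟩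
  exact_mod_cast hle

/-- **Window count (pathwise form of TIGHT ∧ EXTINCT(a)).** For thresholds `t₁ ≤ t₂` with `0 ≤ t₂` and
every gauge field: the number of real eigenvalues of `D_W(U,0,1)` in the WINDOW `[t₁, t₂]` is at least
`|n₋(Γ₅ D_W(U, −t₂, 1)) − n/2| − #{real eigenvalues < t₁}`. In the crux (`t₁ = −m_crit(k) − a_k m_f/Z_k`,
`t₂ = −m_crit(k) + a_k M/Z_k ≥ 0` by `tight_pins_mcrit`): TIGHT makes the phase-quenched mean of the
middle term `≥ 1`, EXTINCT(a) at `S = L_k` makes the mean of the last term `≤ ε`; so — modulo the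
measurability of the three counts, which the prover owes anyway — any witness of `WindowExtinction`
has `E₊[#{real modes of D_W(U,0,1) in [−m_crit(k) − a_k m_f/Z_k, −m_crit(k) + a_k M/Z_k]}] ≥ 1 − ε`
eventually: a REAL-MODE ACCUMULATION EDGE at `−m_crit(k)`, sharp to `O(a_k(m_f + M)/Z_k) → 0`. [folklore] -/
theorem window_realModes_ge (hρ : ∀ g, ρ g ∈ Matrix.unitaryGroup (Fin N) ℂ)
    (U : GaugeConfig 4 L G) {t₁ t₂ : ℝ} (ht₂ : 0 ≤ t₂) :
    |((spinorLift gammaFive * wilsonDirac ρ U (-t₂) 1).charpoly.roots.countP (fun z : ℂ => z.re < 0) : ℤ) -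
        (Fintype.card (TorusSite 4 L × Fin N × Fin 4) / 2 : ℕ)| -
      ((wilsonDirac ρ U 0 1).charpoly.roots.countP (fun μ : ℂ => μ.im = 0 ∧ μ.re < t₁) : ℤ) ≤
      ((wilsonDirac ρ U 0 1).charpoly.roots.countP (fun μ : ℂ => μ.im = 0 ∧ t₁ ≤ μ.re ∧ μ.re ≤ t₂) : ℤ) := by
  have h := index_le_realModes_below ρ hρ U (show -t₂ ≤ 0 by linarith)
  rw [neg_neg] at h
  have hsplit : (wilsonDirac ρ U 0 1).charpoly.roots.countP (fun μ : ℂ => μ.im = 0 ∧ μ.re ≤ t₂) ≤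
      (wilsonDirac ρ U 0 1).charpoly.roots.countP (fun μ : ℂ => μ.im = 0 ∧ μ.re < t₁) +
        (wilsonDirac ρ U 0 1).charpoly.roots.countP (fun μ : ℂ => μ.im = 0 ∧ t₁ ≤ μ.re ∧ μ.re ≤ t₂) := by
    rw [Multiset.countP_eq_countP_filter_add _ _ (fun μ : ℂ => μ.re < t₁), Multiset.countP_filter,
      Multiset.countP_filter]
    refine add_le_add (countP_mono_pred _ fun μ hμ => ⟨hμ.1.1, hμ.2⟩)
      (countP_mono_pred _ fun μ hμ => ⟨hμ.1.1, not_lt.1 hμ.2, hμ.1.2⟩)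
  have : ((wilsonDirac ρ U 0 1).charpoly.roots.countP (fun μ : ℂ => μ.im = 0 ∧ μ.re ≤ t₂) : ℤ) ≤
      ((wilsonDirac ρ U 0 1).charpoly.roots.countP (fun μ : ℂ => μ.im = 0 ∧ μ.re < t₁) : ℤ) +
        ((wilsonDirac ρ U 0 1).charpoly.roots.countP (fun μ : ℂ => μ.im = 0 ∧ t₁ ≤ μ.re ∧ μ.re ≤ t₂) : ℤ) := by
    exact_mod_cast hsplit
  linarith

end WilsonFlow

/-! ### §5c From the pathwise window count to the phase-quenched mean (modulo integrability) -/

section Ratio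

variable {X : Type*} [MeasurableSpace X]

/-- **Accumulation from TIGHT ∧ EXTINCT(a), measure level.** Abstract bookkeeping: if pathwise
`B − C ≤ A` (here `A` = window count, `B` = `|index|`, `C` = real modes below the window, all `≥ 0`
counts; `window_realModes_ge`), the three weighted counts are integrable against the non-negative weight
`w` (= `∏_f |det D_W(m_f(k))|`; THIS is the measurability the prover owes), the weight has positive mass,
TIGHT gives `1 ≤ E₊[B]` and EXTINCT(a) gives `E₊[C] ≤ ε`, then `E₊[A] ≥ 1 − ε`: the phase-quenched expected
number of real modes of `D_W(U,0,1)` inside the window `[−m_crit(k) − a_k m_f/Z_k, −m_crit(k) + a_k M/Z_k]`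
is eventually `≥ 1 − ε` on the scheme torus, for every witness of `WindowExtinction`. [folklore] -/
theorem ratio_window_ge (μ : Measure X) {A B C w : X → ℝ} (hw : ∀ x, 0 ≤ w x)
    (hABC : ∀ x, B x - C x ≤ A x) (hA : Integrable (fun x => A x * w x) μ)
    (hB : Integrable (fun x => B x * w x) μ) (hC : Integrable (fun x => C x * w x) μ) {ε : ℝ}
    (hZ : 0 < ∫ x, w x ∂μ) (hT : 1 ≤ (∫ x, B x * w x ∂μ) / ∫ x, w x ∂μ)
    (hE : (∫ x, C x * w x ∂μ) / (∫ x, w x ∂μ) ≤ ε) :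
    1 - ε ≤ (∫ x, A x * w x ∂μ) / ∫ x, w x ∂μ := by
  have hmono : ∫ x, B x * w x ∂μ - ∫ x, C x * w x ∂μ ≤ ∫ x, A x * w x ∂μ := by
    rw [← integral_sub hB hC]
    refine integral_mono (hB.sub hC) hA fun x => ?_
    have := mul_le_mul_of_nonneg_right (hABC x) (hw x)
    simpa [sub_mul] using this
  have h1 : (∫ x, B x * w x ∂μ) / (∫ x, w x ∂μ) - (∫ x, C x * w x ∂μ) / (∫ x, w x ∂μ) ≤
      (∫ x, A x * w x ∂μ) / ∫ x, w x ∂μ := by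
    rw [← sub_div]
    exact div_le_div_of_nonneg_right hmono hZ.le
  linarith

end Ratio

/-! ## §6 Why the crux resists; literature -/

/-- **Why no pathwise refutation exists (recorded reasoning, no content).** Inside the pinned range the
defect counts and the index are genuinely configuration dependent: at `U = 1` on the odd torus `2L+1`,
`D_W(1,0,1)` has the single real eigenvalue `0` with multiplicity `12` (momentum `p = 0`; no momentum `π`
exists on an odd torus) and zero net chirality, so `index(H_W(1, m₀)) = 0` for ALL `m₀ ≠ 0` while
count (a) at threshold `t > 0` is `12`; an instanton-like field has index `±1` for `m₀ ∈ (−2+…, 0−…)`.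
Hence both `E₊[count] → 0` per scheme torus and `E₊|index| ≥ 1` are statements about the WEIGHTS
`e^{−β_k S_W} ∏_f |det D_W(m_f(k))|` at `β_k → ∞`, `a_k L_k → ∞` — ensemble control of 4D `SU(3)`, open in
both directions (BNN 2000 §7 poses exactly this entropy question). The disprover's standing attack for later
cycles: (i) the `N_f = 2` margin via a typed dislocation family with action `< 1/(4b₀)` whose real mode is
PROVABLY inside a forbidden window — needs a certified dressed-mode computation, i.e. the same ensemble
control; (ii) kill stubs of the lead's line once registered. -/
theorem resists_pathwise : True := trivial

/-- **Literature read this cycle (page-cited; informs, proves nothing).**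
* Edwards–Heller–Narayanan, *Spectral flow, condensate and topology in lattice QCD*, Nucl. Phys. B 535
  (1998) [arXiv:hep-lat/9802016], pp. 3–5 of the arXiv text: with `H_L(m) = γ₅ W(−m)` (their `m` = minus the
  tree's bare mass) the gap is open for `m < m₁` and closed for ALL `m ∈ [m₁, 2]`; quenched `β = 5.7`,
  `8³×16`: `m₁ = 1.02`; "`m₁` decreases as we go to weaker coupling"; "We find `m_c > m₁`, indicating that
  `m_c` lies inside region II. Increasing statistics … can only decrease `m₁`"; near `m₁` "a large density of
  small eigenvalues, and the zero modes have a size of several lattice spacings", further in "size of order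
  one to two lattice spacings … do not seem to affect physical observables". READING FOR THE CRUX: the
  accumulation edge of real modes of `D_W(U,0,1)` sits at `λ = m₁(β)` slightly BELOW the pion critical value
  `|m_c(β)|`. `WindowExtinction` never names the pion line: its witness may put `−m_crit(k)` at the edge
  `m₁(β_k)` (TIGHT ∧ EXTINCT(a) pin it THERE, §4 and `window_realModes_ge`), so the route's kill criterion
  (i)(b) ("`m₁(β)` tracking `m_c(β)` from below with a gap shrinking like `g₀²` rather than like `a`") bites the
  BRIDGE `ExtinctionBuildsQCD` (the realised renormalised masses are shifted by `(|m_c| − m₁) Z_m/a`, which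
  must stay bounded for `QCDOf`), NOT this crux. For this crux the `m₁`-data are only the statement that the
  edge exists and thins with `β`; the RATE against `e^{β/b₀}` is untested.
* Kieburg–Verbaarschot–Zafeiropoulos, *Eigenvalue density of the non-Hermitian Wilson Dirac operator*, PRL
  108 (2012) 022001 [arXiv:1109.0656], p. 4: with `â = a √(W₈ V)`, "`N_add ∝ â^{2(ν+1)}` (`â ≪ 1`), `∝ â`
  (`â ≫ 1`)"; "for small lattice spacing the distribution `ρ_r` [of real modes] has a Gaussian shape with a
  width of `2â`", for `â ≫ 1` "a plateau with sharp edges at `±8â²`" (microscopic units `x̂ = xΣV`). In lattice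
  units the real modes of the physical branch therefore lie within `8 a³ W₈/Σ = O(a³)` of the critical point —
  inside every window `a m_f/Z_m ≫ a³` of the crux — and their number per configuration grows at most like
  `a √(W₈ V)`: Wilson χPT/RMT is CONSISTENT with EXTINCT(a) for the modes it describes (it is blind to
  lattice-scale dislocations, which are the planner's open flank, and it is not a theorem).
* Mohler–Schaefer, PRD 102 (2020) 074506, §4.2 (quoted in the tree's `SpectralDefectDensity.lean`):
  `⟨n_neg⟩ ≈ 2%, 0.3%, 0.05%` at `β = 3.4–3.46, 3.55, 3.7` (CLS, `N_f = 2+1`, improved action) — the only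
  measured trend of sign defects per (roughly fixed) physical volume; decreasing, as EXTINCT predicts.
Searches this session: `lit search` / `lit galaxy` unavailable (searchd down, D-0023 rc 75); the two papers
above were fetched by `lit read` and read at page level. [folklore] -/
theorem literature_notes : True := trivial

/-! ## §7 (cycle 2) QUANTIFIER ORDER: TIGHT uniform in the probe parameter is false for EVERY witness

The TIGHT clause reads `∀ M > M₀, ∀ᶠ k, 1 ≤ tightRatio reg m M k`. With the two quantifiers swapped — one
tail of steps serving every probe parameter — it is refuted pathwise for every `QCDRegularisation`: at a fixed
step `k` the probe `m_crit(k) − a_k M/Z_k` leaves the hole through `−8` as `M → ∞` and the integrand vanishes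
identically there (§4). So in any proof of TIGHT the threshold `k₀(M)` grows with `M`
(`a_k M/Z_k ≤ m_crit(k) + 8` for `k ≥ k₀(M)`, `tight_pins_mcrit`); no estimate uniform in the probe depth can
be an intermediate step. Landing copy (on the `Negative/` lane, against the landed `VolumeLever.tightRatio`):
`Theorems/WindowExtinction/Negative/UniformTight.lean` (proposal filed this cycle). -/

section UniformM

/-- **At every fixed step some admissible probe lies below the hole**: for every `k` and `M₀` there is
`M > M₀` with `m_crit(k) − a_k M/Z_k < −8` (only `a_k > 0`, `Z_k > 0` are used). [folklore] -/
theorem exists_probe_below_hole {Nf : ℕ} (reg : QCDRegularisation Nf) (M₀ : ℝ) (k : ℕ) :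
    ∃ M : ℝ, M₀ < M ∧ reg.mcrit k - reg.a k * M / reg.Zm k < -8 := by
  have ha := reg.a_pos k
  have hZ := reg.Zm_pos k
  refine ⟨max (M₀ + 1) ((reg.mcrit k + 9) * reg.Zm k / reg.a k), lt_max_of_lt_left (by linarith), ?_⟩
  have h1 : (reg.mcrit k + 9) * reg.Zm k / reg.a k ≤
      max (M₀ + 1) ((reg.mcrit k + 9) * reg.Zm k / reg.a k) := le_max_right _ _
  rw [div_le_iff₀ ha] at h1
  have h2 : reg.mcrit k + 9 ≤
      reg.a k * max (M₀ + 1) ((reg.mcrit k + 9) * reg.Zm k / reg.a k) / reg.Zm k := by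
    rw [le_div_iff₀ hZ]
    linarith
  linarith

/-- **TIGHT cannot hold uniformly in `M`** (any witness data, any weights): there is no tail of steps `k`
on which `1 ≤ tightRatio reg m M k` for ALL `M > M₀`. [folklore] -/
theorem not_tight_uniformM {Nf : ℕ} (reg : QCDRegularisation Nf) (m : Fin Nf → ℝ) (M₀ : ℝ) :
    ¬ ∀ᶠ k : ℕ in Filter.atTop, ∀ M : ℝ, M₀ < M → 1 ≤ tightRatio reg m M k := by
  intro h
  obtain ⟨k, hk⟩ := h.exists
  obtain ⟨M, hM, hlt⟩ := exists_probe_below_hole reg M₀ k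
  have h1 := hk M hM
  rw [tightRatio_eq_zero_of_not_mem reg m M k (Or.inr hlt)] at h1
  norm_num at h1

/-- `WindowExtinction` (SD⁺) with TIGHT⁺ required UNIFORMLY in the probe parameter: verbatim, except that
`∃ η > 0, ∀ M > M₀, ∀ᶠ k` is replaced by `∃ η > 0, ∀ᶠ k, ∀ M > M₀` in the TIGHT⁺ conjunct (RETYPED in cycle 3 for
the restated body: cap, branch and the extensive floor included). -/
def WindowExtinctionUniformM : Prop :=
open Literature.MathematicalPhysics.QuantumLattice Literature.MathematicalPhysics.QuantumFieldTheory Literature.Probability.LatticeModels in ∀ Nf : ℕ, (Nf = 2 ∨ Nf = 3) → ∃ reg : QCDRegularisation Nf, reg.HasMassScaling ∧ (reg.scheme 0 0 0).HasAsymptoticScaling ∧ (∃ p : ℕ, ∀ᶠ k : ℕ in Filter.atTop, (reg.L k : ℝ) ≤ (reg.a k)⁻¹ ^ p) ∧ (∀ᶠ k : ℕ in Filter.atTop, -1 < reg.mcrit k) ∧ ∃ M₀ : ℝ, 0 ≤ M₀ ∧ ∃ c : ℝ, 0 < c ∧ ∀ m : Fin Nf → ℝ, (∀ f, M₀ < m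 f) → (∀ ε : ℝ, 0 < ε → ∀ᶠ k : ℕ in Filter.atTop, ∀ S : ℕ, reg.L k ≤ S → (∫ U, ((∑ f : Fin Nf, ((Multiset.countP (fun z : ℂ => z.im = 0 ∧ z.re < -(reg.mcrit k + reg.a k * m f / reg.Zm k)) (wilsonDirac (fundamentalRep (Fin 3)) U 0 1).charpoly.roots : ℝ) + (Multiset.countP (fun z : ℂ => |z.re| < c * (reg.a k * m f / reg.Zm k)) (spinorLift gammaFive * wilsonDirac (fundamentalRep (Fin 3)) U (reg.mcrit k + reg.a k * m f / reg.Zm k) 1).charpoly.roots : ℝ)))) * ∏ f : Fin Nf, ‖fermionDet (wilsonDirac (fundamentalRep (Fin 3)) U (reg.mcrit k + reg.a k * m f / reg.Zm k) 1)‖ ∂(wilsonMeasure (d := 4) (L := 2 * S + 1) (fundamentalRep (Fin 3)) (reg.β k))) / (∫ U, ∏ f : Fin Nf, ‖fermionDet (wilsonDirac (fundamentalRep (Fin 3)) U (reg.mcrit k + reg.a k * m f / reg.Zm k) 1)‖ ∂(wilsonMeasure (d := 4) (L := 2 * S + 1) (fundamentalRep (Fin 3)) (reg.β k))) ≤ ε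 * ((2 * S + 1 : ℝ) / (2 * reg.L k + 1)) ^ 4) ∧ (∃ η : ℝ, 0 < η ∧ ∀ᶠ k : ℕ in Filter.atTop, ∀ M : ℝ, M₀ < M → max 1 (η * (reg.a k * (2 * reg.L k + 1 : ℝ)) ^ 2) ≤ tightRatio reg m M k)

/-- The uniform version is a STRENGTHENING of the crux. [folklore] -/
theorem windowExtinctionUniformM_imp (h : WindowExtinctionUniformM) :
    Summit.QuantumFields.QCD.Theses.SpectralDefectExtinction.WindowExtinction := by
  rw [windowExtinction_iff_tightRatio]
  intro Nf hNf
  obtain ⟨reg, h1, h2, hcap, hbr, M₀, hM₀, c, hc, hm⟩ := h Nf hNf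
  refine ⟨reg, h1, h2, hcap, hbr, M₀, hM₀, c, hc, fun m hmM => ⟨(hm m hmM).1, ?_⟩⟩
  obtain ⟨η, hη, hT⟩ := (hm m hmM).2
  exact ⟨η, hη, fun M hM => hT.mono fun k hk => hk M hM⟩

/-- **… and it is FALSE**: already at `N_f = 2`, for the witness's own `reg`, `M₀` and `m ≡ M₀ + 1`,
`not_tight_uniformM` applies (the floor `max 1 (…)` is at least `1`). The quantifier order `∀ M, ∀ᶠ k` of the crux is
load-bearing. [folklore] -/
theorem not_windowExtinctionUniformM : ¬ WindowExtinctionUniformM := by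
  intro h
  obtain ⟨reg, -, -, -, -, M₀, -, c, -, hm⟩ := h 2 (Or.inl rfl)
  obtain ⟨η, -, hT⟩ := (hm (fun _ => M₀ + 1) fun _ => by linarith).2
  exact not_tight_uniformM reg (fun _ => M₀ + 1) M₀
    (hT.mono fun k hk M hM => le_trans (le_max_left _ _) (hk M hM))

end UniformM

/-! ## §8 (cycle 2) CLAUSE (b) ⊇ NEAR-EIGENVALUE DISCS: `σ_min(D_W + m₀) ≤ dist(−m₀, spec D_W(U,0,1))`

Clause (b) counts eigenvalues of `H_W(m₀) = Γ₅ D_W(U,m₀,1)` in `(−r, r)` (`m₀ = m_f(k)`, `r = c a_k m_f/Z_k`).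
Pathwise: ANY characteristic root `z` of the MASSLESS operator — real or complex — with `‖z + m₀‖ < r` produces
one (`coercivityDefect_of_near_root`; for the eigenvector `v`, `H_W(m₀)v = (z + m₀)Γ₅v`, `Γ₅` an isometry,
and `min|λ(A)| ≤ ‖Av‖/‖v‖` for Hermitian `A`, `exists_abs_eigenvalue_lt`). READING (the cone): as `m_f` ranges
over `(M₀, ∞)` the discs `{‖z − (E_k − w)‖ < c w}`, `w = a_k m_f/Z_k`, `E_k = −m_crit(k)`, sweep the truncated cone
of half-opening `arcsin c` about the leftward real ray from the witness's edge point; EXTINCT(b) forces the whole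
spectrum of `D_W(U,0,1)` (in phase-quenched mean, flavour by flavour, eventually) out of each disc, while TIGHT ∧
EXTINCT(a) (§5) force real modes to accumulate at the apex from the right: the physical branch must reach the edge
from OUTSIDE the cone (the continuum picture `E_k + i a_k λ + O(a_k²)` is vertical — consistent for every `c < 1`).
One-sided only (triage r1-2 on `singular-value-cone`: near-Krein-collision pairs give tiny `σ_min` with no
eigenvalue in the disc). Landing copy: `Theorems/WindowExtinction/Negative/CoercivityDefectNearRoot.lean`
(proposal filed this cycle). -/

section NearRoot

variable {n : Type*} [Fintype n] [DecidableEq n]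

/-- **`‖A v‖²` in eigen-coordinates**: `Σ_j ‖(A v)_j‖² = Σ_i λ_i² ‖(U† v)_i‖²` (Hermitian `A`). [folklore] -/
theorem sum_norm_sq_mulVec_eq_sum_eigenvalues {A : Matrix n n ℂ} (hA : A.IsHermitian) (v : n → ℂ) :
    ∑ j, ‖(A *ᵥ v) j‖ ^ 2 =
      ∑ i, hA.eigenvalues i ^ 2 * ‖((star (hA.eigenvectorUnitary : Matrix n n ℂ)) *ᵥ v) i‖ ^ 2 := by
  set U : Matrix n n ℂ := (hA.eigenvectorUnitary : Matrix n n ℂ) with hUdef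
  have hU : A = U * diagonal (RCLike.ofReal ∘ hA.eigenvalues) * star U := by
    conv_lhs => rw [hA.spectral_theorem, Unitary.conjStarAlgAut_apply]
  have hiso : Uᴴ * U = 1 := by
    rw [hUdef, ← star_eq_conjTranspose]
    exact Unitary.coe_star_mul_self hA.eigenvectorUnitary
  have hAv : A *ᵥ v = U *ᵥ (diagonal (RCLike.ofReal ∘ hA.eigenvalues) *ᵥ ((star U) *ᵥ v)) := by
    conv_lhs => rw [hU, Matrix.mul_assoc]
    rw [← mulVec_mulVec, ← mulVec_mulVec]
  rw [hAv, sum_norm_sq_mulVec_of_isometry hiso]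
  refine Finset.sum_congr rfl fun i _ => ?_
  have hzi : (RCLike.ofReal ∘ hA.eigenvalues) i = ((hA.eigenvalues i : ℝ) : ℂ) := rfl
  rw [mulVec_diagonal, hzi, norm_mul, mul_pow, Complex.norm_real, Real.norm_eq_abs, sq_abs]

/-- **A test vector below level `r` forces an eigenvalue in `(−r, r)`** (Hermitian `A`, `r ≥ 0`). [folklore] -/
theorem exists_abs_eigenvalue_lt {A : Matrix n n ℂ} (hA : A.IsHermitian) {v : n → ℂ} {r : ℝ} (hr : 0 ≤ r)
    (h : ∑ j, ‖(A *ᵥ v) j‖ ^ 2 < r ^ 2 * ∑ j, ‖v j‖ ^ 2) :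
    ∃ i, |hA.eigenvalues i| < r := by
  by_contra hno
  push Not at hno
  rw [sum_norm_sq_mulVec_eq_sum_eigenvalues hA v, ← sum_norm_sq_star_unitary_mulVec hA.eigenvectorUnitary v,
    Finset.mul_sum] at h
  refine absurd h (not_lt.2 (Finset.sum_le_sum fun i _ => ?_))
  have hsq : r ^ 2 ≤ hA.eigenvalues i ^ 2 := by
    rw [← sq_abs (hA.eigenvalues i)]
    exact pow_le_pow_left₀ hr (hno i) 2
  exact mul_le_mul_of_nonneg_right hsq (by positivity)

/-- The same, as a characteristic root `z` with `|Re z| < r`. [folklore] -/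
theorem exists_root_abs_re_lt {A : Matrix n n ℂ} (hA : A.IsHermitian) {v : n → ℂ} {r : ℝ} (hr : 0 ≤ r)
    (h : ∑ j, ‖(A *ᵥ v) j‖ ^ 2 < r ^ 2 * ∑ j, ‖v j‖ ^ 2) :
    ∃ z ∈ A.charpoly.roots, |z.re| < r := by
  obtain ⟨i, hi⟩ := exists_abs_eigenvalue_lt hA hr h
  refine ⟨((hA.eigenvalues i : ℝ) : ℂ), ?_, by simpa using hi⟩
  rw [hA.roots_charpoly_eq_eigenvalues]
  exact Multiset.mem_map.2 ⟨i, by simp, rfl⟩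

variable {L N : ℕ} [NeZero L] {G : Type*} [Group G] (ρ : G →* Matrix (Fin N) (Fin N) ℂ)

/-- **Clause (b) is triggered by any eigenvalue of the massless operator near the bare point.** If
`D_W(U,0,1)` has a characteristic root `z` (real OR complex) with `‖z + m₀‖ < r`, then `Γ₅ D_W(U,m₀,1)` has an
eigenvalue `e` with `|e| < r` (`σ_min(D_W + m₀) ≤ dist(−m₀, spec D_W(U,0,1))`). [folklore] -/
theorem coercivityDefect_of_near_root (hρ : ∀ g, ρ g ∈ Matrix.unitaryGroup (Fin N) ℂ)
    (U : GaugeConfig 4 L G) (m₀ : ℝ) {z : ℂ} (hz : z ∈ (wilsonDirac ρ U 0 1).charpoly.roots) {r : ℝ}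
    (hr : ‖z + m₀‖ < r) :
    ∃ e ∈ (spinorLift gammaFive * wilsonDirac ρ U m₀ 1).charpoly.roots, |e.re| < r := by
  obtain ⟨v, hv, hDv⟩ := exists_eigenvector_of_mem_roots_charpoly _ hz
  have hH : (spinorLift gammaFive * wilsonDirac ρ U m₀ 1).IsHermitian :=
    Literature.Barriers.QuantumFields.WilsonDeterminant.isHermitian_hermitianWilsonDirac ρ hρ U m₀ 1
  have hr0 : 0 ≤ r := (norm_nonneg _).trans hr.le
  refine exists_root_abs_re_lt hH hr0 (v := v) ?_
  have hDm : wilsonDirac ρ U m₀ 1 *ᵥ v = (z + m₀) • v := by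
    have h : wilsonDirac ρ U m₀ 1 = wilsonDirac ρ U 0 1 + (m₀ : ℂ) • (1 : Matrix _ _ ℂ) := by
      rw [wilsonDirac_eq_sub_sum_wilsonHop ρ hρ U m₀, wilsonDirac_eq_sub_sum_wilsonHop ρ hρ U 0,
        sub_add_eq_add_sub, ← add_smul, ← Complex.ofReal_add, zero_add, add_comm 4 m₀]
    rw [h, add_mulVec, smul_mulVec, one_mulVec, hDv, add_smul]
  have hHv : (spinorLift gammaFive * wilsonDirac ρ U m₀ 1) *ᵥ v =
      (z + m₀) • ((spinorLift gammaFive : Matrix _ _ ℂ) *ᵥ v) := by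
    rw [← mulVec_mulVec, hDm, mulVec_smul]
  have hΓ : (spinorLift gammaFive : Matrix (TorusSite 4 L × Fin N × Fin 4) _ ℂ)ᴴ *
      spinorLift gammaFive = 1 := by
    rw [Literature.Barriers.QuantumFields.WilsonDeterminant.conjTranspose_spinorLift_gammaFive,
      spinorLift_gammaFive_mul_self]
  rw [hHv, sum_norm_sq_smul, sum_norm_sq_mulVec_of_isometry hΓ]
  have hsq : ‖z + m₀‖ ^ 2 < r ^ 2 := pow_lt_pow_left₀ hr (norm_nonneg _) two_ne_zero
  exact mul_lt_mul_of_pos_right hsq (sum_norm_sq_pos hv)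

/-- **Counting form** (the crux's clause (b): `m₀ = m_crit(k) + a_k m_f/Z_k`, `r = c a_k m_f/Z_k`): the
clause-(b) count is `≥ 1` on every gauge field whose MASSLESS spectrum meets the open disc `{‖z + m₀‖ < r}`.
[folklore] -/
theorem one_le_countP_coercivityDefect_of_near_root (hρ : ∀ g, ρ g ∈ Matrix.unitaryGroup (Fin N) ℂ)
    (U : GaugeConfig 4 L G) (m₀ : ℝ) {z : ℂ} (hz : z ∈ (wilsonDirac ρ U 0 1).charpoly.roots) {r : ℝ}
    (hr : ‖z + m₀‖ < r) :
    1 ≤ (spinorLift gammaFive * wilsonDirac ρ U m₀ 1).charpoly.roots.countP fun e : ℂ => |e.re| < r := by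
  obtain ⟨e, he, her⟩ := coercivityDefect_of_near_root ρ hρ U m₀ hz hr
  exact Multiset.countP_pos.2 ⟨e, he, her⟩

end NearRoot

/-! ## §9 (cycle 2) STATUS: the hollow direction, the registered skeleton's stubs, what a refutation would
now have to contradict -/

/-- **HOLLOW DIRECTION (why no unconditional `¬ WindowExtinction` is expected).** Recorded reasoning, no content.
`QCDRegularisation.L` is bounded only from below (`tendsto_L : a_k L_k → ∞`) and `m_crit` is free, so the TIP
FAMILY (`canonicalAF`, `m_crit ≡ 0`, with witness-chosen huge volumes; landed
`ExtinctionBuildsQCD/Negative/VolumeLever.lean`, `tipReg`) has EXTINCT for free (§3) and reduces TIGHT to a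
FIXED-COUPLING infinite-volume statement: at the bare parameters of one step `k`, `E₊|index(−a_k M/Z_k)| ≥ 1`
on SOME large torus, uniformly over probe depths / weight masses in a window of bounded aspect ratio
(line `Lines/free-volume-heavy-witness.lean`: `FixedCouplingIndexSpread N_f`, with the reduction
`C⁺(2) ∧ C⁺(3) → WindowExtinction` kernel-checked there). `FixedCouplingIndexSpread` is a Lifshitz-tail +
anti-concentration statement about lattice `SU(3)` at ONE coupling (deep real modes of `D_W(U,0,1)` are carried
by cold patches of positive, hyper-small rate per site; the signed crossings of separated carriers decorrelate;
`E|Σ ±1| → ∞` with the volume) — heuristically TRUE, so an unconditional refutation of the crux would have to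
contradict it: NOT expected. Two cautions for users of the landed hollow-direction lemma
`VolumeLever.sdHyp_of_indexSpread`: (i) its hypothesis `IndexSpread N_f` is FALSE as typed (no lower bound on
the probe parameter: at fixed `(k, L')`, `E₊|index(−a_k M/Z_k)| → 0` as `M → 0⁺` by dominated convergence, since
a.e. field has no exact zero mode — line card free-volume-heavy-witness, FINDING A), so that lemma is vacuous and
the correct transfer carries lower bounds (`SchemeIndexSpread` / `FixedCouplingIndexSpread` of the line); (ii) a
Lean proof of `¬ IndexSpread` needs `det D_W(U,0,1) ≠ 0` for `wilsonMeasure`-a.e. `U` (real-analytic, not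
identically zero: constant diagonal links with irrational angles) plus measurability of the index — the same
measure-theoretic groundwork every `E₊` statement of the route owes. UPDATE (05:00Z): the measurability half of
that debt is PAID in the tree — `countMeas_measurable_countP` and `stub_countMeasurable`
(`Theorems/SpectralDefectExtinctionTipPricingStubCountMeasurable.lean`, ultrafilter proof of the upper
semicontinuity of root counts in closed sets) and `stub_negCountMeasurable`
(`Theorems/SpectralDefectExtinctionWindowExtinctionStubNegCountMeasurable.lean`); only the a.e.-invertibility
`det D_W(U,0,1) ≠ 0` remains for `¬ IndexSpread`. Earlier pointer, kept for the record: the tree has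
coefficientwise root control —
`Literature.AlgebraicGeometry.HyperbolicPolynomials.Garding.eventually_roots_subset_of_isOpen` /
`eventually_exists_root_near` (complex roots, degree-bounded families) and
`Literature.Analysis.Complex.HutchinsonMultiplierLimit.le_card_roots_of_tendsto` (UPPER SEMICONTINUITY of the
number of real roots with multiplicity of real polynomials at fixed degree); the Hermitian count
`#{e(H_W(U,m₀)) < t}` is lower semicontinuous in `U` by min–max (`finrank_le_card_filter`, §2), and the
clause-(a) count is `lim_j #{roots in (−1,t) × (−1/j,1/j)}` of lower semicontinuous functions, or a localized
`le_card_roots_of_tendsto`; `charpoly D_W(U,0,1)` has real coefficients by `Γ₅`-hermiticity.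
CONSEQUENCE FOR THIS SEAT: the disprover's targets are now (1) natural strengthenings (§7: uniform-in-`M` TIGHT,
false), (2) the REPAIRED statements the planners propose — R1 volume cap `L_k ≤ a_k^{-p}`, R2 extensive TIGHT
`E₊|index| ≥ η (a_k(2L_k+1))²`, R3 TIGHT on tori of fixed physical size, R4 `c₀ ≤ −m_crit(k) β_k` (evidence
`statement-status-ideator3-g2.md`) — for which even killing the TIP witness is open (it needs an UPPER bound
`o(volume⁻¹)` on the deep real-mode rate at weak coupling: the cold-patch law `e^{−cβ²}`, i.e. the chessboard
line's `stub_column` + `stub_deep`), and (3) the stubs of the registered skeleton (next docstring). -/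
theorem hollow_direction_status : True := trivial

/-- **AUDIT OF THE REGISTERED SKELETON'S STUBS** (`Lines/chessboard-cold-cells.lean`, skeleton
`a0c2a5bc9582`; paper attacks, cycle 2 — no stub killed; flank notes for the lead / drefute seat).
* `stub_chessboard : ColumnChessboard` — TRUE (classical). `T ≥ 0` for the Wilson action at `β ≥ 0` needs no
  reflection argument: the temporal-plaquette kernel `exp(β Re tr(U V†))` is a positive-definite function on
  `SU(3)` (power series with positive coefficients in the positive-definite function `Re tr = (χ₃ + χ₃̄)/2`), the
  Gauss-law projection commutes with it, and flat-cube indicators are slice-multiplication operators commuting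
  with the projection; Schatten–Hölder with all exponents `2S+1` holds for any number of factors. Edge cases:
  `X = ∅` needs `μ(univ) ≤ 1` (probability measure); `q = 0` makes the hypothesis fail for `θ > 0` (column events
  are open and contain `U = 1`), vacuous. No kill.
* `stub_column : ColumnPatternCost` — no kill; CONSTANT CHECK. The cheapest all-flat mechanism is NOT the
  uniform cold ball but `SU(2)`-REDUCIBILITY: a slice whose spatial links fix a common colour vector (e.g. lie in
  `SU(2) ⊂ SU(3)`) has EVERY spatial cube EXACTLY flat at typical `SU(2)` action (the planner's own triage
  remark). Flatness at level `(400β)⁻¹` needs the `10–11` physical d.o.f. per site transverse to the gauge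
  orbit of the `SU(2)`-valued slice configurations (`24 − 13` per site; `16 − 6` counting physical d.o.f.)
  within `ε² ≈ g₀²/600` of zero: Gaussian small-ball cost `≈ 11 × ½ log 600 ≈ 32–35` nats per cube (an
  ESTIMATE, propagator factors ignored), still `> 8`; the
  exact-flatness locus has codimension `21` (`5` holonomies each in a stabiliser `SU(2)`, codim `5`, minus `4` for
  the line in `ℂP²`), not `26`, so the generic small-ball estimate is `δ^{10.5} ∈ [e^{−50}, e^{−26}]`, not
  `δ^{13}`: margin intact but thinner than the line card's Numbers §N2. MONTE-CARLO TEST RUN THIS CYCLE (kit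
  `j013959`, auto-attached `compute-j013959.json`; quenched `SU(3)` Metropolis on `6⁴`, 40 configurations × 1296
  spatial cubes per coupling, self-checks: gauge invariance `5·10⁻¹⁵`, plaquette `0.5955(35)` at `β_W = 6.0` /
  `0.6458(31)` at `6.6` vs known `0.594` / `0.644`): `βΦ³` (tree `β = β_W/3` × bottom of the `24×24` cube Laplacian
  in the skeleton's normalisation) has median `0.082` (`β_W = 6.0`) / `0.077` (`6.6`) — INSIDE the predicted typical
  range `[0.03, 0.3]` — quantiles `10⁻⁴ ↦ 0.018/0.020`, `10⁻² ↦ 0.036/0.034`, minimum over `51840` cubes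
  `0.0144/0.0146`; NO cube below `1/100`, none below `flatLevel = 1/400`; the two couplings agree (β-independence of
  the relative event, as claimed); lower-tail fit `CDF ∝ x^{6.5}` on the lowest 5% (fatter than the small-ball
  `x^{10.5}` at these depths) extrapolates to `log P(βΦ³ ≤ 1/400) ≈ −22 < −8`. VERDICT: `stub_column`'s constants
  SURVIVE the single-cube marginal test with ≈ 14 nats to spare (caveats: marginal only — column events are
  `(2S+1)`-fold and positively correlated in time; extrapolation beyond the sampled tail; `6⁴`).
* `stub_geometry : FlatCubeDichotomy` — TRUE for `n ≤ 3` by one line (content begins at `n = 4`): the averaging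
  identities `Σ_y E_y(ψ) ≤ 4λ‖ψ‖²` (each spatial link in `4` cubes, temporal terms dropped) and
  `Σ_y M_y(ψ) = 8‖ψ‖²` give flat cubes carrying cube-mass `≥ 4‖ψ‖² > 0`, hence ONE `λ`-flat cube `y` with
  `ψ ≠ 0` at a corner; `t := y` serves since `n⁴/128 < 1` for `n ≤ 3`. For `n ≥ 4` the Poincaré step is needed;
  the discrete Neumann constant of the `(n+1)`-path is `1/(2(1 − cos(π/(n+1)))) ≤ n²/4` for `n ≥ 2`
  (`= 1/2 > 1/4` at `n = 1`, irrelevant there), inside the stated tolerance `C_P < 6n²`. No counterexample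
  mechanism found (isolated flat cubes + smooth `|ψ|` lose half the mass by Poincaré). No kill.
* `KyFanCounting` (internal target) — TRUE as stated (Schur compression trace `< kη` vs Ky Fan minimum
  `≥ (k − j)·2η`; `η ≤ 0` gives `k = 0`).
* `stub_transfer : TransferStmt` — FLANK (misstated scope, not a kill): it asserts `PQFlatLD N_f reg` for EVERY
  mass-scaling, asymptotically scaling `reg`, including lines deep in the hole (`m_crit ≡ −4`, where
  `D_W(1, −4, 1)` has six exactly massless doublers and `|det|` is critical and non-local in `U`); the "one nat
  per cube" heuristic (one-loop sea shift `O(N_f g₀²)` per plaquette) is argued only near the physical line.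
  Recommended reshape: restrict to the witness class actually used (`SubGaussianVolume ∧` edge at the `g₀²`
  scale, `cE ≤ −m_crit(k) β_k ≤ CE`, as the kato line's PINS), or to `reg` with `m_crit(k) → 0`.
* `stub_edge : EdgeWitnessStmt` — LOGICAL SHAPE FLAG: `PQFlatLD N_f reg` sits as a HYPOTHESIS inside
  `∃ reg …, ∀ m > M₀, PQFlatLD N_f reg → (Tight ∧ (DeepExtinctAt → Extinct))`; hence the stub is inhabited by
  ANY admissible sub-Gaussian `reg` for which `PQFlatLD N_f reg` is FALSE — a vacuous closure the composition
  `sdHyp_of_stubs` would only notice through `stub_transfer`. No such `reg` is exhibited here (falsifying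
  `PQFlatLD` at an admissible `reg` needs a tilted flat-block frequency `> e^{−7}` per cube eventually in `k`,
  against a gauge-sector rate `≈ e^{−30}`), but the honest form is `∃ reg …, PQFlatLD N_f reg ∧ ∀ m > M₀, …` or
  `PQFlatLD` moved to the composition. The stub's CONTENT (TIGHT at the physical edge for a capped witness +
  the band + clause (b)) is the crux's own open content (§6 `resists_pathwise`).
* `stub_deep : DeepFromFlatStmt` — conditional bookkeeping (Ky Fan + IMS + union bound); plausible modulo
  effort; the IMS localisation error for the LATTICE form must be checked against `flatLevel = 4·deepConst`
  (factor `4` = Ky Fan `2` × IMS `2`): tight but consistent as stated.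
Other lines: free-volume-heavy-witness — UPDATE: this is the line the lead PICKED (`PICKED.md`); its S1–S4 are
classical truths (lower semicontinuity of `n₋` — candidate `DrefuteS1Proof.lean`; rank-`r` determinant ratio
`(1 + 8/μ)^{±r}`; Combes–Thomas via the numerical range `Re(D_W + μ) ≥ μ`; Kolmogorov–Rogozin — PROVED,
`DrefuteS4Proof.lean`), and S5 `stub_activeGoodCores` is classified STUB-MISSTATED by the drefute seats gen 1 / gen 2
(`NegativeNote-ActiveGoodCoresAbundant(-gen2).md`: false generically as typed — `∃ (R,Tp,Tm)` before `∀ m` with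
zero-tolerance exactness over refills of all other cores; corrected repair C″ `Drefute2.ActiveGoodCoresAbundant''`
with `∀ m` first, robustness relative to the active set and an odds floor); this seat adds nothing on S5 and takes the
lead's stuck stubs as `-- Targets` on re-arm; kato-radius
`stub_katoBudgetRadius` (`c₀ ≈ 0.33`) survives with the IMS edge term oriented so that the `f²|∇χ|²` factor sits
at the endpoint OUTSIDE `B_R` (possible edge by edge), as the docstring's "mass outside radius `R`" requires. -/
theorem registered_skeleton_audit : True := trivial

/-- **Literature, cycle 2.** Searches for kill criterion (i) of the route (sign-defect frequency per FIXED
physical volume NOT decreasing along finer lattice spacings): `lit search "negative Wilson fermion determinant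
sign strange quark lattice spacing reweighting frequency" --year-from 2019` (local FTS unavailable, OpenAlex /
S2 / arXiv HTTP 429, Crossref 15 rows: Mohler–Schaefer PRD 102 (2020) 074506 again; factorisation papers
Giusti–Saccardi PLB 2022, Wenger PoS LATTICE2022 042; CLS quark-mass proceedings PoS LATTICE2019 220 /
LATTICE2025 210 — none reports the trend at `β = 3.85`); `lit search … --source zbmath` (0). search-degraded:
no new datum either way; the only measured trend remains MS2020 §4.2 (decreasing `2% → 0.05%`, `β = 3.4 → 3.7`). -/
theorem literature_notes_cycle2 : True := trivial

/-! ## §10 (cycle 2) TIGHTNESS OF CLAUSE (b): the window constant is pinned, `c ≤ 1`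

(PARALLEL DERIVATION NOTICE: obtained independently and simultaneously by the sibling 8968 disprover —
`Cruxes/ExtinctionBuildsQCD/Disproof.lean` §6 `c_le_one_of_extinct_tight`, landing as
`Theorems/ExtinctionBuildsQCD/Negative/CoercivityCeiling.lean`, UNCONDITIONAL there via the landed root-count
measurability `countMeas_measurable_countP` of `Theorems/SpectralDefectExtinctionTipPricingStubCountMeasurable.lean`;
the landing copy of this section, `Theorems/WindowExtinction/Negative/WindowConstantLeOne.lean`, discharges the
measurability hypothesis the same way (`countsAEMeasurable`, `windowConstant_le_one'`,
`not_windowExtinction_with_one_lt`) — ported verbatim below.)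

The index change of `H_W` across `[m₁, m₂]` is carried by SMALL EIGENVALUES OF `H_W` AT ANY INTERMEDIATE MASS
(`abs_negCount_sub_le_countP_abs_le`: four counting-Weyl steps + trichotomy; no eigenvalue continuity, no
simplicity). With `m₁` = TIGHT's probe `m_crit − a_kM/Z_k`, `m₀` = the bare mass `m_crit + a_km_f/Z_k` of one
flavour and `m₂ = m₀ + a_k(m_f+M)/Z_k` (index there ≤ clause-(a) count): PATHWISE
`|TIGHT integrand| ≤ count_a(f) + #{e ∈ spec H_W(m_f(k)) : |e| ≤ a_k(m_f + M)/Z_k}`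
(`abs_index_le_signDefects_add_coercivityBand`), hence `≤ count_a(f) + count_b(f) ≤ EXTINCT integrand` as soon as
`c > 1 + M/m_f` (`tightIntegrand_le_extinctIntegrand`). So every witness with integrable EXTINCT integrands has
`c ≤ 1` (`windowConstant_le_one`, hypothesis = a.e.-strong MEASURABILITY of the defect counts only — TIGHT
itself makes the weight integrable; at `c > 1`: `1 ≤ tightRatio ≤ extinctRatio(S = L_k) ≤ 1/2`). The crux asks
only `∃ c > 0` — nothing is refuted — but clause (b) is SHARP AT `c = 1`: the level TIGHT forces through zero
within `a_k(m_f+M)/Z_k` of the bare mass is the lattice shadow of the continuum zero modes (`|γ₅(D+m)| = m`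
exactly on them); "statistical Vafa–Witten coercivity" can at best reach the free value. `CountsAEMeasurable` =
measurability of the two root counts in `U`, the debt every `E₊` statement of the route owes. Landing copy: `Theorems/WindowExtinction/Negative/WindowConstantLeOne.lean` (against the landed
`IndexBudget.abs_index_le_realModeCount`, `VolumeLever.tightRatio`; proposal filed this cycle). -/

/-! ## §1 Abstract: the index change across `[m₁, m₂]` is carried by small eigenvalues of `H(m₀)` -/

section WCAbstract

variable {n : Type*} [Fintype n] [DecidableEq n]

/-- **Three Hermitian matrices: the negative-count change from `A₁` to `A₂` is carried by small
eigenvalues of `A₀`.** If `|Re v†(A₁ − A₀)v| ≤ δ₁‖v‖²` and `|Re v†(A₂ − A₀)v| ≤ δ₂‖v‖²` (`δ₁, δ₂ ≥ 0`), then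
`|#{λ(A₁) < 0} − #{λ(A₂) < 0}| ≤ #{|λ(A₀)| ≤ max δ₁ δ₂}`. Proof: counting-Weyl (`card_filter_lt_neg_le`)
gives `#{λ(A₂) < 0} ≥ #{λ(A₀) < −δ₂}` and `#{λ(A₁) > 0} ≥ #{λ(A₀) > δ₁}`, so
`#{λ(A₁) < 0} − #{λ(A₂) < 0} ≤ n − #{λ(A₀) > δ₁} − #{λ(A₀) < −δ₂} ≤ #{−δ₂ ≤ λ(A₀) ≤ δ₁}`; symmetrically. [folklore] -/
theorem abs_card_neg_sub_card_neg_le {A₀ A₁ A₂ : Matrix n n ℂ} (h₀ : A₀.IsHermitian) (h₁ : A₁.IsHermitian)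
    (h₂ : A₂.IsHermitian) {δ₁ δ₂ : ℝ} (hδ₁ : 0 ≤ δ₁) (hδ₂ : 0 ≤ δ₂)
    (hE₁ : ∀ v : n → ℂ, |(star v ⬝ᵥ (A₁ - A₀) *ᵥ v).re| ≤ δ₁ * ∑ i, ‖v i‖ ^ 2)
    (hE₂ : ∀ v : n → ℂ, |(star v ⬝ᵥ (A₂ - A₀) *ᵥ v).re| ≤ δ₂ * ∑ i, ‖v i‖ ^ 2) :
    |((Finset.univ.filter fun i => h₁.eigenvalues i < 0).card : ℤ) -
        ((Finset.univ.filter fun i => h₂.eigenvalues i < 0).card : ℤ)| ≤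
      ((Finset.univ.filter fun i => |h₀.eigenvalues i| ≤ max δ₁ δ₂).card : ℤ) := by
  -- the four counting steps, all with `A := A₀`
  have s1 := card_filter_lt_neg_le h₀ h₁ (σ := 1) (δ := δ₁) (Or.inl rfl) hE₁
  have s2 := card_filter_lt_neg_le h₀ h₁ (σ := -1) (δ := δ₁) (Or.inr rfl) hE₁
  have s3 := card_filter_lt_neg_le h₀ h₂ (σ := 1) (δ := δ₂) (Or.inl rfl) hE₂
  have s4 := card_filter_lt_neg_le h₀ h₂ (σ := -1) (δ := δ₂) (Or.inr rfl) hE₂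
  have e1 : (Finset.univ.filter fun i => (1 : ℝ) * h₀.eigenvalues i < -δ₁) =
      Finset.univ.filter fun i => h₀.eigenvalues i < -δ₁ :=
    Finset.filter_congr fun i _ => by rw [one_mul]
  have e2 : (Finset.univ.filter fun i => (-1 : ℝ) * h₀.eigenvalues i < -δ₁) =
      Finset.univ.filter fun i => δ₁ < h₀.eigenvalues i :=
    Finset.filter_congr fun i _ => by rw [neg_one_mul, neg_lt_neg_iff]
  have e3 : (Finset.univ.filter fun i => (1 : ℝ) * h₀.eigenvalues i < -δ₂) =
      Finset.univ.filter fun i => h₀.eigenvalues i < -δ₂ :=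
    Finset.filter_congr fun i _ => by rw [one_mul]
  have e4 : (Finset.univ.filter fun i => (-1 : ℝ) * h₀.eigenvalues i < -δ₂) =
      Finset.univ.filter fun i => δ₂ < h₀.eigenvalues i :=
    Finset.filter_congr fun i _ => by rw [neg_one_mul, neg_lt_neg_iff]
  have f1 : (Finset.univ.filter fun i => (1 : ℝ) * h₁.eigenvalues i < 0) =
      Finset.univ.filter fun i => h₁.eigenvalues i < 0 :=
    Finset.filter_congr fun i _ => by rw [one_mul]
  have f2 : (Finset.univ.filter fun i => (-1 : ℝ) * h₁.eigenvalues i < 0) =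
      Finset.univ.filter fun i => 0 < h₁.eigenvalues i :=
    Finset.filter_congr fun i _ => by rw [neg_one_mul, neg_lt_zero]
  have f3 : (Finset.univ.filter fun i => (1 : ℝ) * h₂.eigenvalues i < 0) =
      Finset.univ.filter fun i => h₂.eigenvalues i < 0 :=
    Finset.filter_congr fun i _ => by rw [one_mul]
  have f4 : (Finset.univ.filter fun i => (-1 : ℝ) * h₂.eigenvalues i < 0) =
      Finset.univ.filter fun i => 0 < h₂.eigenvalues i :=
    Finset.filter_congr fun i _ => by rw [neg_one_mul, neg_lt_zero]
  rw [e1, f1] at s1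
  rw [e2, f2] at s2
  rw [e3, f3] at s3
  rw [e4, f4] at s4
  -- trichotomies (negative and positive eigenvalues are disjoint subsets of `univ`)
  have t₁ : (Finset.univ.filter fun i => h₁.eigenvalues i < 0).card +
      (Finset.univ.filter fun i => 0 < h₁.eigenvalues i).card ≤ Fintype.card n := by
    rw [← Finset.card_union_of_disjoint (Finset.disjoint_filter.2 fun i _ h h' => by linarith),
      ← Finset.card_univ]
    exact Finset.card_le_card (Finset.subset_univ _)
  have t₂ : (Finset.univ.filter fun i => h₂.eigenvalues i < 0).card +
      (Finset.univ.filter fun i => 0 < h₂.eigenvalues i).card ≤ Fintype.card n := by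
    rw [← Finset.card_union_of_disjoint (Finset.disjoint_filter.2 fun i _ h h' => by linarith),
      ← Finset.card_univ]
    exact Finset.card_le_card (Finset.subset_univ _)
  -- the band count dominates the complements of the two pairs of far sets
  have cover : ∀ {a b : ℝ}, 0 ≤ a → 0 ≤ b → a ≤ max δ₁ δ₂ → b ≤ max δ₁ δ₂ →
      Fintype.card n ≤ (Finset.univ.filter fun i => a < h₀.eigenvalues i).card +
        (Finset.univ.filter fun i => h₀.eigenvalues i < -b).card +
          (Finset.univ.filter fun i => |h₀.eigenvalues i| ≤ max δ₁ δ₂).card := by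
    intro a b ha hb haℓ hbℓ
    rw [← Finset.card_univ]
    have hcov : (Finset.univ : Finset n) ⊆
        (Finset.univ.filter fun i => a < h₀.eigenvalues i) ∪
          (Finset.univ.filter fun i => h₀.eigenvalues i < -b) ∪
            (Finset.univ.filter fun i => |h₀.eigenvalues i| ≤ max δ₁ δ₂) := by
      intro i _
      simp only [Finset.mem_union, Finset.mem_filter, Finset.mem_univ, true_and]
      by_cases hgt : a < h₀.eigenvalues i
      · exact Or.inl (Or.inl hgt)
      · by_cases hlt : h₀.eigenvalues i < -b
        · exact Or.inl (Or.inr hlt)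
        · exact Or.inr (abs_le.2 ⟨by linarith [not_lt.1 hlt], by linarith [not_lt.1 hgt]⟩)
    calc (Finset.univ : Finset n).card ≤ _ := Finset.card_le_card hcov
      _ ≤ _ := Finset.card_union_le _ _
      _ ≤ _ := add_le_add (Finset.card_union_le _ _) le_rfl
  have band := cover hδ₁ hδ₂ (le_max_left _ _) (le_max_right _ _)
  have band' := cover hδ₂ hδ₁ (le_max_right _ _) (le_max_left _ _)
  rw [abs_le]
  constructor <;> omega

variable {Γ D : Matrix n n ℂ}

/-- **The index change across `[m₁, m₂]` is carried by small eigenvalues of `H(m₀)`.** For the Hermitian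
pencil `H(m) = ΓD + mΓ` (`Γ` Hermitian unitary, `ΓD` Hermitian) and `m₁ ≤ m₀ ≤ m₂`:
`|n₋(H(m₁)) − n₋(H(m₂))| ≤ #{eigenvalues e of H(m₀), |e| ≤ max (m₀ − m₁) (m₂ − m₀)}` (counts as
characteristic roots; `|Re v†(H(m) − H(m₀))v| ≤ |m − m₀| ‖v‖²`, landed `pencil_diff_bound`). [folklore] -/
theorem abs_negCount_sub_le_countP_abs_le (hΓ : Γᴴ = Γ) (hΓ2 : Γ * Γ = 1) (hD : (Γ * D)ᴴ = Γ * D)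
    {m₁ m₀ m₂ : ℝ} (hle₁ : m₁ ≤ m₀) (hle₂ : m₀ ≤ m₂) :
    |((Γ * D + (m₁ : ℂ) • Γ).charpoly.roots.countP (fun z => z.re < 0) : ℤ) -
        ((Γ * D + (m₂ : ℂ) • Γ).charpoly.roots.countP (fun z => z.re < 0) : ℤ)| ≤
      ((Γ * D + (m₀ : ℂ) • Γ).charpoly.roots.countP
        (fun z => |z.re| ≤ max (m₀ - m₁) (m₂ - m₀)) : ℤ) := by
  have hd₁ : |m₁ - m₀| = m₀ - m₁ := by rw [abs_sub_comm]; exact abs_of_nonneg (by linarith)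
  have hd₂ : |m₂ - m₀| = m₂ - m₀ := abs_of_nonneg (by linarith)
  have hE₁ := fun v => pencil_diff_bound (D := D) hΓ hΓ2 m₀ m₁ v
  have hE₂ := fun v => pencil_diff_bound (D := D) hΓ hΓ2 m₀ m₂ v
  simp only [hd₁] at hE₁
  simp only [hd₂] at hE₂
  have h := abs_card_neg_sub_card_neg_le (pencil_isHermitian hΓ hD m₀) (pencil_isHermitian hΓ hD m₁)
    (pencil_isHermitian hΓ hD m₂) (by linarith) (by linarith) hE₁ hE₂
  rw [countP_roots_eq_card_filter (pencil_isHermitian hΓ hD m₁) (· < 0),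
    countP_roots_eq_card_filter (pencil_isHermitian hΓ hD m₂) (· < 0),
    countP_roots_eq_card_filter (pencil_isHermitian hΓ hD m₀) (fun x => |x| ≤ max (m₀ - m₁) (m₂ - m₀))]
  exact h

end WCAbstract

/-! ## §2 Wilson fermions: TIGHT integrand ≤ clause (a) + small eigenvalues of `H_W` at the bare mass -/

section WCWilson

variable {L : ℕ} [NeZero L]

/-- **Index change of `H_W` across `[m₁, m₂]` ≤ eigenvalues of `H_W(m₀)` within the half-width of zero**
(every `SU(3)` gauge field; `m₁ ≤ m₀ ≤ m₂`). [folklore] -/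
theorem abs_negCount_hermitianWilson_sub_le_countP_abs_le (U : GaugeConfig 4 L SU3) {m₁ m₀ m₂ : ℝ}
    (h₁ : m₁ ≤ m₀) (h₂ : m₀ ≤ m₂) :
    |((spinorLift gammaFive * wilsonDirac (fundamentalRep (Fin 3)) U m₁ 1).charpoly.roots.countP
          (fun z : ℂ => z.re < 0) : ℤ) -
        ((spinorLift gammaFive * wilsonDirac (fundamentalRep (Fin 3)) U m₂ 1).charpoly.roots.countP
          (fun z : ℂ => z.re < 0) : ℤ)| ≤
      ((spinorLift gammaFive * wilsonDirac (fundamentalRep (Fin 3)) U m₀ 1).charpoly.roots.countP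
        (fun z : ℂ => |z.re| ≤ max (m₀ - m₁) (m₂ - m₀)) : ℤ) := by
  have hρ : ∀ g : SU3, fundamentalRep (Fin 3) g ∈ Matrix.unitaryGroup (Fin 3) ℂ :=
    fundamentalRep_mem_unitaryGroup
  rw [hermitianWilsonDirac_eq_pencil _ hρ U m₁, hermitianWilsonDirac_eq_pencil _ hρ U m₂,
    hermitianWilsonDirac_eq_pencil _ hρ U m₀]
  exact abs_negCount_sub_le_countP_abs_le
    Literature.Barriers.QuantumFields.WilsonDeterminant.conjTranspose_spinorLift_gammaFive
    spinorLift_gammaFive_mul_self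
    (Literature.Barriers.QuantumFields.WilsonDeterminant.isHermitian_hermitianWilsonDirac _ hρ U 0 1) h₁ h₂

/-- **TIGHT integrand ≤ sign defects + coercivity band AT THE BARE MASS.** For a line `m_crit`, a flavour
window `w_f > 0` (bare mass `m_crit + w_f`) and a probe depth `w_M ≥ 0`, on every `SU(3)` gauge field:
`|n₋(Γ₅D_W(U, m_crit − w_M, 1)) − 6L⁴| ≤ #{real λ ∈ spec D_W(U,0,1), λ < −(m_crit + w_f)}`
`+ #{e ∈ spec Γ₅D_W(U, m_crit + w_f, 1), |e| ≤ w_f + w_M}` — triangle through the mass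
`m₂ = m_crit + 2w_f + w_M` (index there ≤ real modes `≤ −m₂ < −(m_crit + w_f)`, landed
`abs_index_le_realModeCount`) and §1 on `[m_crit − w_M, m₂]` about `m₀ = m_crit + w_f`. [folklore] -/
theorem abs_index_le_signDefects_add_coercivityBand (U : GaugeConfig 4 L SU3) (mcrit wf wM : ℝ)
    (hwf : 0 < wf) (hwM : 0 ≤ wM) :
    |((spinorLift gammaFive * wilsonDirac (fundamentalRep (Fin 3)) U (mcrit - wM) 1).charpoly.roots.countP
          (fun z : ℂ => z.re < 0) : ℤ) - 6 * (L : ℤ) ^ 4| ≤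
      ((wilsonDirac (fundamentalRep (Fin 3)) U 0 1).charpoly.roots.countP
          (fun z : ℂ => z.im = 0 ∧ z.re < -(mcrit + wf)) : ℤ) +
        ((spinorLift gammaFive * wilsonDirac (fundamentalRep (Fin 3)) U (mcrit + wf) 1).charpoly.roots.countP
          (fun z : ℂ => |z.re| ≤ wf + wM) : ℤ) := by
  set m₂ := mcrit + 2 * wf + wM with hm₂
  have hband := abs_negCount_hermitianWilson_sub_le_countP_abs_le U
    (m₁ := mcrit - wM) (m₀ := mcrit + wf) (m₂ := m₂) (by linarith) (by linarith)
  have hmax : max (mcrit + wf - (mcrit - wM)) (m₂ - (mcrit + wf)) = wf + wM := by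
    rw [hm₂, max_eq_left (by linarith)]; ring
  rw [hmax] at hband
  have hidx := Summit.QuantumFields.QCD.Theorems.ExtinctionBuildsQCD.Negative.abs_index_le_realModeCount U m₂
  have hlt₂ : -m₂ < -(mcrit + wf) := by rw [hm₂]; linarith
  have hmono : ((wilsonDirac (fundamentalRep (Fin 3)) U 0 1).charpoly.roots.countP
      (fun z : ℂ => z.im = 0 ∧ z.re ≤ -m₂) : ℤ) ≤
      ((wilsonDirac (fundamentalRep (Fin 3)) U 0 1).charpoly.roots.countP
        (fun z : ℂ => z.im = 0 ∧ z.re < -(mcrit + wf)) : ℤ) := by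
    exact_mod_cast countP_mono_pred
      (wilsonDirac (fundamentalRep (Fin 3)) U 0 1).charpoly.roots
      (p := fun z : ℂ => z.im = 0 ∧ z.re ≤ -m₂) (q := fun z : ℂ => z.im = 0 ∧ z.re < -(mcrit + wf))
      fun z hz => ⟨hz.1, lt_of_le_of_lt hz.2 hlt₂⟩
  -- triangle inequality
  have htri : |((spinorLift gammaFive * wilsonDirac (fundamentalRep (Fin 3)) U (mcrit - wM) 1).charpoly.roots.countP
          (fun z : ℂ => z.re < 0) : ℤ) - 6 * (L : ℤ) ^ 4| ≤
      |((spinorLift gammaFive * wilsonDirac (fundamentalRep (Fin 3)) U (mcrit - wM) 1).charpoly.roots.countP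
            (fun z : ℂ => z.re < 0) : ℤ) -
          ((spinorLift gammaFive * wilsonDirac (fundamentalRep (Fin 3)) U m₂ 1).charpoly.roots.countP
            (fun z : ℂ => z.re < 0) : ℤ)| +
        |((spinorLift gammaFive * wilsonDirac (fundamentalRep (Fin 3)) U m₂ 1).charpoly.roots.countP
            (fun z : ℂ => z.re < 0) : ℤ) - 6 * (L : ℤ) ^ 4| := by
    have := abs_sub_le
      ((spinorLift gammaFive * wilsonDirac (fundamentalRep (Fin 3)) U (mcrit - wM) 1).charpoly.roots.countP
          (fun z : ℂ => z.re < 0) : ℤ)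
      ((spinorLift gammaFive * wilsonDirac (fundamentalRep (Fin 3)) U m₂ 1).charpoly.roots.countP
          (fun z : ℂ => z.re < 0) : ℤ)
      (6 * (L : ℤ) ^ 4)
    exact this
  linarith

/-- **… hence ≤ the clause-(a) + clause-(b) counts of ONE flavour whenever `c w_f > w_f + w_M`**
(`c > 1 + M/m_f` in the crux's parameters: `w_f = a_k m_f/Z_k`, `w_M = a_k M/Z_k`). [folklore] -/
theorem abs_index_le_signDefects_add_coercivityDefects (U : GaugeConfig 4 L SU3) (mcrit wf wM c : ℝ)
    (hwf : 0 < wf) (hwM : 0 ≤ wM) (hc : wf + wM < c * wf) :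
    |((spinorLift gammaFive * wilsonDirac (fundamentalRep (Fin 3)) U (mcrit - wM) 1).charpoly.roots.countP
          (fun z : ℂ => z.re < 0) : ℤ) - 6 * (L : ℤ) ^ 4| ≤
      ((wilsonDirac (fundamentalRep (Fin 3)) U 0 1).charpoly.roots.countP
          (fun z : ℂ => z.im = 0 ∧ z.re < -(mcrit + wf)) : ℤ) +
        ((spinorLift gammaFive * wilsonDirac (fundamentalRep (Fin 3)) U (mcrit + wf) 1).charpoly.roots.countP
          (fun z : ℂ => |z.re| < c * wf) : ℤ) := by
  refine (abs_index_le_signDefects_add_coercivityBand U mcrit wf wM hwf hwM).trans (add_le_add le_rfl ?_)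
  exact_mod_cast countP_mono_pred
    (spinorLift gammaFive * wilsonDirac (fundamentalRep (Fin 3)) U (mcrit + wf) 1).charpoly.roots
    (p := fun z : ℂ => |z.re| ≤ wf + wM) (q := fun z : ℂ => |z.re| < c * wf)
    fun z hz => lt_of_le_of_lt hz hc

end WCWilson

/-! ## §3 The crux's ratios: `c ≤ 1` for every witness with an integrable EXTINCT integrand -/

section WCCrux

variable {Nf : ℕ}

/-- The clause-(a) + clause-(b) DEFECT COUNT of the crux at step `k` on the torus of half-side `L'`, summed over
flavours (verbatim; an `ℕ`-valued quantity cast to `ℝ`). -/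
def defectCountSum (reg : QCDRegularisation Nf) (c : ℝ) (m : Fin Nf → ℝ) (k L' : ℕ)
    (U : GaugeConfig 4 (2 * L' + 1) SU3) : ℝ :=
  ∑ f : Fin Nf, ((Multiset.countP (fun z : ℂ => z.im = 0 ∧ z.re < -(reg.mcrit k + reg.a k * m f / reg.Zm k)) (wilsonDirac (fundamentalRep (Fin 3)) U 0 1).charpoly.roots : ℝ) + (Multiset.countP (fun z : ℂ => |z.re| < c * (reg.a k * m f / reg.Zm k)) (spinorLift gammaFive * wilsonDirac (fundamentalRep (Fin 3)) U (reg.mcrit k + reg.a k * m f / reg.Zm k) 1).charpoly.roots : ℝ))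

/-- The phase-quenched WEIGHT `∏_f |det D_W(U, m_f(k), 1)|` (verbatim). -/
def pqWeight (reg : QCDRegularisation Nf) (m : Fin Nf → ℝ) (k L' : ℕ) (U : GaugeConfig 4 (2 * L' + 1) SU3) : ℝ :=
  ∏ f : Fin Nf, ‖fermionDet (wilsonDirac (fundamentalRep (Fin 3)) U (reg.mcrit k + reg.a k * m f / reg.Zm k) 1)‖

/-- The EXTINCT integrand of the crux at step `k` on the torus of half-side `L'` (verbatim numerator:
defect count × weight). -/
def extinctIntegrand (reg : QCDRegularisation Nf) (c : ℝ) (m : Fin Nf → ℝ) (k L' : ℕ)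
    (U : GaugeConfig 4 (2 * L' + 1) SU3) : ℝ :=
  defectCountSum reg c m k L' U * pqWeight reg m k L' U

/-- The TIGHT integrand of the crux at step `k`, probe parameter `M`, on the torus of half-side `L'`. -/
def tightIntegrand (reg : QCDRegularisation Nf) (m : Fin Nf → ℝ) (M : ℝ) (k L' : ℕ)
    (U : GaugeConfig 4 (2 * L' + 1) SU3) : ℝ :=
  |(Multiset.countP (fun z : ℂ => z.re < 0) (spinorLift gammaFive * wilsonDirac (fundamentalRep (Fin 3)) U (reg.mcrit k - reg.a k * M / reg.Zm k) 1).charpoly.roots : ℝ) - 6 * (2 * L' + 1 : ℝ) ^ 4| * pqWeight reg m k L' U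

/-- `Extinct` through `extinctIntegrand` (definitional). -/
theorem extinct_iff_extinctIntegrand (reg : QCDRegularisation Nf) (c : ℝ) (m : Fin Nf → ℝ) :
    (Summit.QuantumFields.QCD.Theorems.ExtinctionBuildsQCD.Negative.Extinct Nf reg c m) ↔ ∀ ε : ℝ, 0 < ε → ∀ᶠ k : ℕ in Filter.atTop, ∀ S : ℕ, reg.L k ≤ S →
      (∫ U, extinctIntegrand reg c m k S U ∂(wilsonMeasure (d := 4) (L := 2 * S + 1) (fundamentalRep (Fin 3)) (reg.β k))) /
        (∫ U, pqWeight reg m k S U ∂(wilsonMeasure (d := 4) (L := 2 * S + 1) (fundamentalRep (Fin 3)) (reg.β k)))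
      ≤ ε * ((2 * S + 1 : ℝ) / (2 * reg.L k + 1)) ^ 4 :=
  Iff.rfl

/-- The landed `VolumeLever.tightRatio` through `tightIntegrand` (definitional). -/
theorem tightRatio_landed_eq (reg : QCDRegularisation Nf) (k L' : ℕ) (m : Fin Nf → ℝ) (M : ℝ) :
    Summit.QuantumFields.QCD.Theorems.ExtinctionBuildsQCD.Negative.tightRatio reg k L' m M =
      (∫ U, tightIntegrand reg m M k L' U ∂(wilsonMeasure (d := 4) (L := 2 * L' + 1) (fundamentalRep (Fin 3)) (reg.β k))) /
        (∫ U, pqWeight reg m k L' U ∂(wilsonMeasure (d := 4) (L := 2 * L' + 1) (fundamentalRep (Fin 3)) (reg.β k))) :=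
  rfl

/-- The weight is non-negative. -/
theorem pqWeight_nonneg (reg : QCDRegularisation Nf) (m : Fin Nf → ℝ) (k L' : ℕ)
    (U : GaugeConfig 4 (2 * L' + 1) SU3) : 0 ≤ pqWeight reg m k L' U :=
  Finset.prod_nonneg fun _ _ => norm_nonneg _

/-- The defect count is non-negative. -/
theorem defectCountSum_nonneg (reg : QCDRegularisation Nf) (c : ℝ) (m : Fin Nf → ℝ) (k L' : ℕ)
    (U : GaugeConfig 4 (2 * L' + 1) SU3) : 0 ≤ defectCountSum reg c m k L' U :=
  Finset.sum_nonneg fun _ _ => by positivity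

/-- A root count of a characteristic polynomial is at most the matrix size. [folklore] -/
theorem countP_roots_charpoly_le {ι : Type*} [Fintype ι] [DecidableEq ι] (A : Matrix ι ι ℂ) (p : ℂ → Prop)
    [DecidablePred p] : A.charpoly.roots.countP p ≤ Fintype.card ι :=
  ((Multiset.countP_le_card p _).trans (Polynomial.card_roots' _)).trans (le_of_eq A.charpoly_natDegree_eq_dim)

/-- **The defect count is bounded by the matrix size**: `≤ N_f · 2 · 12(2L'+1)⁴`. [folklore] -/
theorem defectCountSum_le (reg : QCDRegularisation Nf) (c : ℝ) (m : Fin Nf → ℝ) (k L' : ℕ)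
    (U : GaugeConfig 4 (2 * L' + 1) SU3) :
    defectCountSum reg c m k L' U ≤ Nf * (2 * Fintype.card (TorusSite 4 (2 * L' + 1) × Fin 3 × Fin 4)) := by
  unfold defectCountSum
  set n := Fintype.card (TorusSite 4 (2 * L' + 1) × Fin 3 × Fin 4) with hn
  calc _ ≤ ∑ _f : Fin Nf, ((n : ℝ) + n) := Finset.sum_le_sum fun f _ => add_le_add
          (by exact_mod_cast countP_roots_charpoly_le _ _) (by exact_mod_cast countP_roots_charpoly_le _ _)
    _ = Nf * (2 * n) := by rw [Finset.sum_const, Finset.card_univ, Fintype.card_fin, nsmul_eq_mul]; ring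

/-- **Pathwise: TIGHT integrand ≤ EXTINCT integrand** (same field, same step, same masses) as soon as some
flavour `f₀` has `c m_{f₀} > m_{f₀} + M` and positive mass. [folklore] -/
theorem tightIntegrand_le_extinctIntegrand (reg : QCDRegularisation Nf) {c : ℝ} {m : Fin Nf → ℝ} {M : ℝ}
    (f₀ : Fin Nf) (hm₀ : 0 < m f₀) (hM : 0 ≤ M) (hc : m f₀ + M < c * m f₀)
    (k L' : ℕ) (U : GaugeConfig 4 (2 * L' + 1) SU3) :
    tightIntegrand reg m M k L' U ≤ extinctIntegrand reg c m k L' U := by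
  unfold tightIntegrand extinctIntegrand defectCountSum
  refine mul_le_mul_of_nonneg_right ?_ (pqWeight_nonneg reg m k L' U)
  have haZ : 0 < reg.a k / reg.Zm k := div_pos (reg.a_pos k) (reg.Zm_pos k)
  set wf := reg.a k * m f₀ / reg.Zm k with hwf
  set wM := reg.a k * M / reg.Zm k with hwM
  have hwf0 : 0 < wf := by rw [hwf]; exact div_pos (mul_pos (reg.a_pos k) hm₀) (reg.Zm_pos k)
  have hwM0 : 0 ≤ wM := by
    rw [hwM]; exact div_nonneg (mul_nonneg (reg.a_pos k).le hM) (reg.Zm_pos k).le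
  have hcw : wf + wM < c * wf := by
    have e1 : wf + wM = reg.a k / reg.Zm k * (m f₀ + M) := by rw [hwf, hwM]; ring
    have e2 : c * wf = reg.a k / reg.Zm k * (c * m f₀) := by rw [hwf]; ring
    rw [e1, e2]
    exact mul_lt_mul_of_pos_left hc haZ
  have hZ := abs_index_le_signDefects_add_coercivityDefects U (reg.mcrit k) wf wM c hwf0 hwM0 hcw
  -- cast to ℝ
  have hR : |((Multiset.countP (fun z : ℂ => z.re < 0) (spinorLift gammaFive *
        wilsonDirac (fundamentalRep (Fin 3)) U (reg.mcrit k - wM) 1).charpoly.roots : ℕ) : ℝ) -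
        6 * (2 * L' + 1 : ℝ) ^ 4| ≤
      ((Multiset.countP (fun z : ℂ => z.im = 0 ∧ z.re < -(reg.mcrit k + wf))
          (wilsonDirac (fundamentalRep (Fin 3)) U 0 1).charpoly.roots : ℕ) : ℝ) +
        ((Multiset.countP (fun z : ℂ => |z.re| < c * wf) (spinorLift gammaFive *
          wilsonDirac (fundamentalRep (Fin 3)) U (reg.mcrit k + wf) 1).charpoly.roots : ℕ) : ℝ) := by
    have h := (Int.cast_le (R := ℝ)).2 hZ
    push_cast at h ⊢
    exact h
  refine hR.trans ?_
  have hcwf : c * wf = c * (reg.a k * m f₀ / reg.Zm k) := by rw [hwf]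
  rw [hcwf]
  refine Finset.single_le_sum (f := fun f : Fin Nf => ((Multiset.countP (fun z : ℂ => z.im = 0 ∧
      z.re < -(reg.mcrit k + reg.a k * m f / reg.Zm k)) (wilsonDirac (fundamentalRep (Fin 3)) U 0 1).charpoly.roots : ℝ) +
      (Multiset.countP (fun z : ℂ => |z.re| < c * (reg.a k * m f / reg.Zm k)) (spinorLift gammaFive *
        wilsonDirac (fundamentalRep (Fin 3)) U (reg.mcrit k + reg.a k * m f / reg.Zm k) 1).charpoly.roots : ℝ)))
    (fun f _ => by positivity) (Finset.mem_univ f₀)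

/-- Measurability of the DEFECT COUNTS in `U` on the scheme tori for the mass tuple `m` (a.e.-strong
measurability of the `ℕ`-valued root-count sum; the weights are not involved). This is the debt every `E₊`
statement of the route owes — the counts are semialgebraic in `U`, hence Borel — not proved here. -/
def CountsAEMeasurable (reg : QCDRegularisation Nf) (c : ℝ) (m : Fin Nf → ℝ) : Prop :=
  ∀ k : ℕ, AEStronglyMeasurable (defectCountSum reg c m k (reg.L k))
    (wilsonMeasure (d := 4) (L := 2 * reg.L k + 1) (fundamentalRep (Fin 3)) (reg.β k))

/-- **Measurability of the sign-defect count** `U ↦ #{real roots z of charpoly D_W(U,0,1), re z < t}`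
(landed general fact `countMeas_measurable_countP`: continuity of `U ↦ D_W(U,0,1)` and the closed exhaustion
`{im = 0, −j ≤ re ≤ t − 1/(j+1)}` of the half-line). [folklore] -/
theorem measurable_signDefectCount (L : ℕ) [NeZero L] (t : ℝ) :
    Measurable fun U : GaugeConfig 4 L SU3 => Multiset.countP (fun z : ℂ => z.im = 0 ∧ z.re < t)
      (wilsonDirac (fundamentalRep (Fin 3)) U 0 1).charpoly.roots := by
  have hA : Continuous fun U : GaugeConfig 4 L SU3 => wilsonDirac (fundamentalRep (Fin 3)) U 0 1 :=
    continuous_wilsonDirac _ (continuous_fundamentalRep (Fin 3)) 0 1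
  refine Summit.QuantumFields.QCD.Cruxes.TipPricing.HermitianFlowCoarea.countMeas_measurable_countP hA
    (fun z : ℂ => z.im = 0 ∧ z.re < t)
    (fun j => {z : ℂ | z.im = 0 ∧ -(j : ℝ) ≤ z.re ∧ z.re ≤ t - 1 / (j + 1)})
    (fun j => ?_) (fun j k hjk => ?_) (fun z => ?_)
  · exact (isClosed_eq Complex.continuous_im continuous_const).inter
      ((isClosed_le continuous_const Complex.continuous_re).inter
        (isClosed_le Complex.continuous_re continuous_const))
  · rintro z ⟨h0, h1, h2⟩
    have hk : (1 : ℝ) / (k + 1) ≤ 1 / (j + 1) :=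
      one_div_le_one_div_of_le (by positivity) (by exact_mod_cast Nat.succ_le_succ hjk)
    have hjk' : (j : ℝ) ≤ k := by exact_mod_cast hjk
    exact ⟨h0, by linarith, by linarith⟩
  · constructor
    · rintro ⟨h0, h1⟩
      obtain ⟨j₁, hj₁⟩ := exists_nat_one_div_lt (sub_pos.mpr h1)
      obtain ⟨j₂, hj₂⟩ := exists_nat_ge (-z.re)
      refine ⟨max j₁ j₂, h0, ?_, ?_⟩
      · have : (j₂ : ℝ) ≤ ((max j₁ j₂ : ℕ) : ℝ) := by exact_mod_cast le_max_right _ _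
        linarith
      · have : (1 : ℝ) / ((max j₁ j₂ : ℕ) + 1) ≤ 1 / (j₁ + 1) :=
          one_div_le_one_div_of_le (by positivity) (by exact_mod_cast Nat.succ_le_succ (le_max_left _ _))
        linarith
    · rintro ⟨j, h0, -, h2⟩
      have : (0 : ℝ) < 1 / (j + 1) := by positivity
      exact ⟨h0, by linarith⟩

/-- **Measurability of the coercivity-defect count** `U ↦ #{eigenvalues e of Γ₅ D_W(U,m₀,1), |e| < r}`
(same general fact; exhaustion `{|re| ≤ r − 1/(j+1)}`). [folklore] -/
theorem measurable_coercivityDefectCount (L : ℕ) [NeZero L] (m₀ r : ℝ) :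
    Measurable fun U : GaugeConfig 4 L SU3 => Multiset.countP (fun z : ℂ => |z.re| < r)
      (spinorLift gammaFive * wilsonDirac (fundamentalRep (Fin 3)) U m₀ 1).charpoly.roots := by
  have hA : Continuous fun U : GaugeConfig 4 L SU3 =>
      spinorLift gammaFive * wilsonDirac (fundamentalRep (Fin 3)) U m₀ 1 :=
    continuous_const.matrix_mul (continuous_wilsonDirac _ (continuous_fundamentalRep (Fin 3)) m₀ 1)
  refine Summit.QuantumFields.QCD.Cruxes.TipPricing.HermitianFlowCoarea.countMeas_measurable_countP hA
    (fun z : ℂ => |z.re| < r) (fun j => {z : ℂ | |z.re| ≤ r - 1 / (j + 1)}) (fun j => ?_)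
    (fun j k hjk => ?_) (fun z => ?_)
  · exact isClosed_le (continuous_abs.comp Complex.continuous_re) continuous_const
  · intro z hz
    simp only [Set.mem_setOf_eq] at hz ⊢
    have hk : (1 : ℝ) / (k + 1) ≤ 1 / (j + 1) :=
      one_div_le_one_div_of_le (by positivity) (by exact_mod_cast Nat.succ_le_succ hjk)
    linarith
  · constructor
    · intro h
      obtain ⟨j, hj⟩ := exists_nat_one_div_lt (sub_pos.mpr h)
      exact ⟨j, by simp only [Set.mem_setOf_eq]; linarith⟩
    · rintro ⟨j, hj⟩
      simp only [Set.mem_setOf_eq] at hj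
      have : (0 : ℝ) < 1 / (j + 1) := by positivity
      linarith

/-- **The defect counts ARE measurable**: `CountsAEMeasurable` holds for every regularisation, window
constant and mass tuple (finite sum of casts of measurable `ℕ`-valued counts). [folklore] -/
theorem countsAEMeasurable (reg : QCDRegularisation Nf) (c : ℝ) (m : Fin Nf → ℝ) :
    CountsAEMeasurable reg c m := by
  intro k
  refine Measurable.aestronglyMeasurable ?_
  unfold defectCountSum
  refine Finset.measurable_sum _ fun f _ => Measurable.add ?_ ?_
  · exact measurable_from_nat.comp (measurable_signDefectCount (2 * reg.L k + 1) _)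
  · exact measurable_from_nat.comp (measurable_coercivityDefectCount (2 * reg.L k + 1) _ _)

/-- **The window constant is pinned: `c ≤ 1`.** If `(reg, M₀, c)` satisfies EXTINCT ∧ TIGHT for every mass
tuple above `M₀ ≥ 0` (`N_f ≥ 1`) and the defect counts are measurable on the scheme tori, then `c ≤ 1`:
otherwise for `m ≡ K` large and `M = M₀ + 1`, pathwise `tightIntegrand ≤ extinctIntegrand`
(`tightIntegrand_le_extinctIntegrand`); TIGHT makes the weight integrable with positive integral (a
non-integrable weight has Bochner integral `0`), the bounded measurable count then makes the EXTINCT integrand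
integrable, and `1 ≤ tightRatio ≤ extinctRatio(S = L_k) ≤ 1/2` at a common large `k`. [folklore] -/
theorem windowConstant_le_one (hNf : 0 < Nf) (reg : QCDRegularisation Nf) {M₀ c : ℝ} (hM₀ : 0 ≤ M₀)
    (h : ∀ m : Fin Nf → ℝ, (∀ f, M₀ < m f) → (Summit.QuantumFields.QCD.Theorems.ExtinctionBuildsQCD.Negative.Extinct Nf reg c m) ∧ (Summit.QuantumFields.QCD.Theorems.ExtinctionBuildsQCD.Negative.Tight Nf reg M₀ m))
    (hC : ∀ m : Fin Nf → ℝ, (∀ f, M₀ < m f) → CountsAEMeasurable reg c m) : c ≤ 1 := by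
  by_contra hc
  rw [not_le] at hc
  -- the mass tuple and the probe
  set K : ℝ := (M₀ + 1) / (c - 1) + (M₀ + 1) with hK
  have hc1 : 0 < c - 1 := by linarith
  have hK₀ : M₀ < K := by
    have : 0 < (M₀ + 1) / (c - 1) := div_pos (by linarith) hc1
    rw [hK]; linarith
  have hKpos : 0 < K := lt_of_le_of_lt hM₀ hK₀
  have hcK : K + (M₀ + 1) < c * K := by
    have h1 : (c - 1) * K = (M₀ + 1) + (c - 1) * (M₀ + 1) := by
      rw [hK, mul_add, mul_div_cancel₀ _ hc1.ne']
    have h2 : 0 < (c - 1) * (M₀ + 1) := mul_pos hc1 (by linarith)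
    nlinarith
  set m : Fin Nf → ℝ := fun _ => K with hm
  have hmM : ∀ f, M₀ < m f := fun _ => hK₀
  obtain ⟨hE, hT⟩ := h m hmM
  have hE' := (extinct_iff_extinctIntegrand reg c m).1 hE (1 / 2) (by norm_num)
  have hT' := (Summit.QuantumFields.QCD.Theorems.ExtinctionBuildsQCD.Negative.tight_iff_tightRatio reg M₀ m).1 hT (M₀ + 1) (by linarith)
  obtain ⟨k, hEk, hTk⟩ := (hE'.and hT').exists
  have hEk' := hEk (reg.L k) le_rfl
  set μ := wilsonMeasure (d := 4) (L := 2 * reg.L k + 1) (fundamentalRep (Fin 3)) (reg.β k) with hμ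
  have hratio : (2 * (reg.L k : ℝ) + 1) / (2 * reg.L k + 1) = 1 := div_self (by positivity)
  rw [hratio, one_pow, mul_one] at hEk'
  rw [tightRatio_landed_eq] at hTk
  have htight_nonneg : 0 ≤ ∫ U, tightIntegrand reg m (M₀ + 1) k (reg.L k) U ∂μ :=
    integral_nonneg fun U => mul_nonneg (abs_nonneg _) (pqWeight_nonneg reg m k (reg.L k) U)
  -- TIGHT ⇒ the weight has positive integral, hence is integrable
  have hZpos : 0 < ∫ U, pqWeight reg m k (reg.L k) U ∂μ := by
    have hpos : 0 < (∫ U, tightIntegrand reg m (M₀ + 1) k (reg.L k) U ∂μ) /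
        ∫ U, pqWeight reg m k (reg.L k) U ∂μ := by linarith
    rcases div_pos_iff.1 hpos with h' | h'
    · exact h'.2
    · exact absurd h'.1 (not_lt.2 htight_nonneg)
  have hw : Integrable (pqWeight reg m k (reg.L k)) μ := by
    by_contra hw
    rw [integral_undef hw] at hZpos
    exact lt_irrefl _ hZpos
  -- bounded measurable count × integrable weight ⇒ integrable EXTINCT integrand
  set C : ℝ := Nf * (2 * Fintype.card (TorusSite 4 (2 * reg.L k + 1) × Fin 3 × Fin 4)) with hCdef
  have hg : Integrable (extinctIntegrand reg c m k (reg.L k)) μ := by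
    refine (hw.const_mul C).mono' ((hC m hmM k).mul hw.aestronglyMeasurable) (ae_of_all _ fun U => ?_)
    rw [Real.norm_eq_abs]
    show |defectCountSum reg c m k (reg.L k) U * pqWeight reg m k (reg.L k) U| ≤
      C * pqWeight reg m k (reg.L k) U
    rw [abs_of_nonneg (mul_nonneg (defectCountSum_nonneg reg c m k _ U) (pqWeight_nonneg reg m k _ U))]
    exact mul_le_mul_of_nonneg_right (defectCountSum_le reg c m k _ U) (pqWeight_nonneg reg m k _ U)
  -- numerators compare pathwise
  have hnum : ∫ U, tightIntegrand reg m (M₀ + 1) k (reg.L k) U ∂μ ≤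
      ∫ U, extinctIntegrand reg c m k (reg.L k) U ∂μ :=
    integral_mono_of_nonneg (Filter.Eventually.of_forall fun U =>
        mul_nonneg (abs_nonneg _) (pqWeight_nonneg reg m k (reg.L k) U)) hg
      (Filter.Eventually.of_forall fun U =>
        tightIntegrand_le_extinctIntegrand reg ⟨0, hNf⟩ hKpos (by linarith) hcK k (reg.L k) U)
  have hle : (∫ U, tightIntegrand reg m (M₀ + 1) k (reg.L k) U ∂μ) / ∫ U, pqWeight reg m k (reg.L k) U ∂μ ≤
      (∫ U, extinctIntegrand reg c m k (reg.L k) U ∂μ) / ∫ U, pqWeight reg m k (reg.L k) U ∂μ :=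
    div_le_div_of_nonneg_right hnum hZpos.le
  linarith

/-- **Crux-level form.** The strengthening of `WindowExtinction` in which the window constant exceeds `1`
— `∃ reg …, ∃ M₀ ≥ 0, ∃ c > 1, ∀ m > M₀, Extinct ∧ Tight` — is false at each `N_f ≥ 1` for every witness whose
defect counts are measurable (the route's measurability debt made explicit as a hypothesis). [folklore] -/
theorem not_sdHyp_with_one_lt (hNf : 0 < Nf) (reg : QCDRegularisation Nf) {M₀ c : ℝ} (hM₀ : 0 ≤ M₀)
    (hc : 1 < c) (hC : ∀ m : Fin Nf → ℝ, (∀ f, M₀ < m f) → CountsAEMeasurable reg c m) :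
    ¬ ∀ m : Fin Nf → ℝ, (∀ f, M₀ < m f) → (Summit.QuantumFields.QCD.Theorems.ExtinctionBuildsQCD.Negative.Extinct Nf reg c m) ∧ (Summit.QuantumFields.QCD.Theorems.ExtinctionBuildsQCD.Negative.Tight Nf reg M₀ m) :=
  fun h => absurd (windowConstant_le_one hNf reg hM₀ h hC) (not_le.2 hc)

/-- **UNCONDITIONAL: every witness of `Extinct ∧ Tight` (all tuples above `M₀`, `N_f ≥ 1`) has `c ≤ 1`.**
[folklore] -/
theorem windowConstant_le_one' (hNf : 0 < Nf) (reg : QCDRegularisation Nf) {M₀ c : ℝ} (hM₀ : 0 ≤ M₀)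
    (h : ∀ m : Fin Nf → ℝ, (∀ f, M₀ < m f) → (Summit.QuantumFields.QCD.Theorems.ExtinctionBuildsQCD.Negative.Extinct Nf reg c m) ∧ (Summit.QuantumFields.QCD.Theorems.ExtinctionBuildsQCD.Negative.Tight Nf reg M₀ m)) : c ≤ 1 :=
  windowConstant_le_one hNf reg hM₀ h fun m _ => countsAEMeasurable reg c m

/-- **`SD(N_f)` pins the window constant** (`N_f ≥ 1`): any `SDHyp N_f` witness has `c ≤ 1`; stated as the
refutation of the strengthening "`SDHyp` with `c > 1`". [folklore] -/
theorem not_sdHyp_with_one_lt' (hNf : 0 < Nf) :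
    ¬ ∃ reg : QCDRegularisation Nf, reg.HasMassScaling ∧ (reg.scheme 0 0 0).HasAsymptoticScaling ∧
      ∃ M₀ : ℝ, 0 ≤ M₀ ∧ ∃ c : ℝ, 1 < c ∧ ∀ m : Fin Nf → ℝ, (∀ f, M₀ < m f) →
        (Summit.QuantumFields.QCD.Theorems.ExtinctionBuildsQCD.Negative.Extinct Nf reg c m) ∧ (Summit.QuantumFields.QCD.Theorems.ExtinctionBuildsQCD.Negative.Tight Nf reg M₀ m) := by
  rintro ⟨reg, -, -, M₀, hM₀, c, hc, h⟩
  exact absurd (windowConstant_le_one' hNf reg hM₀ h) (not_le.2 hc)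

/-- **Crux-level: `WindowExtinction` with the window constant required `> 1` is FALSE** (verbatim clauses,
`∃ c, 1 < c ∧ …` in place of `∃ c, 0 < c ∧ …`). [folklore] -/
theorem not_windowExtinction_with_one_lt :
    ¬ ∀ Nf : ℕ, (Nf = 2 ∨ Nf = 3) → ∃ reg : QCDRegularisation Nf, reg.HasMassScaling ∧
      (reg.scheme 0 0 0).HasAsymptoticScaling ∧ ∃ M₀ : ℝ, 0 ≤ M₀ ∧ ∃ c : ℝ, 1 < c ∧
        ∀ m : Fin Nf → ℝ, (∀ f, M₀ < m f) → (Summit.QuantumFields.QCD.Theorems.ExtinctionBuildsQCD.Negative.Extinct Nf reg c m) ∧ (Summit.QuantumFields.QCD.Theorems.ExtinctionBuildsQCD.Negative.Tight Nf reg M₀ m) :=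
  fun h => not_sdHyp_with_one_lt' (Nf := 2) two_pos (h 2 (Or.inl rfl))

end WCCrux

/-! ## §11 (cycle 3, 2026-08-17) THE RESTATED CRUX SD⁺: cap exponent, the index above the line, near-tip programme

Seat `refuter-cdisprove-stmt-QuantumFields-18063-0`, first cycle on the restated item. Landing copy of §11b:
`Theorems/WindowExtinction/Negative/ProbeAboveLine.lean` (`--supports stmt-QuantumFields-18063`; p138086 ACCEPTED, commit
44252414cd11; provers: `open Summit.QuantumFields.QCD.Theorems.WindowExtinction.Negative` for `absIndex_mul_weight_le_extinct_mul`,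
`eventually_absIndexRatio_le_of_extinct`, `not_windowExtinction_probeAbove`, `index_jump_of_windowExtinction`). -/

section SDPlus

open Summit.QuantumFields.QCD.Theorems.ExtinctionBuildsQCD.Negative

variable {Nf : ℕ}

/-! ### §11a The cap exponent starts at `2` -/

/-- **No regularisation meets the volume cap with exponent `p ≤ 1`.** `a_k L_k → ∞` and `a_k → 0` are structure
fields of `QCDRegularisation`; `L_k ≤ a_k^{−p}` eventually with `p ≤ 1` would give `a_k L_k ≤ max a_k 1 ≤ 1`
eventually. So in SD⁺ the witness's cap exponent is `≥ 2`, and `a_k⁻¹ ≪ L_k ≤ a_k^{−p}`. [folklore] -/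
theorem not_cap_of_le_one (reg : QCDRegularisation Nf) {p : ℕ} (hp : p ≤ 1) :
    ¬ ∀ᶠ k : ℕ in Filter.atTop, (reg.L k : ℝ) ≤ (reg.a k)⁻¹ ^ p := by
  intro hcap
  have ha1 : ∀ᶠ k : ℕ in Filter.atTop, reg.a k ≤ 1 :=
    (reg.tendsto_a.eventually (gt_mem_nhds one_pos)).mono fun k hk => hk.le
  have hbig : ∀ᶠ k : ℕ in Filter.atTop, (2 : ℝ) ≤ reg.a k * reg.L k :=
    reg.tendsto_L.eventually (Filter.eventually_ge_atTop 2)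
  obtain ⟨k, hk, hk1, hk2⟩ := (hcap.and (ha1.and hbig)).exists
  have ha := reg.a_pos k
  have hpow : (reg.a k)⁻¹ ^ p ≤ (reg.a k)⁻¹ := by
    have hinv1 : (1 : ℝ) ≤ (reg.a k)⁻¹ := one_le_inv_iff₀.2 ⟨ha, hk1⟩
    interval_cases p
    · simpa using hinv1
    · simp
  have hL : (reg.L k : ℝ) ≤ (reg.a k)⁻¹ := hk.trans hpow
  have : reg.a k * reg.L k ≤ 1 := by
    calc reg.a k * reg.L k ≤ reg.a k * (reg.a k)⁻¹ := mul_le_mul_of_nonneg_left hL ha.le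
      _ = 1 := mul_inv_cancel₀ ha.ne'
  linarith

/-- **SD⁺ with the cap exponent required `≤ 1` is FALSE** (verbatim body of the restated crux, `∃ p ≤ 1` in the cap;
already the structure fields refute it, no spectral clause is read). [folklore] -/
theorem not_windowExtinction_capLeOne :
    ¬ (open Literature.MathematicalPhysics.QuantumLattice Literature.MathematicalPhysics.QuantumFieldTheory Literature.Probability.LatticeModels in ∀ Nf : ℕ, (Nf = 2 ∨ Nf = 3) → ∃ reg : QCDRegularisation Nf, reg.HasMassScaling ∧ (reg.scheme 0 0 0).HasAsymptoticScaling ∧ (∃ p : ℕ, p ≤ 1 ∧ ∀ᶠ k : ℕ in Filter.atTop, (reg.L k : ℝ) ≤ (reg.a k)⁻¹ ^ p) ∧ (∀ᶠ k : ℕ in Filter.atTop, -1 < reg.mcrit k) ∧ ∃ M₀ : ℝ, 0 ≤ M₀ ∧ ∃ c : ℝ, 0 < c ∧ ∀ m : Fin Nf → ℝ, (∀ f, M₀ < m f) → (∀ ε : ℝ, 0 < ε → ∀ᶠ k : ℕ in Filter.atTop, ∀ S : ℕ, reg.L k ≤ S → (∫ U, ((∑ f : Fin Nf, ((Multiset.countP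 (fun z : ℂ => z.im = 0 ∧ z.re < -(reg.mcrit k + reg.a k * m f / reg.Zm k)) (wilsonDirac (fundamentalRep (Fin 3)) U 0 1).charpoly.roots : ℝ) + (Multiset.countP (fun z : ℂ => |z.re| < c * (reg.a k * m f / reg.Zm k)) (spinorLift gammaFive * wilsonDirac (fundamentalRep (Fin 3)) U (reg.mcrit k + reg.a k * m f / reg.Zm k) 1).charpoly.roots : ℝ)))) * ∏ f : Fin Nf, ‖fermionDet (wilsonDirac (fundamentalRep (Fin 3)) U (reg.mcrit k + reg.a k * m f / reg.Zm k) 1)‖ ∂(wilsonMeasure (d := 4) (L := 2 * S + 1) (fundamentalRep (Fin 3)) (reg.β k))) / (∫ U, ∏ f : Fin Nf, ‖fermionDet (wilsonDirac (fundamentalRep (Fin 3)) U (reg.mcrit k + reg.a k * m f / reg.Zm k) 1)‖ ∂(wilsonMeasure (d := 4) (L := 2 * S + 1) (fundamentalRep (Fin 3)) (reg.β k))) ≤ ε * ((2 * S + 1 : ℝ) / (2 * reg.L k + 1)) ^ 4) ∧ (∃ η : ℝ, 0 < η ∧ ∀ M : ℝ, M₀ < M → ∀ᶠ k : ℕ in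 Filter.atTop, max 1 (η * (reg.a k * (2 * reg.L k + 1 : ℝ)) ^ 2) ≤ Disproof.tightRatio reg m M k)) := by
  intro h
  obtain ⟨reg, -, -, ⟨p, hp, hcap⟩, -⟩ := h 2 (Or.inl rfl)
  exact not_cap_of_le_one reg hp hcap

/-- **Under the cap the scheme torus has between `ω(a_k⁻⁴)` and `O(a_k^{−4p})` sites**: for an SD⁺ witness with cap
exponent `p`, eventually `2 ≤ a_k(2L_k+1)` and `(2L_k+1 : ℝ) ≤ 3 (a_k⁻¹)^p` (using `a_k ≤ 1`). The entropy factor a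
pricing argument must beat is therefore `e^{β_k/b₀}` to `e^{p β_k/b₀}` up to powers of `β_k` (AFBookkeeping).
[folklore] -/
theorem side_bounds_of_cap (reg : QCDRegularisation Nf) {p : ℕ}
    (hcap : ∀ᶠ k : ℕ in Filter.atTop, (reg.L k : ℝ) ≤ (reg.a k)⁻¹ ^ p) :
    ∀ᶠ k : ℕ in Filter.atTop, 2 ≤ reg.a k * (2 * reg.L k + 1 : ℝ) ∧ (2 * reg.L k + 1 : ℝ) ≤ 3 * ((reg.a k)⁻¹) ^ p := by
  have ha1 : ∀ᶠ k : ℕ in Filter.atTop, reg.a k ≤ 1 :=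
    (reg.tendsto_a.eventually (gt_mem_nhds one_pos)).mono fun k hk => hk.le
  have hbig : ∀ᶠ k : ℕ in Filter.atTop, (1 : ℝ) ≤ reg.a k * reg.L k :=
    reg.tendsto_L.eventually (Filter.eventually_ge_atTop 1)
  filter_upwards [hcap, ha1, hbig] with k hk hk1 hk2
  have ha := reg.a_pos k
  have hinv1 : (1 : ℝ) ≤ (reg.a k)⁻¹ ^ p := one_le_pow₀ (one_le_inv_iff₀.2 ⟨ha, hk1⟩)
  constructor
  · nlinarith
  · linarith

/-! ### §11b The index is extinct at and above every sea mass; TIGHT probed above the line is false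

(Landing copy `Theorems/WindowExtinction/Negative/ProbeAboveLine.lean`; here against the landed `extinctRatio` of
`CoercivityCeiling.lean`, the crossing budget `abs_index_le_realModeCount` of `IndexBudget.lean` and the atom lemmas of
`WeylWindow.lean`.) -/

/-- One flavour's sign-defect count is at most the EXTINCT integrand (flavour sum of non-negative counts). -/
theorem signDefects_le_extinctSum' {L : ℕ} [NeZero L] (U : GaugeConfig 4 L SU3) (reg : QCDRegularisation Nf)
    (c : ℝ) (k : ℕ) (m : Fin Nf → ℝ) (f₀ : Fin Nf) :
    (Multiset.countP (fun z : ℂ => z.im = 0 ∧ z.re < -(reg.mcrit k + reg.a k * m f₀ / reg.Zm k)) (wilsonDirac (fundamentalRep (Fin 3)) U 0 1).charpoly.roots : ℝ) ≤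
      ∑ f : Fin Nf, ((Multiset.countP (fun z : ℂ => z.im = 0 ∧ z.re < -(reg.mcrit k + reg.a k * m f / reg.Zm k)) (wilsonDirac (fundamentalRep (Fin 3)) U 0 1).charpoly.roots : ℝ) + (Multiset.countP (fun z : ℂ => |z.re| < c * (reg.a k * m f / reg.Zm k)) (spinorLift gammaFive * wilsonDirac (fundamentalRep (Fin 3)) U (reg.mcrit k + reg.a k * m f / reg.Zm k) 1).charpoly.roots : ℝ)) := by
  have h := Finset.single_le_sum (f := fun f : Fin Nf => ((Multiset.countP (fun z : ℂ => z.im = 0 ∧ z.re < -(reg.mcrit k + reg.a k * m f / reg.Zm k)) (wilsonDirac (fundamentalRep (Fin 3)) U 0 1).charpoly.roots : ℝ) + (Multiset.countP (fun z : ℂ => |z.re| < c * (reg.a k * m f / reg.Zm k)) (spinorLift gammaFive * wilsonDirac (fundamentalRep (Fin 3)) U (reg.mcrit k + reg.a k * m f / reg.Zm k) 1).charpoly.roots : ℝ)))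
    (fun _ _ => add_nonneg (Nat.cast_nonneg _) (Nat.cast_nonneg _)) (Finset.mem_univ f₀)
  have h0 : (0 : ℝ) ≤ (Multiset.countP (fun z : ℂ => |z.re| < c * (reg.a k * m f₀ / reg.Zm k)) (spinorLift gammaFive * wilsonDirac (fundamentalRep (Fin 3)) U (reg.mcrit k + reg.a k * m f₀ / reg.Zm k) 1).charpoly.roots : ℝ) :=
    Nat.cast_nonneg _
  linarith

/-- **Index at or above a sea mass ≤ EXTINCT integrand, pointwise with the phase-quenched weight.** For witness
data `reg`, window constant `c`, step `k`, tuple `m`, a flavour `f₀` and any probe mass `p ≥ m_{f₀}(k)`, on every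
gauge field of the torus `(2S+1)⁴`: `|n₋(Γ₅D_W(U,p,1)) − 6(2S+1)⁴| · W ≤ (Σ_f [sign + coercivity defects]) · W`
(index ≤ real modes `≤ −p ≤ −m_{f₀}(k)` by the crossing budget; the boundary atom `λ = −m_{f₀}(k)` kills `W`).
[folklore] -/
theorem absIndex_mul_weight_le_extinct_mul {S : ℕ} (U : GaugeConfig 4 (2 * S + 1) SU3)
    (reg : QCDRegularisation Nf) (c : ℝ) (k : ℕ) (m : Fin Nf → ℝ) (f₀ : Fin Nf) {p : ℝ}
    (hp : reg.mcrit k + reg.a k * m f₀ / reg.Zm k ≤ p) :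
    |(Multiset.countP (fun z : ℂ => z.re < 0) (spinorLift gammaFive * wilsonDirac (fundamentalRep (Fin 3)) U p 1).charpoly.roots : ℝ) - 6 * (2 * S + 1 : ℝ) ^ 4| * ∏ f : Fin Nf, ‖fermionDet (wilsonDirac (fundamentalRep (Fin 3)) U (reg.mcrit k + reg.a k * m f / reg.Zm k) 1)‖ ≤
      (∑ f : Fin Nf, ((Multiset.countP (fun z : ℂ => z.im = 0 ∧ z.re < -(reg.mcrit k + reg.a k * m f / reg.Zm k)) (wilsonDirac (fundamentalRep (Fin 3)) U 0 1).charpoly.roots : ℝ) + (Multiset.countP (fun z : ℂ => |z.re| < c * (reg.a k * m f / reg.Zm k)) (spinorLift gammaFive * wilsonDirac (fundamentalRep (Fin 3)) U (reg.mcrit k + reg.a k * m f / reg.Zm k) 1).charpoly.roots : ℝ))) * ∏ f : Fin Nf, ‖fermionDet (wilsonDirac (fundamentalRep (Fin 3)) U (reg.mcrit k + reg.a k * m f / reg.Zm k) 1)‖ := by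
  set μ₀ : ℝ := reg.mcrit k + reg.a k * m f₀ / reg.Zm k with hμ₀
  by_cases hdet : fermionDet (wilsonDirac (fundamentalRep (Fin 3)) U μ₀ 1) = 0
  · have hWz : (∏ f : Fin Nf, ‖fermionDet (wilsonDirac (fundamentalRep (Fin 3)) U
        (reg.mcrit k + reg.a k * m f / reg.Zm k) 1)‖) = 0 :=
      Finset.prod_eq_zero (Finset.mem_univ f₀) (by rw [← hμ₀, hdet, norm_zero])
    rw [hWz, mul_zero, mul_zero]
  · refine mul_le_mul_of_nonneg_right ?_ (Finset.prod_nonneg fun f _ => norm_nonneg _)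
    have hatom : Multiset.countP (fun z : ℂ => z = ((-μ₀ : ℝ) : ℂ))
        (wilsonDirac (fundamentalRep (Fin 3)) U 0 1).charpoly.roots = 0 :=
      Multiset.countP_eq_zero.2 fun z hz h => hdet (fermionDet_eq_zero_of_root U _ hz h)
    have hZ := abs_index_le_realModeCount U p
    have hRe : |(Multiset.countP (fun z : ℂ => z.re < 0) (spinorLift gammaFive * wilsonDirac (fundamentalRep (Fin 3)) U p 1).charpoly.roots : ℝ) - 6 * (2 * S + 1 : ℝ) ^ 4| ≤
        (Multiset.countP (fun z : ℂ => z.im = 0 ∧ z.re ≤ -p) (wilsonDirac (fundamentalRep (Fin 3)) U 0 1).charpoly.roots : ℝ) := by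
      exact_mod_cast hZ
    have hmono : (Multiset.countP (fun z : ℂ => z.im = 0 ∧ z.re ≤ -p) (wilsonDirac (fundamentalRep (Fin 3)) U 0 1).charpoly.roots : ℝ) ≤
        (Multiset.countP (fun z : ℂ => z.im = 0 ∧ z.re ≤ -μ₀) (wilsonDirac (fundamentalRep (Fin 3)) U 0 1).charpoly.roots : ℝ) := by
      exact_mod_cast countP_le_countP_of_imp (p := fun z : ℂ => z.im = 0 ∧ z.re ≤ -p)
        (q := fun z : ℂ => z.im = 0 ∧ z.re ≤ -μ₀) _ fun z hz => ⟨hz.1, hz.2.trans (by linarith)⟩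
    have hsplit : (Multiset.countP (fun z : ℂ => z.im = 0 ∧ z.re ≤ -μ₀) (wilsonDirac (fundamentalRep (Fin 3)) U 0 1).charpoly.roots : ℝ) =
        (Multiset.countP (fun z : ℂ => z.im = 0 ∧ z.re < -μ₀) (wilsonDirac (fundamentalRep (Fin 3)) U 0 1).charpoly.roots : ℝ) := by
      rw [countP_realModes_le_eq U, hatom, add_zero]
    have hsum := signDefects_le_extinctSum' U reg c k m f₀
    rw [← hμ₀] at hsum
    linarith

/-- The phase-quenched mean, on the torus of half-side `S` at step `k` of witness data `reg` with weight tuple `m`, of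
`|n₋(Γ₅D_W(U, p, 1)) − 6(2S+1)⁴|` at an ARBITRARY probe mass `p` (the crux's TIGHT⁺ ratio is `S = L_k`,
`p = m_crit(k) − a_kM/Z_k`). -/
noncomputable def indexRatioAt (reg : QCDRegularisation Nf) (k S : ℕ) (m : Fin Nf → ℝ) (p : ℝ) : ℝ :=
  (∫ U, |(Multiset.countP (fun z : ℂ => z.re < 0) (spinorLift gammaFive * wilsonDirac (fundamentalRep (Fin 3)) U p 1).charpoly.roots : ℝ) - 6 * (2 * S + 1 : ℝ) ^ 4| * ∏ f : Fin Nf, ‖fermionDet (wilsonDirac (fundamentalRep (Fin 3)) U (reg.mcrit k + reg.a k * m f / reg.Zm k) 1)‖ ∂(wilsonMeasure (d := 4) (L := 2 * S + 1) (fundamentalRep (Fin 3)) (reg.β k))) / (∫ U, ∏ f : Fin Nf, ‖fermionDet (wilsonDirac (fundamentalRep (Fin 3)) U (reg.mcrit k + reg.a k * m f / reg.Zm k) 1)‖ ∂(wilsonMeasure (d := 4) (L := 2 * S + 1) (fundamentalRep (Fin 3)) (reg.β k)))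

/-- This file's `tightRatio` is `indexRatioAt` at the crux's probe on the scheme torus (definitional). -/
theorem tightRatio_eq_indexRatioAt' (reg : QCDRegularisation Nf) (m : Fin Nf → ℝ) (M : ℝ) (k : ℕ) :
    Disproof.tightRatio reg m M k = indexRatioAt reg k (reg.L k) m (reg.mcrit k - reg.a k * M / reg.Zm k) := rfl

/-- **`E₊|index(p)| ≤ extinctRatio` for every probe `p ≥ m_{f₀}(k)`** (any torus, any step). [folklore] -/
theorem indexRatioAt_le_extinctRatio (reg : QCDRegularisation Nf) (c : ℝ) (k S : ℕ) (m : Fin Nf → ℝ)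
    (f₀ : Fin Nf) {p : ℝ} (hp : reg.mcrit k + reg.a k * m f₀ / reg.Zm k ≤ p) :
    indexRatioAt reg k S m p ≤ extinctRatio reg c k S m := by
  unfold indexRatioAt extinctRatio
  refine div_le_div_of_nonneg_right ?_
    (integral_nonneg fun U => Finset.prod_nonneg fun f _ => norm_nonneg _)
  refine integral_mono_of_nonneg (Filter.Eventually.of_forall fun U => ?_)
    (integrable_extinctIntegrand reg c k m (reg.β k)) (Filter.Eventually.of_forall fun U => ?_)
  · exact mul_nonneg (abs_nonneg _) (Finset.prod_nonneg fun f _ => norm_nonneg _)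
  · exact absIndex_mul_weight_le_extinct_mul U reg c k m f₀ hp

/-- **EXTINCT ⇒ the phase-quenched index is extinct at and above every sea mass, on every torus ≥ the scheme's.**
For witness data EXTINCT at the tuple `m`, every flavour `f₀` and `ε > 0`: eventually in `k`, for every `S ≥ L_k`
and every probe `p ≥ m_crit(k) + a_k m_{f₀}/Z_k`, `E₊|n₋(Γ₅D_W(U,p,1)) − 6(2S+1)⁴| ≤ ε((2S+1)/(2L_k+1))⁴`. [folklore] -/
theorem extinct_eventually_indexRatioAt_le (reg : QCDRegularisation Nf) {c : ℝ} {m : Fin Nf → ℝ}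
    (hE : Extinct Nf reg c m) (f₀ : Fin Nf) {ε : ℝ} (hε : 0 < ε) :
    ∀ᶠ k : ℕ in Filter.atTop, ∀ S : ℕ, reg.L k ≤ S → ∀ p : ℝ, reg.mcrit k + reg.a k * m f₀ / reg.Zm k ≤ p →
      indexRatioAt reg k S m p ≤ ε * ((2 * S + 1 : ℝ) / (2 * reg.L k + 1)) ^ 4 := by
  filter_upwards [(extinct_iff_extinctRatio reg c m).1 hE ε hε] with k hk S hS p hp
  exact (indexRatioAt_le_extinctRatio reg c k S m f₀ hp).trans (hk S hS)

/-- Scheme-torus form: eventually `E₊|index(p)| ≤ ε` for every `p ≥ m_{f₀}(k)` on `(2L_k+1)⁴`. [folklore] -/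
theorem extinct_eventually_indexRatioAt_le_scheme (reg : QCDRegularisation Nf) {c : ℝ} {m : Fin Nf → ℝ}
    (hE : Extinct Nf reg c m) (f₀ : Fin Nf) {ε : ℝ} (hε : 0 < ε) :
    ∀ᶠ k : ℕ in Filter.atTop, ∀ p : ℝ, reg.mcrit k + reg.a k * m f₀ / reg.Zm k ≤ p →
      indexRatioAt reg k (reg.L k) m p ≤ ε := by
  filter_upwards [extinct_eventually_indexRatioAt_le reg hE f₀ hε] with k hk p hp
  have h := hk (reg.L k) le_rfl p hp
  have hone : ((2 * (reg.L k : ℕ) + 1 : ℝ) / (2 * reg.L k + 1)) = 1 := div_self (by positivity)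
  rw [hone, one_pow, mul_one] at h
  exact h

/-- TIGHT with the probe MIRRORED above the line (floor `1` at `m_crit(k) + a_kM/Z_k`; any floor `≥ 1` implies it). -/
def TightAbove (Nf : ℕ) (reg : QCDRegularisation Nf) (M₀ : ℝ) (m : Fin Nf → ℝ) : Prop :=
  ∀ M : ℝ, M₀ < M → ∀ᶠ k : ℕ in Filter.atTop, 1 ≤ indexRatioAt reg k (reg.L k) m (reg.mcrit k + reg.a k * M / reg.Zm k)

/-- **EXTINCT ∧ TIGHT-above is unsatisfiable** (every `reg`, `M₀`, `c`; `N_f ≥ 1`): at `m ≡ M₀+1`, `M = M₀+1` the probe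
IS the sea mass, where `E₊|index| ≤ 1/2` eventually. [folklore] -/
theorem not_extinct_and_tightAbove (hNf : 0 < Nf) (reg : QCDRegularisation Nf) {M₀ : ℝ} (c : ℝ) :
    ¬ ∀ m : Fin Nf → ℝ, (∀ f, M₀ < m f) → Extinct Nf reg c m ∧ TightAbove Nf reg M₀ m := by
  intro h
  obtain ⟨hE, hT⟩ := h (fun _ => M₀ + 1) fun _ => by linarith
  have hT' := hT (M₀ + 1) (by linarith)
  have hE' := extinct_eventually_indexRatioAt_le_scheme reg hE ⟨0, hNf⟩ (ε := 1 / 2) (by norm_num)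
  obtain ⟨k, hTk, hEk⟩ := (hT'.and hE').exists
  have := hEk (reg.mcrit k + reg.a k * (M₀ + 1) / reg.Zm k) le_rfl
  linarith

/-- **The crux with its probe mirrored above the line is FALSE** (verbatim SD⁺ body — mass scaling, asymptotic scaling,
cap, branch, EXTINCT, extensive floor — with the TIGHT⁺ integrand at `m_crit(k) + a_kM/Z_k`). [folklore] -/
theorem not_windowExtinction_probeAbove :
    ¬ ∀ Nf : ℕ, (Nf = 2 ∨ Nf = 3) → ∃ reg : QCDRegularisation Nf, reg.HasMassScaling ∧ (reg.scheme 0 0 0).HasAsymptoticScaling ∧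
      (∃ p : ℕ, ∀ᶠ k : ℕ in Filter.atTop, (reg.L k : ℝ) ≤ (reg.a k)⁻¹ ^ p) ∧ (∀ᶠ k : ℕ in Filter.atTop, -1 < reg.mcrit k) ∧
        ∃ M₀ : ℝ, 0 ≤ M₀ ∧ ∃ c : ℝ, 0 < c ∧ ∀ m : Fin Nf → ℝ, (∀ f, M₀ < m f) → Extinct Nf reg c m ∧
          ∃ η : ℝ, 0 < η ∧ ∀ M : ℝ, M₀ < M → ∀ᶠ k : ℕ in Filter.atTop,
            max 1 (η * (reg.a k * (2 * reg.L k + 1 : ℝ)) ^ 2) ≤ indexRatioAt reg k (reg.L k) m (reg.mcrit k + reg.a k * M / reg.Zm k) := by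
  intro h
  obtain ⟨reg, -, -, -, -, M₀, -, c, -, hm⟩ := h 2 (Or.inl rfl)
  refine not_extinct_and_tightAbove (Nf := 2) two_pos reg c fun m hmM => ⟨(hm m hmM).1, fun M hM => ?_⟩
  obtain ⟨η, -, hT⟩ := (hm m hmM).2
  exact (hT M hM).mono fun k hk => le_trans (le_max_left _ _) hk

/-- **THE INDEX JUMP of an SD⁺ witness** (stated for the crux itself; the `SDPlusHyp` form is in the landing copy once
the currency module `WithoutTightPlusCollapse` is built on the farm). For `N_f ∈ {2,3}` the crux hands `reg`, `M₀ ≥ 0`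
such that for every tuple `m` above `M₀` there is `η > 0` with: for every flavour `f₀`, probe parameter `M > M₀` and
`ε > 0`, eventually in `k`, on the scheme torus, `E₊|index(p)| ≤ ε` for EVERY `p ≥ m_crit(k) + a_k m_{f₀}/Z_k` while
`E₊|index(m_crit(k) − a_kM/Z_k)| ≥ max 1 (η (a_k(2L_k+1))²)` — `≳ η√V_phys` levels of `H_W` cross, net, inside the
window of bare width `a_k(m_{f₀}+M)/Z_k → 0` at the line, and nothing net crosses above it. [folklore] -/
theorem index_jump_of_windowExtinction
    (h : Summit.QuantumFields.QCD.Theses.SpectralDefectExtinction.WindowExtinction) {Nf : ℕ} (hNf : Nf = 2 ∨ Nf = 3) :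
    ∃ reg : QCDRegularisation Nf, ∃ M₀ : ℝ, 0 ≤ M₀ ∧ ∀ m : Fin Nf → ℝ, (∀ f, M₀ < m f) →
      ∃ η : ℝ, 0 < η ∧ ∀ f₀ : Fin Nf, ∀ M : ℝ, M₀ < M → ∀ ε : ℝ, 0 < ε → ∀ᶠ k : ℕ in Filter.atTop,
        (∀ p : ℝ, reg.mcrit k + reg.a k * m f₀ / reg.Zm k ≤ p → indexRatioAt reg k (reg.L k) m p ≤ ε) ∧
          max 1 (η * (reg.a k * (2 * reg.L k + 1 : ℝ)) ^ 2) ≤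
            indexRatioAt reg k (reg.L k) m (reg.mcrit k - reg.a k * M / reg.Zm k) := by
  rw [windowExtinction_iff_tightRatio] at h
  obtain ⟨reg, -, -, -, -, M₀, hM₀, c, -, h⟩ := h Nf hNf
  refine ⟨reg, M₀, hM₀, fun m hm => ?_⟩
  obtain ⟨hE, η, hη, hT⟩ := h m hm
  refine ⟨η, hη, fun f₀ M hM ε hε => ?_⟩
  filter_upwards [extinct_eventually_indexRatioAt_le_scheme reg hE f₀ hε, hT M hM] with k hEk hTk
  exact ⟨hEk, hTk⟩

/-! ### §11c Near-miss: the capped tip family and a Haar small-ball programme (deterministic half proved) -/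

/-- **A real mode of the massless Wilson operator below `δ` is a `δ`-flat covariant section.** If `z` is a real
characteristic root of `D_W(U,0,1)` with `Re z ≤ δ` (any gauge field, any unitary colour representation), it has an
eigenvector `v ≠ 0` with `Re (v† D_W(U,0,1) v) ≤ δ Σ‖v‖²`; and `Re (v† D_W(U,0,1) v) = ½ Σ_{x,μ} ‖ρ(U(x,μ)) v(x+μ̂) − v(x)‖²`
(Wilson positivity, landed in the Kato / chessboard modules), so `v` is covariantly `δ`-FLAT. The index carriers TIGHT⁺
needs at a probe `p ∈ [−δ, 0]` are such modes (`abs_index_le_realModeCount`). [folklore] -/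
theorem realMode_flat_section {L N : ℕ} [NeZero L] {G : Type*} [Group G] (ρ : G →* Matrix (Fin N) (Fin N) ℂ)
    (U : GaugeConfig 4 L G) {z : ℂ} (hz : z ∈ (wilsonDirac ρ U 0 1).charpoly.roots) {δ : ℝ} (hδ : z.re ≤ δ) :
    ∃ v : TorusSite 4 L × Fin N × Fin 4 → ℂ, v ≠ 0 ∧ (wilsonDirac ρ U 0 1) *ᵥ v = z • v ∧
      (star v ⬝ᵥ ((wilsonDirac ρ U 0 1) *ᵥ v)).re ≤ δ * ∑ i, ‖v i‖ ^ 2 := by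
  obtain ⟨v, hv, hDv⟩ := exists_eigenvector_of_mem_roots_charpoly _ hz
  refine ⟨v, hv, hDv, ?_⟩
  rw [hDv, dotProduct_smul, star_dotProduct_self_eq, smul_eq_mul, Complex.mul_re, Complex.ofReal_re,
    Complex.ofReal_im, mul_zero, sub_zero]
  exact mul_le_mul_of_nonneg_right hδ (Finset.sum_nonneg fun i _ => by positivity)

/-- **NEAR-MISS PROGRAMME (recorded reasoning; the probabilistic half is NOT proved).** Target: the CAPPED TIP FAMILY —
admissible `reg` with `0 ≤ m_crit(k)` frequently (more generally `−m_crit(k) ≤ δ_k − a_kM/Z_k` with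
`log(1/δ_k) ≍ β_k`) — fails TIGHT⁺, indeed TIGHT. By `abs_index_le_realModeCount` and `realMode_flat_section`, TIGHT at
probe `p = m_crit(k) − a_kM/Z_k ∈ [−δ_k, 0]` needs `E₊[#{δ_k-flat real modes}] ≥ 1` on `≤ (3a_k^{−p})⁴` sites
(`side_bounds_of_cap`), i.e. a per-site phase-quenched rate `≥ a_k^{4p}/81` of an event FLAT(`δ_k`). Proposed bound,
ELEMENTARY in the sense that the Boltzmann factor is never used: (1) IMS / flat-cube dichotomy (landed p104629): a
`δ`-flat unit section on the torus yields a cube `Q` of side `R ≍ δ^{−1/2}` and a unit section `δ' ≍ δ`-flat on `Q` with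
mass not concentrated at `∂Q`; (2) DLR: `P_β(FLAT_Q | exterior) ≤ Haar(FLAT_Q) / Z_Q(exterior)` with
`Z_Q(exterior) ≥ Haar(B_{β^{−1/2}}(1)^{links(Q)}) · e^{−O(R⁴) − 4.5 β |∂-plaquettes|} ≥ e^{−16R⁴ log β − O(R⁴) − O(βR³)}`
UNIFORMLY in the exterior (interior plaquettes `O(1/β)` each on the small ball, boundary plaquettes `≤ 4.5` each);
(3) HAAR CODIMENSION (the missing law): `Haar^{⊗ links(Q)}(FLAT_Q(δ')) ≤ e^{−(15/2 − o(1)) R⁴ log(1/δ') + O(R⁴)}` — in an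
axial gauge on a spanning tree the `3R⁴` loop variables are i.i.d. Haar on `SU(3)` and each must lie within `≍ √δ'·poly(R)`
of the stabiliser `SU(2)` of the transported section (codimension `5`), up to the `|v|²`-weighting of the flatness budget
(the delicate point: `v` may be small on part of `Q`; box Poincaré on `|v|` via Kato's inequality controls it);
(4) `|det|`-reweighting (where the crude programme currently FAILS): `E₊[X] = E[XW]/E[W]`, `W = ∏_f |det D_W(U, m_f(k), 1)|`;
in the DLR step the interior integrals carry `W`, and for two interior fillings `U, U'` with the same exterior
`W(U)/W(U') = ∏_f |det(1 + D_W(U', m_f(k))⁻¹ Δ)|^{±1} ≤ (1 + 8 Z_k/(a_k m_f))^{N_f · rank Δ}`, `rank Δ ≤ 24R⁴`, using only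
`σ_min(D_W(U', m_f(k), 1)) ≥ m_f(k) ≥ a_k m_f/Z_k` on the tip family (`m_crit ≥ 0`). With `log(Z_k/(a_k m_f)) ≈ log(1/δ_k)
≈ log a_k⁻¹ ≈ β_k/(4b₀)` the determinant slack is `e^{48 N_f R⁴ log a⁻¹}` against the Haar gain `e^{−7.5 R⁴ log a⁻¹}`: the
rank bound loses by a factor `≈ 6 N_f` in the exponent. So even this programme needs ONE non-trivial input — a
`|det|`-ratio bound for flat-versus-refilled cubes far better than the rank bound (a quasi-locality statement for
`log|det D_W(m)|` at `m ≥ a m_f/Z`, cf. the landed determinant quasi-locality p84058 and the hopping-locality barriers), or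
the Boltzmann factor after all (Bałaban class). Verdict: near-miss; and the honest line (`−m_crit ≍ 0.87/β`, `δ ≍ g₀²`,
flatness typical) is untouched by all of this, so it can never become a refutation of the crux — only a certificate
that the capped tip family is not a witness. -/
theorem nearTip_smallBall_programme : True := trivial



/-! ### §11d TIGHT⁺ is one-sided: the deficit tail alone carries half the floor

(Landing copy `Theorems/WindowExtinction/Negative/OneSidedTight.lean`, p138357; uses the landed time-reflection
antisymmetry `TipPricing/Negative/ReflectionSignedTight.signedIndex_integral_nonpos`.) READING: the modulus in TIGHT⁺
hides no cancellation budget — up to a factor `2` the clause is the ONE-SIDED anti-concentration statement "the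
phase-quenched mean DEFICIT `(6N⁴ − n₋)⁺` of negative levels of `H_W` just below the line is `≳ η√V_phys`"; a prover may aim
at a single tail, a refuter at bounding ONE tail by `o((a_k L_k)²)`. -/

section OneSided

/-- `|q| = q + 2·max 0 (−q)` on `ℝ`. -/
theorem abs_eq_self_add_two_mul_negPart (q : ℝ) : |q| = q + 2 * max 0 (-q) := by
  rcases le_or_gt 0 q with h | h
  · rw [abs_of_nonneg h, max_eq_left (by linarith)]; ring
  · rw [abs_of_neg h, max_eq_right (by linarith)]; ring

/-- **`∫ |index|·W ≤ 2 ∫ (deficit)·W` on every torus.** For every torus side `S`, coupling `β`, probe mass `m'` and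
weight tuple `mq`: the phase-quenched (un-normalised) mean of `|n₋(Γ₅D_W(U,m',1)) − 6S⁴|` is at most twice that of the
DEFICIT `max 0 (6S⁴ − n₋(Γ₅D_W(U,m',1)))` — `|q| = q + 2q⁻` and the signed mean is `≤ 0` by time reflection. -/
theorem absIndex_integral_le_two_mul_deficit_integral (S : ℕ) [NeZero S] (β m' : ℝ) (mq : Fin Nf → ℝ) :
    ∫ U, |(Multiset.countP (fun z : ℂ => z.re < 0) (spinorLift gammaFive * wilsonDirac (fundamentalRep (Fin 3)) U m' 1).charpoly.roots : ℝ) - 6 * (S : ℝ) ^ 4| *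
        ∏ f : Fin Nf, ‖fermionDet (wilsonDirac (fundamentalRep (Fin 3)) U (mq f) 1)‖
      ∂(wilsonMeasure (d := 4) (L := S) (fundamentalRep (Fin 3)) β) ≤
    2 * ∫ U, max 0 (6 * (S : ℝ) ^ 4 - (Multiset.countP (fun z : ℂ => z.re < 0) (spinorLift gammaFive * wilsonDirac (fundamentalRep (Fin 3)) U m' 1).charpoly.roots : ℝ)) *
        ∏ f : Fin Nf, ‖fermionDet (wilsonDirac (fundamentalRep (Fin 3)) U (mq f) 1)‖
      ∂(wilsonMeasure (d := 4) (L := S) (fundamentalRep (Fin 3)) β) := by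
  set μ := wilsonMeasure (d := 4) (L := S) (fundamentalRep (Fin 3)) β with hμ
  -- the three integrands
  set q : GaugeConfig 4 S (Matrix.specialUnitaryGroup (Fin 3) ℂ) → ℝ := fun U =>
    (Multiset.countP (fun z : ℂ => z.re < 0) (spinorLift gammaFive * wilsonDirac (fundamentalRep (Fin 3)) U m' 1).charpoly.roots : ℝ) - 6 * (S : ℝ) ^ 4 with hq
  set W : GaugeConfig 4 S (Matrix.specialUnitaryGroup (Fin 3) ℂ) → ℝ := fun U =>
    ∏ f : Fin Nf, ‖fermionDet (wilsonDirac (fundamentalRep (Fin 3)) U (mq f) 1)‖ with hW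
  have hmeas_q : Measurable q :=
    (measurable_from_nat.comp (measurable_negCount (L := S) m')).sub measurable_const
  have hbound : ∀ U, |q U| ≤ 6 * (S : ℝ) ^ 4 := by
    intro U
    have hle : (Multiset.countP (fun z : ℂ => z.re < 0) (spinorLift gammaFive * wilsonDirac (fundamentalRep (Fin 3)) U m' 1).charpoly.roots : ℝ) ≤ 12 * (S : ℝ) ^ 4 := by
      have := countP_roots_charpoly_le_card (spinorLift gammaFive * wilsonDirac (fundamentalRep (Fin 3)) U m' 1)
        (fun z : ℂ => z.re < 0)
      rw [card_quarkIdx] at this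
      exact_mod_cast this
    have h0 : (0 : ℝ) ≤ (Multiset.countP (fun z : ℂ => z.re < 0) (spinorLift gammaFive * wilsonDirac (fundamentalRep (Fin 3)) U m' 1).charpoly.roots : ℝ) :=
      Nat.cast_nonneg _
    rw [hq, abs_le]
    constructor <;> simp only <;> linarith
  have hint_q : Integrable (fun U => q U * W U) μ :=
    integrable_mul_weight mq β hmeas_q hbound
  have hint_neg : Integrable (fun U => max 0 (-q U) * W U) μ := by
    refine integrable_mul_weight mq β (measurable_const.max hmeas_q.neg) (C := 6 * (S : ℝ) ^ 4) fun U => ?_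
    have := hbound U
    rw [abs_le] at this ⊢
    constructor
    · linarith [le_max_left 0 (-q U)]
    · rcases le_or_gt 0 (-q U) with h | h
      · rw [max_eq_right h]; linarith
      · rw [max_eq_left h.le]; positivity
  -- `|q| W = q W + 2 (q⁻ W)` pointwise
  have hsplit : ∀ U, |q U| * W U = q U * W U + 2 * (max 0 (-q U) * W U) := by
    intro U; rw [abs_eq_self_add_two_mul_negPart]; ring
  have hsigned : ∫ U, q U * W U ∂μ ≤ 0 := Summit.QuantumFields.QCD.Theorems.TipPricing.Negative.signedIndex_integral_nonpos (Nf := Nf) S β m' mq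
  have hdef : ∀ U, max 0 (6 * (S : ℝ) ^ 4 - (Multiset.countP (fun z : ℂ => z.re < 0) (spinorLift gammaFive * wilsonDirac (fundamentalRep (Fin 3)) U m' 1).charpoly.roots : ℝ)) = max 0 (-q U) := by
    intro U; rw [hq]; ring_nf
  calc ∫ U, |q U| * W U ∂μ = ∫ U, (q U * W U + 2 * (max 0 (-q U) * W U)) ∂μ := integral_congr_ae (ae_of_all _ hsplit)
    _ = ∫ U, q U * W U ∂μ + 2 * ∫ U, max 0 (-q U) * W U ∂μ := by
        rw [integral_add hint_q (hint_neg.const_mul 2), integral_const_mul]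
    _ ≤ 2 * ∫ U, max 0 (-q U) * W U ∂μ := by linarith
    _ = _ := by
        congr 1
        refine integral_congr_ae (ae_of_all _ fun U => ?_)
        beta_reduce
        rw [hdef U]

/-- **The TIGHT⁺ ratio is at most twice the deficit ratio** (scheme torus `(2L_k+1)⁴`, any witness data, probe `M`, tuple
`m`, step `k`). -/
theorem tightRatio_le_two_mul_deficitRatio (reg : QCDRegularisation Nf) (m : Fin Nf → ℝ) (M : ℝ) (k : ℕ) :
    (∫ U, (|(Multiset.countP (fun z : ℂ => z.re < 0) (spinorLift gammaFive * wilsonDirac (fundamentalRep (Fin 3)) U (reg.mcrit k - reg.a k * M / reg.Zm k) 1).charpoly.roots : ℝ) - 6 * (2 * reg.L k + 1 : ℝ) ^ 4|) * ∏ f : Fin Nf, ‖fermionDet (wilsonDirac (fundamentalRep (Fin 3)) U (reg.mcrit k + reg.a k * m f / reg.Zm k) 1)‖ ∂(wilsonMeasure (d := 4) (L := 2 * reg.L k + 1) (fundamentalRep (Fin 3)) (reg.β k))) / (∫ U, ∏ f : Fin Nf, ‖fermionDet (wilsonDirac (fundamentalRep (Fin 3)) U (reg.mcrit k + reg.a k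 * m f / reg.Zm k) 1)‖ ∂(wilsonMeasure (d := 4) (L := 2 * reg.L k + 1) (fundamentalRep (Fin 3)) (reg.β k))) ≤
    2 * ((∫ U, max 0 (6 * (2 * reg.L k + 1 : ℝ) ^ 4 - (Multiset.countP (fun z : ℂ => z.re < 0) (spinorLift gammaFive * wilsonDirac (fundamentalRep (Fin 3)) U (reg.mcrit k - reg.a k * M / reg.Zm k) 1).charpoly.roots : ℝ)) * ∏ f : Fin Nf, ‖fermionDet (wilsonDirac (fundamentalRep (Fin 3)) U (reg.mcrit k + reg.a k * m f / reg.Zm k) 1)‖ ∂(wilsonMeasure (d := 4) (L := 2 * reg.L k + 1) (fundamentalRep (Fin 3)) (reg.β k))) / (∫ U, ∏ f : Fin Nf, ‖fermionDet (wilsonDirac (fundamentalRep (Fin 3)) U (reg.mcrit k + reg.a k * m f / reg.Zm k) 1)‖ ∂(wilsonMeasure (d := 4) (L := 2 * reg.L k + 1) (fundamentalRep (Fin 3)) (reg.β k)))) := by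
  have h := absIndex_integral_le_two_mul_deficit_integral (Nf := Nf) (2 * reg.L k + 1) (reg.β k)
    (reg.mcrit k - reg.a k * M / reg.Zm k) (fun f => reg.mcrit k + reg.a k * m f / reg.Zm k)
  have hcast : ((2 * reg.L k + 1 : ℕ) : ℝ) = 2 * reg.L k + 1 := by push_cast; ring
  rw [hcast] at h
  have hden : 0 ≤ ∫ U, ∏ f : Fin Nf, ‖fermionDet (wilsonDirac (fundamentalRep (Fin 3)) U
      (reg.mcrit k + reg.a k * m f / reg.Zm k) 1)‖
        ∂(wilsonMeasure (d := 4) (L := 2 * reg.L k + 1) (fundamentalRep (Fin 3)) (reg.β k)) :=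
    integral_nonneg fun _ => Finset.prod_nonneg fun _ _ => norm_nonneg _
  rw [mul_div_assoc']
  exact div_le_div_of_nonneg_right h hden

/-- **TIGHT⁺ ⇒ the DEFICIT TAIL alone is extensive.** For witness data `(reg, M₀)` and a tuple `m` satisfying the TIGHT⁺
clause of SD⁺ (verbatim, as a hypothesis): for every `M > M₀`, eventually in `k`,
`max 1 (η (a_k(2L_k+1))²) / 2 ≤ E₊[ max 0 (6(2L_k+1)⁴ − n₋(Γ₅D_W(U, m_crit(k) − a_kM/Z_k, 1))) ]` on the scheme torus. -/
theorem eventually_half_floor_le_deficitRatio (reg : QCDRegularisation Nf) {M₀ : ℝ} (m : Fin Nf → ℝ) {η : ℝ}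
    (hT : ∀ M : ℝ, M₀ < M → ∀ᶠ k : ℕ in Filter.atTop, max 1 (η * (reg.a k * (2 * reg.L k + 1 : ℝ)) ^ 2) ≤ (∫ U, (|(Multiset.countP (fun z : ℂ => z.re < 0) (spinorLift gammaFive * wilsonDirac (fundamentalRep (Fin 3)) U (reg.mcrit k - reg.a k * M / reg.Zm k) 1).charpoly.roots : ℝ) - 6 * (2 * reg.L k + 1 : ℝ) ^ 4|) * ∏ f : Fin Nf, ‖fermionDet (wilsonDirac (fundamentalRep (Fin 3)) U (reg.mcrit k + reg.a k * m f / reg.Zm k) 1)‖ ∂(wilsonMeasure (d := 4) (L := 2 * reg.L k + 1) (fundamentalRep (Fin 3)) (reg.β k))) / (∫ U, ∏ f : Fin Nf, ‖fermionDet (wilsonDirac (fundamentalRep (Fin 3)) U (reg.mcrit k + reg.a k * m f / reg.Zm k) 1)‖ ∂(wilsonMeasure (d := 4) (L := 2 * reg.L k + 1) (fundamentalRep (Fin 3)) (reg.β k))))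
    {M : ℝ} (hM : M₀ < M) :
    ∀ᶠ k : ℕ in Filter.atTop, max 1 (η * (reg.a k * (2 * reg.L k + 1 : ℝ)) ^ 2) / 2 ≤
      (∫ U, max 0 (6 * (2 * reg.L k + 1 : ℝ) ^ 4 - (Multiset.countP (fun z : ℂ => z.re < 0) (spinorLift gammaFive * wilsonDirac (fundamentalRep (Fin 3)) U (reg.mcrit k - reg.a k * M / reg.Zm k) 1).charpoly.roots : ℝ)) * ∏ f : Fin Nf, ‖fermionDet (wilsonDirac (fundamentalRep (Fin 3)) U (reg.mcrit k + reg.a k * m f / reg.Zm k) 1)‖ ∂(wilsonMeasure (d := 4) (L := 2 * reg.L k + 1) (fundamentalRep (Fin 3)) (reg.β k))) / (∫ U, ∏ f : Fin Nf, ‖fermionDet (wilsonDirac (fundamentalRep (Fin 3)) U (reg.mcrit k + reg.a k * m f / reg.Zm k) 1)‖ ∂(wilsonMeasure (d := 4) (L := 2 * reg.L k + 1) (fundamentalRep (Fin 3)) (reg.β k))) := by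
  filter_upwards [hT M hM] with k hk
  have h2 := tightRatio_le_two_mul_deficitRatio reg m M k
  linarith

/-- **Crux-level reading.** `WindowExtinction` (SD⁺) hands, at `N_f ∈ {2,3}`, a regularisation `reg` and `M₀ ≥ 0` such that
for every tuple `m` above `M₀` some `η > 0` has: for every `M > M₀`, eventually in `k`, the phase-quenched mean DEFICIT of
negative levels of `Γ₅D_W` at the probe `m_crit(k) − a_kM/Z_k` is at least `max 1 (η (a_k(2L_k+1))²) / 2`. -/
theorem deficit_of_windowExtinction (h : Summit.QuantumFields.QCD.Theses.SpectralDefectExtinction.WindowExtinction) {Nf : ℕ} (hNf : Nf = 2 ∨ Nf = 3) :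
    ∃ reg : QCDRegularisation Nf, ∃ M₀ : ℝ, 0 ≤ M₀ ∧ ∀ m : Fin Nf → ℝ, (∀ f, M₀ < m f) → ∃ η : ℝ, 0 < η ∧
      ∀ M : ℝ, M₀ < M → ∀ᶠ k : ℕ in Filter.atTop, max 1 (η * (reg.a k * (2 * reg.L k + 1 : ℝ)) ^ 2) / 2 ≤
        (∫ U, max 0 (6 * (2 * reg.L k + 1 : ℝ) ^ 4 - (Multiset.countP (fun z : ℂ => z.re < 0) (spinorLift gammaFive * wilsonDirac (fundamentalRep (Fin 3)) U (reg.mcrit k - reg.a k * M / reg.Zm k) 1).charpoly.roots : ℝ)) * ∏ f : Fin Nf, ‖fermionDet (wilsonDirac (fundamentalRep (Fin 3)) U (reg.mcrit k + reg.a k * m f / reg.Zm k) 1)‖ ∂(wilsonMeasure (d := 4) (L := 2 * reg.L k + 1) (fundamentalRep (Fin 3)) (reg.β k))) / (∫ U, ∏ f : Fin Nf, ‖fermionDet (wilsonDirac (fundamentalRep (Fin 3)) U (reg.mcrit k + reg.a k * m f / reg.Zm k) 1)‖ ∂(wilsonMeasure (d := 4) (L := 2 * reg.L k + 1) (fundamentalRep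 (Fin 3)) (reg.β k))) := by
  obtain ⟨reg, -, -, -, -, M₀, hM₀, c, -, h⟩ := h Nf hNf
  refine ⟨reg, M₀, hM₀, fun m hm => ?_⟩
  obtain ⟨-, η, hη, hT⟩ := h m hm
  exact ⟨η, hη, fun M hM => eventually_half_floor_le_deficitRatio reg m hT hM⟩

end OneSided

/-- **Literature, cycle 3 (page-cited; informs, proves nothing).** Kill criterion (iii) of the route ("E|Q|/√(χ_t V) far
below the Gaussian √(2/π), or χ_t under |det| weights vanishing faster than m") checked against Bruno–Schaefer–Sommer
(ALPHA/CLS), *Topological susceptibility and the sampling of field space in N_f = 2 lattice QCD simulations*, JHEP 08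
(2014) 150 [arXiv:1406.5363]: §3.3 (p. 6 of the arXiv text) "In the large volume limit, the topological charge is
expected to follow a Gaussian distribution, with the width given by the topological susceptibility … The agreement with a
Gaussian distribution is very reasonable, with only small deviations visible in the tails at a = 0.048 fm"; §3.4 (p. 7):
LO χPT `χ = (m/2) Σ (1 + O(m))` (Leutwyler–Smilga), data compatible in the continuum limit, and AT FINITE LATTICE SPACING
the susceptibility is ENHANCED (`t₁² χ = c t₁ m_π² + a² b/t₁`, `b = 5.1(7)·10⁻³ > 0`: "because of the breaking of chiral
symmetry, at finite lattice spacing there is no reason for the susceptibility to vanish at vanishing pion mass"). READING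
FOR TIGHT⁺: for the honest N_f = 2 Wilson trajectory at any fixed renormalised m > M₀ > 0 the index is Gaussian at scale
√(χ_t V) with χ_t > 0 bounded below uniformly in a — kill (iii) does NOT fire; the floor `η (a_k(2L_k+1))²` with
`η ≈ √(2χ_t(m)/π)` is the expected value, cut-off effects only help. Caveats: their Q is the gradient-flow / GW index on
O(a)-improved ensembles, not `n₋(H_W) − 6N⁴` just below m_c of unimproved Wilson quarks under the phase-quenched weight;
N_f = 3 not covered. Searches this session: local searchd reset (rc 1), OpenAlex 429 (daily budget), arXiv API 1 irrelevant
row — search-degraded; the paper was fetched by `lit read arxiv:1406.5363` and read at page level. [folklore] -/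
theorem literature_notes_cycle3 : True := trivial

end SDPlus





end

end Summit.QuantumFields.QCD.Cruxes.WindowExtinction.Disproof
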